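import Mathlib.Analysis.SpecialFunctions.Pow.Deriv
import Mathlib.Analysis.SpecialFunctions.ExpDeriv
import Mathlib.Analysis.Convex.Deriv
import Mathlib.Analysis.Convex.SpecificFunctions.Basic
import HarnessLib

/-!
# Isothermal equations of state of solids (Murnaghan, Birch–Murnaghan, Vinet) and the enthalpy rule

The `P`-axis of a computed phase diagram rests on a handful of exact identities relating a
zero-temperature energy–volume curve `E(V)` of a crystal phase to its pressure, bulk modulus and
relative stability:

* `P = -dE/dV`, `K = -V dP/dV` (isothermal bulk modulus), [cite: Poirier1991, §4.3.2 eq. (4.30), §4.4 eq. (4.46)],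
  [cite: Kaxiras2003, §5.6.1 eqs. (5.87)–(5.88)];
* the three closed-form parametrisations used to fit computed or measured `E(V)` / `P(V)` data:
  Murnaghan's integrated linear law [cite: Poirier1991, §4.2 eqs. (4.4)–(4.8)] (original
  [cite: Murnaghan1944]), the third-order Birch–Murnaghan Eulerian finite-strain form
  [cite: Poirier1991, §4.3 eqs. (4.27)–(4.42)], [cite: CohenGulserenHemley2000, eqs. (1)–(2)]
  (original [cite: Birch1947]), and the Vinet ("universal") form
  [cite: CohenGulserenHemley2000, eqs. (4)–(5)] (original [cite: VinetEtAl1987]);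
* at `T = 0` the stable phase at pressure `P` minimises the enthalpy `H = E + PV`; for convex
  `E(V)` the minimiser is the tangent point `E'(V*) = -P`, and two phases exchange stability at the
  pressure given by the common tangent to their `E(V)` curves (Maxwell construction)
  [cite: Kaxiras2003, §5.6.1 (discussion of Fig. 5.6)].

Everything in this file is PROVED (definitions + theorems); there are no named facts.
For each parametrisation we define the printed `P(V)` and `E(V)` forms and prove: `E(V₀) = E₀`,
`P(V₀) = 0`, `P = -dE/dV` (as a `HasDerivAt` statement on `V > 0`), the closed form of
`K(V) = -V P'(V)` and `K(V₀) = B₀`.  For Murnaghan the defining property `K = B₀ + B₀' P` is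
proved exactly, together with its closed-form inverse `V(P) = V₀ (1 + B₀' P/B₀)^{-1/B₀'}`
[cite: Poirier1991, §4.2 eq. (4.7)] (`P(V(P)) = P`, `V(P(V)) = V`), and its monotonicity on the physical
domain (antitone in `P`, monotone in `B₀` and in `B₀'`), whence the exact CORNER RULE
`murnaghanVolume_mem_Icc_of_box` that turns a parameter box `[B₀] × [B₀'] × [P]` into a volume
interval.  The Vinet law has no closed-form inverse: writing `P = 3 B₀ g_η(x)` with the
shape `g_η(x) = (1 - x) x⁻² e^{η(1-x)}` (`x = (V/V₀)^{1/3}`, `η = (3/2)(B₀' - 1)`), we prove that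
`g_η` is strictly decreasing on `0 < x ≤ 1` for `B₀' ≥ 1`, construct the root `vinetVolume`
(`P(V(P)) = P`, `V(P(V)) = V` on `0 < V ≤ V₀`, uniqueness) and prove the same monotonicity
package and CORNER RULE `vinetVolume_mem_Icc_of_box`.  Likewise for the third-order
Birch–Murnaghan law in the compression variable `q = (V₀/V)^{1/3}`: for `B₀' ≥ 4` the pressure is
strictly decreasing on `0 < V ≤ V₀`, the root `birchMurnaghan3Volume` inverts it and obeys the
corner rule `birchMurnaghan3Volume_mem_Icc_of_box`; for `B₀' < 4` the printed third-order pressure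
returns to zero at a finite compression (`birchMurnaghan3Pressure_eq_zero_of_lt_four`), so such a
fit is not monotone on `(0, V₀]`.  For the Birch–Murnaghan and
Vinet closed forms of `K(V)` we prove that the parameter `B₀'` is `(dK/dP)_{P=0}` in the precise
sense `dK/dV|_{V₀} = B₀' · dP/dV|_{V₀}` [cite: Poirier1991, §4.3.2 eq. (4.39)].
Finally, the LINEAR COMPRESSIBILITY ESTIMATE `Δ ln V ≈ -κ_V P` (`κ_V = 1/B₀`) bounds the compression
of all three laws from above: a form-independent comparison principle (`K ≥ B₀` under compression
`⇒ B₀ ln(V₀/V) ≤ P(V)`, `mul_log_div_le_of_bulkModulus_ge`) and the elementary shape inequalities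
`-ln x ≤ g_η(x)` (Vinet, `B₀' ≥ 1`) and `3 ln q ≤ h(q)` (Birch–Murnaghan, `B₀' ≥ 4`) give
`ln(V₀/V(P)) ≤ P/B₀`, `1 - V(P)/V₀ ≤ P/B₀`, `V(P) ≥ V₀ e^{-P/B₀}` for each inverse law.
Conversely, Murnaghan's law `K = B₀ + B₀' P` bounds the other two from the compressed side: a
second comparison principle (`K ≤ B₀ + B₀' P` along the compression path
`⇒ (1/B₀') ln(1 + B₀' P/B₀) ≤ ln(V₀/V)`, `log_murnaghan_le_log_div_of_bulkModulus_le`) together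
with the printed bulk moduli (`vinet_bulkModulus_le`, `birchMurnaghan3_bulkModulus_le`) gives
`V_Vinet(P) ≤ V_Murnaghan(P)` (`B₀' ≥ 1`) and `V_BM3(P) ≤ V_Murnaghan(P)` (`B₀' ≥ 4`) for equal
`(V₀, B₀, B₀')`, hence the common two-sided bracket
`V₀ e^{-P/B₀} ≤ V(P) ≤ V₀ e^{-P/(B₀ + B₀' P)}` for all three laws; and in the reverse direction
(`B₀ + β P ≤ K` with the large-compression slopes `β = 2/3` for Vinet, `β = 7/3` for
Birch–Murnaghan) each printed law is SANDWICHED between two Murnaghan laws with the same `B₀`: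
`V_Murnaghan(P; B₀, 2/3) ≤ V_Vinet(P) ≤ V_Murnaghan(P; B₀, B₀')`,
`V_Murnaghan(P; B₀, 7/3) ≤ V_BM3(P) ≤ V_Murnaghan(P; B₀, B₀')`
(`vinetVolume_mem_Icc_murnaghanVolume`, `birchMurnaghan3Volume_mem_Icc_murnaghanVolume`).
Parameters: `V₀ > 0` equilibrium volume, `B₀` zero-pressure bulk modulus,
`B₀'` its pressure derivative at `P = 0`, `E₀` the minimum energy.

Not here: thermal (Mie–Grüneisen) pressure, fourth-order Birch, Holzapfel / logarithmic forms,
error analysis of fits, any material constant.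
-/

namespace Literature.MathematicalPhysics.StatisticalMechanics

noncomputable section

open Real Set

/-! ## Generic identities: compression ratio and its cube root -/

/-- The linear compression ratio `(V₀/V)^{1/3}` (so that `ρ/ρ₀ = V₀/V` is its cube); the natural
variable of the Birch–Murnaghan form. [cite: Poirier1991, §4.3.2 eq. (4.33)] -/
def cubeRootRatio (V₀ V : ℝ) : ℝ := (V₀ / V) ^ ((1 : ℝ) / 3)

/-- Positivity of `(V₀/V)^{1/3}`. [folklore] -/
private lemma cubeRootRatio_pos {V₀ V : ℝ} (hV₀ : 0 < V₀) (hV : 0 < V) : 0 < cubeRootRatio V₀ V :=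
  Real.rpow_pos_of_pos (div_pos hV₀ hV) _

/-- `((V₀/V)^{1/3})^n = (V₀/V)^{n/3}`. [folklore] -/
private lemma cubeRootRatio_pow {V₀ V : ℝ} (hV₀ : 0 < V₀) (hV : 0 < V) (n : ℕ) :
    cubeRootRatio V₀ V ^ n = (V₀ / V) ^ ((n : ℝ) / 3) := by
  unfold cubeRootRatio
  rw [← Real.rpow_natCast, ← Real.rpow_mul (le_of_lt (div_pos hV₀ hV))]
  congr 1
  ring

/-- `((V₀/V)^{1/3})^3 = V₀/V`. [folklore] -/
private lemma cubeRootRatio_pow_three {V₀ V : ℝ} (hV₀ : 0 < V₀) (hV : 0 < V) :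
    cubeRootRatio V₀ V ^ 3 = V₀ / V := by
  rw [cubeRootRatio_pow hV₀ hV 3]
  norm_num

/-- `(V₀/V₀)^{1/3} = 1`. [folklore] -/
private lemma cubeRootRatio_self {V₀ : ℝ} (hV₀ : 0 < V₀) : cubeRootRatio V₀ V₀ = 1 := by
  unfold cubeRootRatio
  rw [div_self hV₀.ne', Real.one_rpow]

/-- `d/dV (V₀/V)^{1/3} = -(V₀/V)^{1/3} / (3V)`. [folklore] -/
private lemma hasDerivAt_cubeRootRatio {V₀ V : ℝ} (hV₀ : 0 < V₀) (hV : 0 < V) :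
    HasDerivAt (cubeRootRatio V₀) (-(cubeRootRatio V₀ V) / (3 * V)) V := by
  have hr : 0 < V₀ / V := div_pos hV₀ hV
  have h1 : HasDerivAt (fun W : ℝ => V₀ / W) ((0 * V - V₀ * 1) / V ^ 2) V :=
    (hasDerivAt_const V V₀).div (hasDerivAt_id V) hV.ne'
  have h2 := h1.rpow_const (p := (1 : ℝ) / 3) (Or.inl hr.ne')
  refine h2.congr_deriv ?_
  unfold cubeRootRatio
  rw [Real.rpow_sub_one hr.ne']
  field_simp
  ring

/-! ## Enthalpy at `T = 0` and the common-tangent rule -/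

/-- Enthalpy (the `T = 0` Gibbs function) of a phase with energy–volume curve `E`, at pressure
`P` and volume `V`: `H = E(V) + P V`. [cite: Kaxiras2003, App. C (table of thermodynamic
potentials, `Θ = E + PΩ`)] -/
def enthalpy (E : ℝ → ℝ) (P V : ℝ) : ℝ := E V + P * V

/-- Tangent-line inequality for a convex energy–volume curve: if `E` is convex on a convex set
`S` of volumes and has derivative `-P` at `V* ∈ S`, then `E(V) ≥ E(V*) - P (V - V*)` on `S`.
[folklore] -/
private theorem convexOn_tangent_le {E : ℝ → ℝ} {S : Set ℝ} {Vs P : ℝ} (hE : ConvexOn ℝ S E)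
    (hVs : Vs ∈ S) (hd : HasDerivAt E (-P) Vs) {V : ℝ} (hV : V ∈ S) :
    E Vs - P * (V - Vs) ≤ E V := by
  rcases lt_trichotomy Vs V with hlt | heq | hgt
  · have h := hE.le_slope_of_hasDerivAt hVs hV hlt hd
    rw [slope_def_field] at h
    have hpos : 0 < V - Vs := sub_pos.mpr hlt
    have := (le_div_iff₀ hpos).mp h
    linarith
  · subst heq; simp
  · have h := hE.slope_le_of_hasDerivAt hV hVs hgt hd
    rw [slope_def_field] at h
    have hpos : 0 < Vs - V := sub_pos.mpr hgt
    have := (div_le_iff₀ hpos).mp h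
    linarith

/-- ENTHALPY MINIMUM AT THE TANGENT POINT: for a convex energy–volume curve `E` on a convex set
`S` of volumes, a volume `V*` with `E'(V*) = -P` minimises the enthalpy `E(V) + PV` over `S`;
i.e. at `T = 0` the equilibrium volume at pressure `P` is where the tangent to `E(V)` has slope
`-P`. [cite: Kaxiras2003, §5.6.1 eq. (5.88) and the discussion of Fig. 5.6] -/
theorem enthalpy_isMinOn_of_convexOn {E : ℝ → ℝ} {S : Set ℝ} {Vs P : ℝ} (hE : ConvexOn ℝ S E)
    (hVs : Vs ∈ S) (hd : HasDerivAt E (-P) Vs) : IsMinOn (enthalpy E P) S Vs := by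
  intro V hV
  have h := convexOn_tangent_le hE hVs hd hV
  show E Vs + P * Vs ≤ E V + P * V
  linarith

/-- COMMON TANGENT ⇒ EQUAL ENTHALPY: if the chord joining `(V₁, E₁(V₁))` and `(V₂, E₂(V₂))` has
slope `-P`, the two phases have equal enthalpy at pressure `P` (evaluated at `V₁`, `V₂`).
[folklore] -/
private theorem enthalpy_eq_of_chord_slope {E₁ E₂ : ℝ → ℝ} {V₁ V₂ P : ℝ}
    (h : E₂ V₂ - E₁ V₁ = -P * (V₂ - V₁)) : enthalpy E₁ P V₁ = enthalpy E₂ P V₂ := by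
  unfold enthalpy
  linarith

/-- THE COMMON-TANGENT (MAXWELL) CONSTRUCTION FOR A PRESSURE-INDUCED TRANSITION: two phases with
convex energy–volume curves `E₁`, `E₂` on convex volume sets `S₁`, `S₂`; if a common tangent
touches `E₁` at `V₁` and `E₂` at `V₂` with slope `-P`, then at pressure `P` the minimal
enthalpies of the two phases coincide (both equal the common value at the tangent points), so `P`
is the `T = 0` coexistence (transition) pressure. [cite: Kaxiras2003, §5.6.1 (discussion of
Fig. 5.6: "A Maxwell (common tangent) construction … gives the critical pressure")] -/
theorem commonTangent_transitionPressure {E₁ E₂ : ℝ → ℝ} {S₁ S₂ : Set ℝ} {V₁ V₂ P : ℝ}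
    (hE₁ : ConvexOn ℝ S₁ E₁) (hE₂ : ConvexOn ℝ S₂ E₂) (hV₁ : V₁ ∈ S₁) (hV₂ : V₂ ∈ S₂)
    (hd₁ : HasDerivAt E₁ (-P) V₁) (hd₂ : HasDerivAt E₂ (-P) V₂)
    (hchord : E₂ V₂ - E₁ V₁ = -P * (V₂ - V₁)) :
    IsMinOn (enthalpy E₁ P) S₁ V₁ ∧ IsMinOn (enthalpy E₂ P) S₂ V₂ ∧
      enthalpy E₁ P V₁ = enthalpy E₂ P V₂ :=
  ⟨enthalpy_isMinOn_of_convexOn hE₁ hV₁ hd₁, enthalpy_isMinOn_of_convexOn hE₂ hV₂ hd₂,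
    enthalpy_eq_of_chord_slope hchord⟩

/-! ## Murnaghan's integrated linear equation of state -/

/-- MURNAGHAN PRESSURE–VOLUME RELATION `P(V) = (B₀/B₀') [ (V₀/V)^{B₀'} - 1 ]`, obtained by
integrating the linear law `K = B₀ + B₀' P` (`K = -V dP/dV`).
[cite: Poirier1991, §4.2 eq. (4.6)] (original: [Murnaghan1944]) -/
def murnaghanPressure (V₀ B₀ B₀' V : ℝ) : ℝ := B₀ / B₀' * ((V₀ / V) ^ B₀' - 1)

/-- MURNAGHAN ENERGY–VOLUME CURVE
`E(V) = E₀ + (B₀ V / B₀') [ (V₀/V)^{B₀'} / (B₀' - 1) + 1 ] - B₀ V₀ / (B₀' - 1)`,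
the antiderivative of `-P` normalised by `E(V₀) = E₀` (the form fitted to computed `E(V)` data;
requires `B₀' ≠ 0, 1`). [folklore] -/
def murnaghanEnergy (E₀ V₀ B₀ B₀' V : ℝ) : ℝ :=
  E₀ + B₀ * V / B₀' * ((V₀ / V) ^ B₀' / (B₀' - 1) + 1) - B₀ * V₀ / (B₀' - 1)

/-- `P(V₀) = 0` for the Murnaghan form. [cite: Poirier1991, §4.2 eq. (4.6)] -/
theorem murnaghanPressure_self {V₀ : ℝ} (hV₀ : 0 < V₀) (B₀ B₀' : ℝ) :
    murnaghanPressure V₀ B₀ B₀' V₀ = 0 := by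
  simp [murnaghanPressure, div_self hV₀.ne']

/-- `E(V₀) = E₀`: normalisation of the integrated Murnaghan form (`B₀' ≠ 0`, `B₀' ≠ 1`).
[cite: Poirier1991, §4.2 eq. (4.6) (its antiderivative, normalised at `V₀`)] -/
theorem murnaghanEnergy_self {V₀ B₀' : ℝ} (hV₀ : 0 < V₀) (hB : B₀' ≠ 0) (hB1 : B₀' ≠ 1)
    (E₀ B₀ : ℝ) : murnaghanEnergy E₀ V₀ B₀ B₀' V₀ = E₀ := by
  have h1 : B₀' - 1 ≠ 0 := sub_ne_zero.mpr hB1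
  simp only [murnaghanEnergy, div_self hV₀.ne', Real.one_rpow]
  field_simp
  ring

/-- Derivative of the Murnaghan pressure: `dP/dV = -B₀ (V₀/V)^{B₀'} / V` on `V > 0`
(`B₀' ≠ 0`). [cite: Poirier1991, §4.2 eqs. (4.4)–(4.6)] -/
theorem hasDerivAt_murnaghanPressure {V₀ B₀' V : ℝ} (hV₀ : 0 < V₀) (hV : 0 < V) (hB : B₀' ≠ 0)
    (B₀ : ℝ) :
    HasDerivAt (murnaghanPressure V₀ B₀ B₀') (-(B₀ * (V₀ / V) ^ B₀' / V)) V := by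
  have hr : 0 < V₀ / V := div_pos hV₀ hV
  have h1 : HasDerivAt (fun W : ℝ => V₀ / W) ((0 * V - V₀ * 1) / V ^ 2) V :=
    (hasDerivAt_const V V₀).div (hasDerivAt_id V) hV.ne'
  have h2 := ((h1.rpow_const (p := B₀') (Or.inl hr.ne')).sub_const 1).const_mul (B₀ / B₀')
  refine h2.congr_deriv ?_
  rw [Real.rpow_sub_one hr.ne']
  field_simp
  ring

/-- MURNAGHAN'S DEFINING PROPERTY: the bulk modulus `K(V) = -V P'(V)` of the Murnaghan form is
exactly linear in pressure, `K = B₀ + B₀' P(V)`, at every `V > 0`.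
[cite: Poirier1991, §4.2 eqs. (4.4), (4.8)] -/
theorem murnaghan_bulkModulus_linear {V₀ B₀' V : ℝ} (hV₀ : 0 < V₀) (hV : 0 < V) (hB : B₀' ≠ 0)
    (B₀ : ℝ) :
    ∃ P' : ℝ, HasDerivAt (murnaghanPressure V₀ B₀ B₀') P' V ∧
      -V * P' = B₀ + B₀' * murnaghanPressure V₀ B₀ B₀' V := by
  refine ⟨_, hasDerivAt_murnaghanPressure hV₀ hV hB B₀, ?_⟩
  unfold murnaghanPressure
  field_simp
  ring

/-- `K(V₀) = B₀` for the Murnaghan form. [cite: Poirier1991, §4.2 eq. (4.4)] -/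
theorem murnaghan_bulkModulus_self {V₀ B₀' : ℝ} (hV₀ : 0 < V₀) (hB : B₀' ≠ 0) (B₀ : ℝ) :
    ∃ P' : ℝ, HasDerivAt (murnaghanPressure V₀ B₀ B₀') P' V₀ ∧ -V₀ * P' = B₀ := by
  obtain ⟨P', hP', hK⟩ := murnaghan_bulkModulus_linear hV₀ hV₀ hB B₀
  exact ⟨P', hP', by rw [hK, murnaghanPressure_self hV₀]; ring⟩

/-- `P = -dE/dV` FOR THE MURNAGHAN PAIR (`V > 0`, `B₀' ≠ 0, 1`): the integrated energy
differentiates to minus the printed Murnaghan pressure.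
[cite: Poirier1991, §4.2 eq. (4.6) with §4.4 eq. (4.45) (`P = -(∂E/∂V)_T`)] -/
theorem hasDerivAt_murnaghanEnergy {V₀ B₀' V : ℝ} (hV₀ : 0 < V₀) (hV : 0 < V) (hB : B₀' ≠ 0)
    (hB1 : B₀' ≠ 1) (E₀ B₀ : ℝ) :
    HasDerivAt (murnaghanEnergy E₀ V₀ B₀ B₀') (-(murnaghanPressure V₀ B₀ B₀' V)) V := by
  have hr : 0 < V₀ / V := div_pos hV₀ hV
  have h1' : B₀' - 1 ≠ 0 := sub_ne_zero.mpr hB1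
  have h1 : HasDerivAt (fun W : ℝ => V₀ / W) ((0 * V - V₀ * 1) / V ^ 2) V :=
    (hasDerivAt_const V V₀).div (hasDerivAt_id V) hV.ne'
  have h2 : HasDerivAt (fun W : ℝ => (V₀ / W) ^ B₀')
      ((0 * V - V₀ * 1) / V ^ 2 * B₀' * (V₀ / V) ^ (B₀' - 1)) V :=
    h1.rpow_const (p := B₀') (Or.inl hr.ne')
  have h3 : HasDerivAt (fun W : ℝ => B₀ * W / B₀' * ((V₀ / W) ^ B₀' / (B₀' - 1) + 1))
      (B₀ / B₀' * ((V₀ / V) ^ B₀' / (B₀' - 1) + 1) +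
        B₀ * V / B₀' * ((0 * V - V₀ * 1) / V ^ 2 * B₀' * (V₀ / V) ^ (B₀' - 1) / (B₀' - 1))) V := by
    have ha : HasDerivAt (fun W : ℝ => B₀ * W / B₀') (B₀ / B₀') V := by
      have := ((hasDerivAt_id V).const_mul B₀).div_const B₀'
      simpa using this
    have hb : HasDerivAt (fun W : ℝ => (V₀ / W) ^ B₀' / (B₀' - 1) + 1)
        ((0 * V - V₀ * 1) / V ^ 2 * B₀' * (V₀ / V) ^ (B₀' - 1) / (B₀' - 1)) V := by
      have := (h2.div_const (B₀' - 1)).add_const 1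
      simpa using this
    have := ha.mul hb
    simpa only [Pi.mul_def] using this
  have h4 := (h3.const_add E₀).sub_const (B₀ * V₀ / (B₀' - 1))
  have h5 : HasDerivAt (murnaghanEnergy E₀ V₀ B₀ B₀')
      (B₀ / B₀' * ((V₀ / V) ^ B₀' / (B₀' - 1) + 1) +
        B₀ * V / B₀' * ((0 * V - V₀ * 1) / V ^ 2 * B₀' * (V₀ / V) ^ (B₀' - 1) / (B₀' - 1))) V := by
    refine h4.congr_of_eventuallyEq ?_
    exact Filter.Eventually.of_forall fun W => rfl
  refine h5.congr_deriv ?_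
  rw [Real.rpow_sub_one hr.ne', murnaghanPressure]
  field_simp
  ring

/-! ## Birch–Murnaghan (third order, Eulerian finite strain) -/

/-- EULERIAN FINITE STRAIN `f(V) = ½ [ (V₀/V)^{2/3} - 1 ]` (compression: `f > 0` for `V < V₀`).
[cite: Poirier1991, §4.3.2 eq. (4.33)]; same as [CohenGulserenHemley2000, eq. (2)]. -/
def eulerianStrain (V₀ V : ℝ) : ℝ := ((V₀ / V) ^ ((2 : ℝ) / 3) - 1) / 2

/-- THIRD-ORDER BIRCH–MURNAGHAN ENERGY: the strain energy truncated at third order in the Eulerian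
strain, `E(V) = E₀ + a f² + b f³` with `a = (9/2) B₀ V₀` and `b = a (B₀' - 4)`.
[cite: Poirier1991, §4.3 eqs. (4.27), (4.29), (4.40)–(4.41)] (original: [Birch1947]) -/
def birchMurnaghan3Energy (E₀ V₀ B₀ B₀' V : ℝ) : ℝ :=
  E₀ + 9 / 2 * B₀ * V₀ * eulerianStrain V₀ V ^ 2 * (1 + (B₀' - 4) * eulerianStrain V₀ V)

/-- THIRD-ORDER BIRCH–MURNAGHAN PRESSURE in strain form,
`P = 3 B₀ f (1 + 2f)^{5/2} [ 1 + (3/2)(B₀' - 4) f ]`.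
[cite: CohenGulserenHemley2000, eq. (1)]; equals [Poirier1991, eq. (4.41)] with `3b/2a = (3/2)(B₀'-4)`. -/
def birchMurnaghan3Pressure (V₀ B₀ B₀' V : ℝ) : ℝ :=
  3 * B₀ * eulerianStrain V₀ V * (1 + 2 * eulerianStrain V₀ V) ^ ((5 : ℝ) / 2) *
    (1 + 3 / 2 * (B₀' - 4) * eulerianStrain V₀ V)

/-- THE DFT EQUATION-OF-STATE-FIT FORM of the third-order Birch–Murnaghan energy (the form used
for the Δ-test / pseudopotential-verification `E(V)` fits),
`E(V) = E₀ + (9/16) B₀ V₀ [ (V₀/V)^{2/3} - 1 ]² { 2 + [ (V₀/V)^{2/3} - 1 ] (B₀' - 4) }`,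
agrees with the strain form. [cite: KucukbenliEtAl2014, §2.1 eq. (1)] -/
theorem birchMurnaghan3Energy_eq_ratio_form (E₀ V₀ B₀ B₀' V : ℝ) :
    birchMurnaghan3Energy E₀ V₀ B₀ B₀' V =
      E₀ + 9 / 16 * B₀ * V₀ * ((V₀ / V) ^ ((2 : ℝ) / 3) - 1) ^ 2 *
        (2 + ((V₀ / V) ^ ((2 : ℝ) / 3) - 1) * (B₀' - 4)) := by
  unfold birchMurnaghan3Energy eulerianStrain
  ring

/-- `f = (q² - 1)/2` with `q = (V₀/V)^{1/3}`. [folklore] -/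
private lemma eulerianStrain_eq_cubeRootRatio {V₀ V : ℝ} (hV₀ : 0 < V₀) (hV : 0 < V) :
    eulerianStrain V₀ V = (cubeRootRatio V₀ V ^ 2 - 1) / 2 := by
  rw [eulerianStrain, cubeRootRatio_pow hV₀ hV 2]
  norm_num

/-- `1 + 2f = q²`. [cite: Poirier1991, §4.3.2 eq. (4.33)] -/
lemma one_add_two_mul_eulerianStrain {V₀ V : ℝ} (hV₀ : 0 < V₀) (hV : 0 < V) :
    1 + 2 * eulerianStrain V₀ V = cubeRootRatio V₀ V ^ 2 := by
  rw [eulerianStrain_eq_cubeRootRatio hV₀ hV]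
  ring

/-- `f(V₀) = 0`. [folklore] -/
private lemma eulerianStrain_self {V₀ : ℝ} (hV₀ : 0 < V₀) : eulerianStrain V₀ V₀ = 0 := by
  rw [eulerianStrain_eq_cubeRootRatio hV₀ hV₀, cubeRootRatio_self hV₀]
  norm_num

/-- `(1 + 2f)^{5/2} = ((V₀/V)^{1/3})^5 = (V₀/V)^{5/3}`. [cite: Poirier1991, §4.3.2 eq. (4.31)] -/
lemma one_add_two_mul_eulerianStrain_rpow {V₀ V : ℝ} (hV₀ : 0 < V₀) (hV : 0 < V) :
    (1 + 2 * eulerianStrain V₀ V) ^ ((5 : ℝ) / 2) = cubeRootRatio V₀ V ^ 5 := by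
  have hq : 0 ≤ cubeRootRatio V₀ V := le_of_lt (cubeRootRatio_pos hV₀ hV)
  rw [one_add_two_mul_eulerianStrain hV₀ hV]
  rw [show (cubeRootRatio V₀ V ^ 2) = cubeRootRatio V₀ V ^ (2 : ℝ) by norm_cast,
    ← Real.rpow_mul hq, show ((2 : ℝ) * (5 / 2)) = ((5 : ℕ) : ℝ) by norm_num, Real.rpow_natCast]

/-- The Birch–Murnaghan pressure in terms of `q = (V₀/V)^{1/3}` and `f`:
`P = 3 B₀ f q⁵ [1 + (3/2)(B₀'-4) f]`. [folklore] -/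
private lemma birchMurnaghan3Pressure_eq_cubeRootRatio {V₀ V : ℝ} (hV₀ : 0 < V₀) (hV : 0 < V)
    (B₀ B₀' : ℝ) :
    birchMurnaghan3Pressure V₀ B₀ B₀' V =
      3 * B₀ * eulerianStrain V₀ V * cubeRootRatio V₀ V ^ 5 *
        (1 + 3 / 2 * (B₀' - 4) * eulerianStrain V₀ V) := by
  rw [birchMurnaghan3Pressure, one_add_two_mul_eulerianStrain_rpow hV₀ hV]

/-- THIRD-ORDER BIRCH–MURNAGHAN EQUATION OF STATE in the usual density form,
`P = (3B₀/2) [ (V₀/V)^{7/3} - (V₀/V)^{5/3} ] { 1 + (3/4)(B₀' - 4) [ (V₀/V)^{2/3} - 1 ] }`.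
[cite: Poirier1991, §4.3.3 eq. (4.42)] -/
theorem birchMurnaghan3Pressure_eq_density_form {V₀ V : ℝ} (hV₀ : 0 < V₀) (hV : 0 < V)
    (B₀ B₀' : ℝ) :
    birchMurnaghan3Pressure V₀ B₀ B₀' V =
      3 * B₀ / 2 * ((V₀ / V) ^ ((7 : ℝ) / 3) - (V₀ / V) ^ ((5 : ℝ) / 3)) *
        (1 + 3 / 4 * (B₀' - 4) * ((V₀ / V) ^ ((2 : ℝ) / 3) - 1)) := by
  rw [birchMurnaghan3Pressure_eq_cubeRootRatio hV₀ hV, eulerianStrain_eq_cubeRootRatio hV₀ hV]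
  have h7 := cubeRootRatio_pow hV₀ hV 7
  have h5 := cubeRootRatio_pow hV₀ hV 5
  have h2 := cubeRootRatio_pow hV₀ hV 2
  push_cast at h7 h5 h2
  rw [← h7, ← h5, ← h2]
  ring

/-- SECOND-ORDER BIRCH–MURNAGHAN (`B₀' = 4`): `P = (3B₀/2) [ (V₀/V)^{7/3} - (V₀/V)^{5/3} ]`.
[cite: Poirier1991, §4.3.2 eq. (4.34)] -/
theorem birchMurnaghan3Pressure_four {V₀ V : ℝ} (hV₀ : 0 < V₀) (hV : 0 < V) (B₀ : ℝ) :
    birchMurnaghan3Pressure V₀ B₀ 4 V =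
      3 * B₀ / 2 * ((V₀ / V) ^ ((7 : ℝ) / 3) - (V₀ / V) ^ ((5 : ℝ) / 3)) := by
  rw [birchMurnaghan3Pressure_eq_density_form hV₀ hV]
  ring

/-- `E(V₀) = E₀` for the Birch–Murnaghan form. [cite: Poirier1991, §4.3.2 eq. (4.27)] -/
theorem birchMurnaghan3Energy_self {V₀ : ℝ} (hV₀ : 0 < V₀) (E₀ B₀ B₀' : ℝ) :
    birchMurnaghan3Energy E₀ V₀ B₀ B₀' V₀ = E₀ := by
  simp [birchMurnaghan3Energy, eulerianStrain_self hV₀]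

/-- `P(V₀) = 0` for the Birch–Murnaghan form. [cite: Poirier1991, §4.3.3 eq. (4.42)] -/
theorem birchMurnaghan3Pressure_self {V₀ : ℝ} (hV₀ : 0 < V₀) (B₀ B₀' : ℝ) :
    birchMurnaghan3Pressure V₀ B₀ B₀' V₀ = 0 := by
  simp [birchMurnaghan3Pressure, eulerianStrain_self hV₀]

/-- Derivative of the Eulerian strain: `df/dV = -q²/(3V)` with `q = (V₀/V)^{1/3}`
(equivalently `-(1/3V₀)(1+2f)^{5/2}`). [cite: Poirier1991, §4.3.2 eq. (4.31)] -/
theorem hasDerivAt_eulerianStrain {V₀ V : ℝ} (hV₀ : 0 < V₀) (hV : 0 < V) :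
    HasDerivAt (eulerianStrain V₀) (-(cubeRootRatio V₀ V ^ 2) / (3 * V)) V := by
  have hq := hasDerivAt_cubeRootRatio hV₀ hV
  have h2 : HasDerivAt (fun W => (cubeRootRatio V₀ W ^ 2 - 1) / 2)
      (((2 : ℕ) : ℝ) * cubeRootRatio V₀ V ^ (2 - 1) * (-(cubeRootRatio V₀ V) / (3 * V)) / 2) V :=
    ((hq.pow 2).sub_const 1).div_const 2
  have h3 : HasDerivAt (eulerianStrain V₀)
      (((2 : ℕ) : ℝ) * cubeRootRatio V₀ V ^ (2 - 1) * (-(cubeRootRatio V₀ V) / (3 * V)) / 2) V := by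
    refine h2.congr_of_eventuallyEq ?_
    filter_upwards [lt_mem_nhds hV] with W hW
    exact eulerianStrain_eq_cubeRootRatio hV₀ hW
  refine h3.congr_deriv ?_
  push_cast
  field_simp

/-- `P = -dE/dV` FOR THE THIRD-ORDER BIRCH–MURNAGHAN PAIR: the strain energy `E₀ + a f² + b f³`
differentiates to minus the Birch–Murnaghan pressure, at every `V > 0`.
[cite: Poirier1991, §4.3 eqs. (4.30), (4.40)–(4.42)] -/
theorem hasDerivAt_birchMurnaghan3Energy {V₀ V : ℝ} (hV₀ : 0 < V₀) (hV : 0 < V)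
    (E₀ B₀ B₀' : ℝ) :
    HasDerivAt (birchMurnaghan3Energy E₀ V₀ B₀ B₀') (-(birchMurnaghan3Pressure V₀ B₀ B₀' V)) V := by
  set q := cubeRootRatio V₀ V with hqdef
  set f := eulerianStrain V₀ V with hfdef
  have hf := hasDerivAt_eulerianStrain hV₀ hV
  have h1 : HasDerivAt (fun W => eulerianStrain V₀ W ^ 2 * (1 + (B₀' - 4) * eulerianStrain V₀ W))
      (((2 : ℕ) : ℝ) * f ^ (2 - 1) * (-(q ^ 2) / (3 * V)) * (1 + (B₀' - 4) * f) +
        f ^ 2 * ((B₀' - 4) * (-(q ^ 2) / (3 * V)))) V :=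
    (hf.pow 2).mul ((hf.const_mul (B₀' - 4)).const_add 1)
  have h2 := (h1.const_mul (9 / 2 * B₀ * V₀)).const_add E₀
  have h3 : HasDerivAt (birchMurnaghan3Energy E₀ V₀ B₀ B₀')
      (9 / 2 * B₀ * V₀ * (((2 : ℕ) : ℝ) * f ^ (2 - 1) * (-(q ^ 2) / (3 * V)) * (1 + (B₀' - 4) * f) +
        f ^ 2 * ((B₀' - 4) * (-(q ^ 2) / (3 * V))))) V := by
    refine h2.congr_of_eventuallyEq ?_
    exact Filter.Eventually.of_forall fun W => by simp only [birchMurnaghan3Energy]; ring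
  refine h3.congr_deriv ?_
  rw [birchMurnaghan3Pressure_eq_cubeRootRatio hV₀ hV, ← hqdef, ← hfdef]
  have hq3 : q ^ 3 = V₀ / V := cubeRootRatio_pow_three hV₀ hV
  have hV' : V ≠ 0 := hV.ne'
  have hq3' : q ^ 3 * V = V₀ := by rw [hq3]; field_simp
  rw [← hq3']
  push_cast
  field_simp
  ring

/-- BULK MODULUS OF THE THIRD-ORDER BIRCH–MURNAGHAN FORM: with `q = (V₀/V)^{1/3}` and `f` the
Eulerian strain, `K(V) = -V P'(V) = B₀ q⁵ [ 1 + 7f + (3/2)(B₀'-4) f (2 + 9f) ]`; for `B₀' = 4`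
this is `K = B₀ (1 + 7f)(1 + 2f)^{5/2}`. [cite: Poirier1991, §4.3.2 eqs. (4.35)–(4.37)] -/
theorem birchMurnaghan3_bulkModulus {V₀ V : ℝ} (hV₀ : 0 < V₀) (hV : 0 < V) (B₀ B₀' : ℝ) :
    ∃ P' : ℝ, HasDerivAt (birchMurnaghan3Pressure V₀ B₀ B₀') P' V ∧
      -V * P' = B₀ * cubeRootRatio V₀ V ^ 5 *
        (1 + 7 * eulerianStrain V₀ V +
          3 / 2 * (B₀' - 4) * eulerianStrain V₀ V * (2 + 9 * eulerianStrain V₀ V)) := by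
  set q := cubeRootRatio V₀ V with hqdef
  set f := eulerianStrain V₀ V with hfdef
  have hf := hasDerivAt_eulerianStrain hV₀ hV
  have hq := hasDerivAt_cubeRootRatio hV₀ hV
  have h1 : HasDerivAt
      (fun W => 3 * B₀ * eulerianStrain V₀ W * cubeRootRatio V₀ W ^ 5 *
        (1 + 3 / 2 * (B₀' - 4) * eulerianStrain V₀ W))
      ((3 * B₀ * (-(q ^ 2) / (3 * V)) * q ^ 5 +
          3 * B₀ * f * (((5 : ℕ) : ℝ) * q ^ (5 - 1) * (-q / (3 * V)))) *
          (1 + 3 / 2 * (B₀' - 4) * f) +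
        3 * B₀ * f * q ^ 5 * (3 / 2 * (B₀' - 4) * (-(q ^ 2) / (3 * V)))) V :=
    (((hf.const_mul (3 * B₀)).mul (hq.pow 5)).mul
      ((hf.const_mul (3 / 2 * (B₀' - 4))).const_add 1))
  have h2 : HasDerivAt (birchMurnaghan3Pressure V₀ B₀ B₀')
      ((3 * B₀ * (-(q ^ 2) / (3 * V)) * q ^ 5 +
          3 * B₀ * f * (((5 : ℕ) : ℝ) * q ^ (5 - 1) * (-q / (3 * V)))) *
          (1 + 3 / 2 * (B₀' - 4) * f) +
        3 * B₀ * f * q ^ 5 * (3 / 2 * (B₀' - 4) * (-(q ^ 2) / (3 * V)))) V := by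
    refine h1.congr_of_eventuallyEq ?_
    filter_upwards [lt_mem_nhds hV] with W hW
    exact birchMurnaghan3Pressure_eq_cubeRootRatio hV₀ hW B₀ B₀'
  refine ⟨_, h2, ?_⟩
  have hV' : V ≠ 0 := hV.ne'
  have hfq : f = (q ^ 2 - 1) / 2 := eulerianStrain_eq_cubeRootRatio hV₀ hV
  rw [hfq]
  push_cast
  field_simp
  ring

/-- `K(V₀) = B₀` for the Birch–Murnaghan form. [cite: Poirier1991, §4.3.2 eq. (4.26)] -/
theorem birchMurnaghan3_bulkModulus_self {V₀ : ℝ} (hV₀ : 0 < V₀) (B₀ B₀' : ℝ) :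
    ∃ P' : ℝ, HasDerivAt (birchMurnaghan3Pressure V₀ B₀ B₀') P' V₀ ∧ -V₀ * P' = B₀ := by
  obtain ⟨P', hP', hK⟩ := birchMurnaghan3_bulkModulus hV₀ hV₀ B₀ B₀'
  refine ⟨P', hP', ?_⟩
  rw [hK, eulerianStrain_self hV₀, cubeRootRatio_self hV₀]
  ring

/-! ## Vinet ("universal") equation of state -/

/-- The Vinet linear expansion variable `x = (V/V₀)^{1/3}`.
[cite: CohenGulserenHemley2000, eq. (4)] -/
def vinetX (V₀ V : ℝ) : ℝ := (V / V₀) ^ ((1 : ℝ) / 3)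

/-- The Vinet exponent scale `η = (3/2)(B₀' - 1)`. [cite: CohenGulserenHemley2000, eq. (4)] -/
def vinetEta (B₀' : ℝ) : ℝ := 3 / 2 * (B₀' - 1)

/-- VINET PRESSURE–VOLUME RELATION `P(V) = 3 B₀ (1 - x) x^{-2} exp[ (3/2)(B₀' - 1)(1 - x) ]`,
`x = (V/V₀)^{1/3}`. [cite: CohenGulserenHemley2000, eq. (4)] (original: [VinetEtAl1987]) -/
def vinetPressure (V₀ B₀ B₀' V : ℝ) : ℝ :=
  3 * B₀ * (1 - vinetX V₀ V) / vinetX V₀ V ^ 2 * exp (vinetEta B₀' * (1 - vinetX V₀ V))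

/-- VINET ENERGY–VOLUME CURVE
`E = E₀ + 4 B₀ V₀/(B₀'-1)² - 2 V₀ B₀ (B₀'-1)^{-2} (5 + 3 B₀'(x-1) - 3x) exp(-(3/2)(B₀'-1)(x-1))`
(as printed; requires `B₀' ≠ 1`). [cite: CohenGulserenHemley2000, eq. (5)] -/
def vinetEnergy (E₀ V₀ B₀ B₀' V : ℝ) : ℝ :=
  E₀ + 4 * B₀ * V₀ / (B₀' - 1) ^ 2 -
    2 * V₀ * B₀ / (B₀' - 1) ^ 2 * (5 + 3 * B₀' * (vinetX V₀ V - 1) - 3 * vinetX V₀ V) *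
      exp (-(3 / 2 * (B₀' - 1) * (vinetX V₀ V - 1)))

/-- Positivity of `x = (V/V₀)^{1/3}`. [folklore] -/
private lemma vinetX_pos {V₀ V : ℝ} (hV₀ : 0 < V₀) (hV : 0 < V) : 0 < vinetX V₀ V :=
  Real.rpow_pos_of_pos (div_pos hV hV₀) _

/-- `x(V₀) = 1`. [folklore] -/
private lemma vinetX_self {V₀ : ℝ} (hV₀ : 0 < V₀) : vinetX V₀ V₀ = 1 := by
  unfold vinetX
  rw [div_self hV₀.ne', Real.one_rpow]

/-- `x³ = V/V₀`. [folklore] -/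
private lemma vinetX_pow_three {V₀ V : ℝ} (hV₀ : 0 < V₀) (hV : 0 < V) : vinetX V₀ V ^ 3 = V / V₀ := by
  unfold vinetX
  rw [← Real.rpow_natCast, ← Real.rpow_mul (le_of_lt (div_pos hV hV₀))]
  norm_num

/-- `dx/dV = x/(3V)`. [folklore] -/
private lemma hasDerivAt_vinetX {V₀ V : ℝ} (hV₀ : 0 < V₀) (hV : 0 < V) :
    HasDerivAt (vinetX V₀) (vinetX V₀ V / (3 * V)) V := by
  have hr : 0 < V / V₀ := div_pos hV hV₀
  have h1 : HasDerivAt (fun W : ℝ => W / V₀) (1 / V₀) V := (hasDerivAt_id V).div_const V₀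
  have h2 := h1.rpow_const (p := (1 : ℝ) / 3) (Or.inl hr.ne')
  refine h2.congr_deriv ?_
  unfold vinetX
  rw [Real.rpow_sub_one hr.ne']
  field_simp

/-- The compact form of the printed Vinet energy,
`E = E₀ + (9 B₀ V₀ / η²) [1 - (1 + η (x-1)) e^{-η(x-1)}]`, `η = (3/2)(B₀'-1)` (`B₀' ≠ 1`).
[cite: CohenGulserenHemley2000, eq. (5) (algebraic rewriting)] -/
theorem vinetEnergy_eq_compact {B₀' : ℝ} (hB1 : B₀' ≠ 1) (E₀ V₀ B₀ V : ℝ) :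
    vinetEnergy E₀ V₀ B₀ B₀' V =
      E₀ + 9 * B₀ * V₀ / vinetEta B₀' ^ 2 *
        (1 - (1 + vinetEta B₀' * (vinetX V₀ V - 1)) *
          exp (-(vinetEta B₀' * (vinetX V₀ V - 1)))) := by
  have h : B₀' - 1 ≠ 0 := sub_ne_zero.mpr hB1
  have hexp : exp (-(vinetEta B₀' * (vinetX V₀ V - 1))) =
      exp (-(3 / 2 * (B₀' - 1) * (vinetX V₀ V - 1))) := by unfold vinetEta; rfl
  rw [hexp]
  unfold vinetEnergy vinetEta
  field_simp
  ring

/-- `E(V₀) = E₀` for the Vinet form (`B₀' ≠ 1`). [cite: CohenGulserenHemley2000, eq. (5)] -/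
theorem vinetEnergy_self {V₀ B₀' : ℝ} (hV₀ : 0 < V₀) (hB1 : B₀' ≠ 1) (E₀ B₀ : ℝ) :
    vinetEnergy E₀ V₀ B₀ B₀' V₀ = E₀ := by
  have h : B₀' - 1 ≠ 0 := sub_ne_zero.mpr hB1
  simp only [vinetEnergy, vinetX_self hV₀, sub_self, mul_zero, neg_zero, exp_zero]
  field_simp
  ring

/-- `P(V₀) = 0` for the Vinet form. [cite: CohenGulserenHemley2000, eq. (4)] -/
theorem vinetPressure_self {V₀ : ℝ} (hV₀ : 0 < V₀) (B₀ B₀' : ℝ) :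
    vinetPressure V₀ B₀ B₀' V₀ = 0 := by
  simp [vinetPressure, vinetX_self hV₀]

/-- `P = -dE/dV` FOR THE VINET PAIR (`V > 0`, `B₀' ≠ 1`): the printed energy (5) differentiates to
minus the printed pressure (4). [cite: CohenGulserenHemley2000, eqs. (4)–(5)] -/
theorem hasDerivAt_vinetEnergy {V₀ B₀' V : ℝ} (hV₀ : 0 < V₀) (hV : 0 < V) (hB1 : B₀' ≠ 1)
    (E₀ B₀ : ℝ) :
    HasDerivAt (vinetEnergy E₀ V₀ B₀ B₀') (-(vinetPressure V₀ B₀ B₀' V)) V := by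
  set x := vinetX V₀ V with hxdef
  have hx := hasDerivAt_vinetX hV₀ hV
  have hB : B₀' - 1 ≠ 0 := sub_ne_zero.mpr hB1
  have hg : HasDerivAt (fun W => 5 + 3 * B₀' * (vinetX V₀ W - 1) - 3 * vinetX V₀ W)
      (3 * B₀' * (x / (3 * V)) - 3 * (x / (3 * V))) V :=
    (((hx.sub_const 1).const_mul (3 * B₀')).const_add 5).sub (hx.const_mul 3)
  have hh : HasDerivAt (fun W => exp (-(3 / 2 * (B₀' - 1) * (vinetX V₀ W - 1))))
      (exp (-(3 / 2 * (B₀' - 1) * (x - 1))) * (-(3 / 2 * (B₀' - 1) * (x / (3 * V))))) V :=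
    ((hx.sub_const 1).const_mul (3 / 2 * (B₀' - 1))).neg.exp
  have h1 := ((hg.mul hh).const_mul (2 * V₀ * B₀ / (B₀' - 1) ^ 2)).const_sub
    (E₀ + 4 * B₀ * V₀ / (B₀' - 1) ^ 2)
  have h2 : HasDerivAt (vinetEnergy E₀ V₀ B₀ B₀')
      (-(2 * V₀ * B₀ / (B₀' - 1) ^ 2 *
        ((3 * B₀' * (x / (3 * V)) - 3 * (x / (3 * V))) * exp (-(3 / 2 * (B₀' - 1) * (x - 1))) +
          (5 + 3 * B₀' * (x - 1) - 3 * x) *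
            (exp (-(3 / 2 * (B₀' - 1) * (x - 1))) * (-(3 / 2 * (B₀' - 1) * (x / (3 * V)))))))) V := by
    refine h1.congr_of_eventuallyEq ?_
    exact Filter.Eventually.of_forall fun W => by simp only [vinetEnergy, Pi.mul_apply]; ring
  refine h2.congr_deriv ?_
  have hx3 : x ^ 3 = V / V₀ := vinetX_pow_three hV₀ hV
  have hxpos : 0 < x := vinetX_pos hV₀ hV
  have hx0 : x ≠ 0 := hxpos.ne'
  have hV' : V ≠ 0 := hV.ne'
  have hV₀' : V₀ ≠ 0 := hV₀.ne'
  have hx3' : x ^ 3 * V₀ = V := by rw [hx3]; field_simp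
  have hexp : exp (vinetEta B₀' * (1 - x)) = exp (-(3 / 2 * (B₀' - 1) * (x - 1))) := by
    congr 1; unfold vinetEta; ring
  rw [vinetPressure, ← hxdef, hexp]
  set e := exp (-(3 / 2 * (B₀' - 1) * (x - 1))) with hedef
  rw [← hx3']
  field_simp
  ring

/-- BULK MODULUS OF THE VINET FORM:
`K(V) = -V P'(V) = B₀ x^{-2} [ 1 + (η x + 1)(1 - x) ] e^{η(1-x)}` with `x = (V/V₀)^{1/3}`,
`η = (3/2)(B₀'-1)`; in particular `K → B₀` as `x → 1`.
[cite: CohenGulserenHemley2000, eq. (4) (its `K = -V dP/dV`, cf. Poirier1991 eq. (4.46))] -/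
theorem vinet_bulkModulus {V₀ V : ℝ} (hV₀ : 0 < V₀) (hV : 0 < V) (B₀ B₀' : ℝ) :
    ∃ P' : ℝ, HasDerivAt (vinetPressure V₀ B₀ B₀') P' V ∧
      -V * P' = B₀ / vinetX V₀ V ^ 2 *
        (1 + (vinetEta B₀' * vinetX V₀ V + 1) * (1 - vinetX V₀ V)) *
          exp (vinetEta B₀' * (1 - vinetX V₀ V)) := by
  set x := vinetX V₀ V with hxdef
  have hx := hasDerivAt_vinetX hV₀ hV
  have hxpos : 0 < x := vinetX_pos hV₀ hV
  have hx0 : x ≠ 0 := hxpos.ne'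
  have ha : HasDerivAt (fun W => 3 * B₀ * (1 - vinetX V₀ W) / vinetX V₀ W ^ 2)
      ((3 * B₀ * (-(x / (3 * V))) * x ^ 2 -
        3 * B₀ * (1 - x) * (((2 : ℕ) : ℝ) * x ^ (2 - 1) * (x / (3 * V)))) / (x ^ 2) ^ 2) V :=
    ((hx.const_sub 1).const_mul (3 * B₀)).div (hx.pow 2) (pow_ne_zero 2 hx0)
  have hb : HasDerivAt (fun W => exp (vinetEta B₀' * (1 - vinetX V₀ W)))
      (exp (vinetEta B₀' * (1 - x)) * (vinetEta B₀' * (-(x / (3 * V))))) V :=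
    ((hx.const_sub 1).const_mul (vinetEta B₀')).exp
  have h1 := ha.mul hb
  have h2 : HasDerivAt (vinetPressure V₀ B₀ B₀')
      ((3 * B₀ * (-(x / (3 * V))) * x ^ 2 -
        3 * B₀ * (1 - x) * (((2 : ℕ) : ℝ) * x ^ (2 - 1) * (x / (3 * V)))) / (x ^ 2) ^ 2 *
          exp (vinetEta B₀' * (1 - x)) +
        3 * B₀ * (1 - x) / x ^ 2 *
          (exp (vinetEta B₀' * (1 - x)) * (vinetEta B₀' * (-(x / (3 * V)))))) V := by
    refine h1.congr_of_eventuallyEq ?_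
    exact Filter.Eventually.of_forall fun W => by simp only [vinetPressure, Pi.mul_apply]
  refine ⟨_, h2, ?_⟩
  have hV' : V ≠ 0 := hV.ne'
  set e := exp (vinetEta B₀' * (1 - x)) with hedef
  push_cast
  field_simp
  ring

/-- `K(V₀) = B₀` for the Vinet form. [cite: CohenGulserenHemley2000, eq. (4)] -/
theorem vinet_bulkModulus_self {V₀ : ℝ} (hV₀ : 0 < V₀) (B₀ B₀' : ℝ) :
    ∃ P' : ℝ, HasDerivAt (vinetPressure V₀ B₀ B₀') P' V₀ ∧ -V₀ * P' = B₀ := by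
  obtain ⟨P', hP', hK⟩ := vinet_bulkModulus hV₀ hV₀ B₀ B₀'
  refine ⟨P', hP', ?_⟩
  rw [hK, vinetX_self hV₀]
  simp


/-! ## The meaning of `B₀'` and the inverse Murnaghan law

`B₀'` enters all three parametrisations as *the pressure derivative of the bulk modulus at zero
pressure*, `K₀' = (dK/dP)_{P=0}` [cite: Poirier1991, §4.2 (text before eq. (4.6)), §4.3.2
eq. (4.39)].  For the Murnaghan form this is the defining linear law (proved above as
`murnaghan_bulkModulus_linear`); for the Birch–Murnaghan and Vinet closed forms of `K(V)` it is a
theorem: `dK/dV|_{V₀} = B₀' · dP/dV|_{V₀}` (chain rule, `dP/dV|_{V₀} = -B₀/V₀ ≠ 0`), i.e.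
`dK/dP = B₀'` at `P = 0`.  The Murnaghan law also inverts in closed form, `V(P)`
[cite: Poirier1991, §4.2 eq. (4.7)], which is the relation used to propagate a printed
`(B₀, B₀')` pair to a volume at pressure. -/

/-- MURNAGHAN VOLUME–PRESSURE RELATION (inverse of eq. (4.6)):
`V(P) = V₀ (1 + B₀' P / B₀)^{-1/B₀'}`, i.e. `ρ = ρ₀ (1 + K₀' P / K₀)^{1/K₀'}`.
[cite: Poirier1991, §4.2 eq. (4.7)] -/
def murnaghanVolume (V₀ B₀ B₀' P : ℝ) : ℝ := V₀ * (1 + B₀' * P / B₀) ^ (-(1 / B₀'))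

/-- `V(0) = V₀` for the inverse Murnaghan law. [cite: Poirier1991, §4.2 eq. (4.7)] -/
theorem murnaghanVolume_zero (V₀ B₀ B₀' : ℝ) : murnaghanVolume V₀ B₀ B₀' 0 = V₀ := by
  simp [murnaghanVolume]

/-- (4.7) INVERTS (4.6) ON THE RIGHT: `P(V(P)) = P` whenever `1 + B₀' P / B₀ > 0`
(`V₀ > 0`, `B₀ ≠ 0`, `B₀' ≠ 0`). [cite: Poirier1991, §4.2 eqs. (4.6)–(4.7)] -/
theorem murnaghanPressure_murnaghanVolume {V₀ B₀ B₀' P : ℝ} (hV₀ : 0 < V₀) (hB₀ : B₀ ≠ 0)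
    (hB : B₀' ≠ 0) (hy : 0 < 1 + B₀' * P / B₀) :
    murnaghanPressure V₀ B₀ B₀' (murnaghanVolume V₀ B₀ B₀' P) = P := by
  unfold murnaghanPressure murnaghanVolume
  have h1 : V₀ / (V₀ * (1 + B₀' * P / B₀) ^ (-(1 / B₀'))) = (1 + B₀' * P / B₀) ^ (1 / B₀') := by
    rw [div_mul_eq_div_div, div_self hV₀.ne', Real.rpow_neg hy.le, one_div (((1 + B₀' * P / B₀)
      ^ (1 / B₀'))⁻¹), inv_inv]
  rw [h1, ← Real.rpow_mul hy.le, one_div_mul_cancel hB, Real.rpow_one]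
  field_simp
  ring

/-- (4.7) INVERTS (4.6) ON THE LEFT: `V(P(V)) = V` for every `V > 0`
(`V₀ > 0`, `B₀ ≠ 0`, `B₀' ≠ 0`). [cite: Poirier1991, §4.2 eqs. (4.6)–(4.7)] -/
theorem murnaghanVolume_murnaghanPressure {V₀ B₀ B₀' V : ℝ} (hV₀ : 0 < V₀) (hV : 0 < V)
    (hB₀ : B₀ ≠ 0) (hB : B₀' ≠ 0) :
    murnaghanVolume V₀ B₀ B₀' (murnaghanPressure V₀ B₀ B₀' V) = V := by
  have hr : 0 < V₀ / V := div_pos hV₀ hV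
  unfold murnaghanPressure murnaghanVolume
  have h1 : 1 + B₀' * (B₀ / B₀' * ((V₀ / V) ^ B₀' - 1)) / B₀ = (V₀ / V) ^ B₀' := by
    field_simp
    ring
  rw [h1, ← Real.rpow_mul hr.le, mul_neg, mul_one_div_cancel hB, Real.rpow_neg_one, inv_div]
  field_simp

/-- MURNAGHAN: `dK/dV = B₀' · dP/dV` at every `V > 0` (so `dK/dP ≡ B₀'` identically), where
`K(V) = B₀ + B₀' P(V)` is the bulk modulus of `murnaghan_bulkModulus_linear`.
[cite: Poirier1991, §4.2 eqs. (4.4), (4.8)] -/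
theorem murnaghan_bulkModulus_hasDerivAt {V₀ B₀' V : ℝ} (hV₀ : 0 < V₀) (hV : 0 < V) (hB : B₀' ≠ 0)
    (B₀ : ℝ) :
    ∃ P' : ℝ, HasDerivAt (murnaghanPressure V₀ B₀ B₀') P' V ∧
      HasDerivAt (fun W => B₀ + B₀' * murnaghanPressure V₀ B₀ B₀' W) (B₀' * P') V :=
  ⟨_, hasDerivAt_murnaghanPressure hV₀ hV hB B₀,
    ((hasDerivAt_murnaghanPressure hV₀ hV hB B₀).const_mul B₀').const_add B₀⟩

/-- BIRCH–MURNAGHAN (third order): the closed-form bulk modulus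
`K(V) = B₀ q⁵ [ 1 + 7f + (3/2)(B₀'-4) f (2 + 9f) ]` of `birchMurnaghan3_bulkModulus` has
`dK/dV|_{V₀} = -B₀ B₀' / V₀`. [cite: Poirier1991, §4.3.2 eq. (4.39), §4.3.3 eqs. (4.40)–(4.42)] -/
theorem birchMurnaghan3_bulkModulus_hasDerivAt_self {V₀ : ℝ} (hV₀ : 0 < V₀) (B₀ B₀' : ℝ) :
    HasDerivAt (fun V => B₀ * cubeRootRatio V₀ V ^ 5 *
        (1 + 7 * eulerianStrain V₀ V +
          3 / 2 * (B₀' - 4) * eulerianStrain V₀ V * (2 + 9 * eulerianStrain V₀ V)))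
      (-(B₀ * B₀') / V₀) V₀ := by
  have hf := hasDerivAt_eulerianStrain hV₀ hV₀
  have hq := hasDerivAt_cubeRootRatio hV₀ hV₀
  have h := ((hq.pow 5).const_mul B₀).mul
    (((hf.const_mul 7).const_add 1).add
      ((hf.const_mul (3 / 2 * (B₀' - 4))).mul ((hf.const_mul 9).const_add 2)))
  refine h.congr_deriv ?_
  simp only [Pi.add_apply, Pi.mul_apply, Pi.pow_apply, cubeRootRatio_self hV₀,
    eulerianStrain_self hV₀]
  push_cast
  field_simp
  ring

/-- `B₀'` IS `(dK/dP)_{P=0}` FOR THE THIRD-ORDER BIRCH–MURNAGHAN FORM: at `V₀` the pressure has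
derivative `P'` with `-V₀ P' = B₀`, the closed-form bulk modulus has derivative `K'`, and
`K' = B₀' P'` (chain rule: `dK/dP = K'/P' = B₀'`, `P' ≠ 0` for `B₀ ≠ 0`).
[cite: Poirier1991, §4.3.2 eq. (4.39), §4.3.3] -/
theorem birchMurnaghan3_Bprime_eq_dK_dP {V₀ : ℝ} (hV₀ : 0 < V₀) (B₀ B₀' : ℝ) :
    ∃ P' K' : ℝ, HasDerivAt (birchMurnaghan3Pressure V₀ B₀ B₀') P' V₀ ∧ -V₀ * P' = B₀ ∧
      HasDerivAt (fun V => B₀ * cubeRootRatio V₀ V ^ 5 *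
          (1 + 7 * eulerianStrain V₀ V +
            3 / 2 * (B₀' - 4) * eulerianStrain V₀ V * (2 + 9 * eulerianStrain V₀ V))) K' V₀ ∧
      K' = B₀' * P' := by
  obtain ⟨P', hP', hK⟩ := birchMurnaghan3_bulkModulus_self hV₀ B₀ B₀'
  refine ⟨P', _, hP', hK, birchMurnaghan3_bulkModulus_hasDerivAt_self hV₀ B₀ B₀', ?_⟩
  have hP'eq : P' = -(B₀ / V₀) := by
    field_simp
    linarith [hK]
  rw [hP'eq]
  field_simp

/-- VINET: the closed-form bulk modulus
`K(V) = B₀ x^{-2} [ 1 + (η x + 1)(1 - x) ] e^{η(1-x)}` of `vinet_bulkModulus` has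
`dK/dV|_{V₀} = -B₀ B₀' / V₀` (`η = (3/2)(B₀' - 1)`).
[cite: CohenGulserenHemley2000, eq. (4) (B₀' defined as the zero-pressure `dK/dP`)] -/
theorem vinet_bulkModulus_hasDerivAt_self {V₀ : ℝ} (hV₀ : 0 < V₀) (B₀ B₀' : ℝ) :
    HasDerivAt (fun V => B₀ / vinetX V₀ V ^ 2 *
        (1 + (vinetEta B₀' * vinetX V₀ V + 1) * (1 - vinetX V₀ V)) *
          exp (vinetEta B₀' * (1 - vinetX V₀ V)))
      (-(B₀ * B₀') / V₀) V₀ := by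
  have hx := hasDerivAt_vinetX hV₀ hV₀
  have hx1 : vinetX V₀ V₀ = 1 := vinetX_self hV₀
  have ha := (hasDerivAt_const V₀ B₀).div (hx.pow 2) (by simp [hx1])
  have hb := (((hx.const_mul (vinetEta B₀')).add_const 1).mul (hx.const_sub 1)).const_add 1
  have hc := ((hx.const_sub 1).const_mul (vinetEta B₀')).exp
  have h := (ha.mul hb).mul hc
  refine h.congr_deriv ?_
  simp only [Pi.mul_apply, Pi.pow_apply, Pi.div_apply, hx1, one_pow, mul_one, sub_self,
    mul_zero, Real.exp_zero, vinetEta]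
  push_cast
  field_simp
  ring

/-- `B₀'` IS `(dK/dP)_{P=0}` FOR THE VINET FORM: at `V₀` the pressure has derivative `P'` with
`-V₀ P' = B₀`, the closed-form bulk modulus has derivative `K'`, and `K' = B₀' P'`.
[cite: CohenGulserenHemley2000, eq. (4)] -/
theorem vinet_Bprime_eq_dK_dP {V₀ : ℝ} (hV₀ : 0 < V₀) (B₀ B₀' : ℝ) :
    ∃ P' K' : ℝ, HasDerivAt (vinetPressure V₀ B₀ B₀') P' V₀ ∧ -V₀ * P' = B₀ ∧
      HasDerivAt (fun V => B₀ / vinetX V₀ V ^ 2 *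
          (1 + (vinetEta B₀' * vinetX V₀ V + 1) * (1 - vinetX V₀ V)) *
            exp (vinetEta B₀' * (1 - vinetX V₀ V))) K' V₀ ∧
      K' = B₀' * P' := by
  obtain ⟨P', hP', hK⟩ := vinet_bulkModulus_self hV₀ B₀ B₀'
  refine ⟨P', _, hP', hK, vinet_bulkModulus_hasDerivAt_self hV₀ B₀ B₀', ?_⟩
  have hP'eq : P' = -(B₀ / V₀) := by
    field_simp
    linarith [hK]
  rw [hP'eq]
  field_simp

/-! ## Comparator intervals: monotonicity of the inverse Murnaghan law

A printed `(V₀, B₀, B₀')` triple with stated uncertainties — or a pressure known only up to a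
gauge interval — is propagated to a VOLUME INTERVAL at pressure `P` by evaluating the inverse
Murnaghan law `V(P) = V₀ (1 + B₀' P / B₀)^{-1/B₀'}` [cite: Poirier1991, §4.2 eq. (4.7)] at the two
extreme corners of the parameter box.  The corner rule is exact because, on the physical domain
`V₀ ≥ 0`, `B₀ > 0`, `B₀' > 0`, `P ≥ 0`, the map is antitone in `P`, monotone in `B₀` and monotone
in `B₀'`; the last uses Bernoulli's inequality `(1 + s)^p ≤ 1 + p s` (`0 ≤ p ≤ 1`, `s ≥ -1`).
These are elementary consequences of the printed law (no new facts). -/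

/-- The base `1 + B₀' P / B₀` of the inverse Murnaghan law is at least `1` on the physical
domain `B₀ > 0`, `B₀' ≥ 0`, `P ≥ 0`. [folklore] -/
private lemma one_le_murnaghanBase {B₀ B₀' P : ℝ} (hB₀ : 0 < B₀) (hB : 0 ≤ B₀') (hP : 0 ≤ P) :
    1 ≤ 1 + B₀' * P / B₀ := by
  have : 0 ≤ B₀' * P / B₀ := div_nonneg (mul_nonneg hB hP) hB₀.le
  linarith

/-- `V(P) > 0` whenever `V₀ > 0` and the base `1 + B₀' P / B₀` is positive.
[cite: Poirier1991, §4.2 eq. (4.7)] -/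
theorem murnaghanVolume_pos {V₀ B₀ B₀' P : ℝ} (hV₀ : 0 < V₀) (hy : 0 < 1 + B₀' * P / B₀) :
    0 < murnaghanVolume V₀ B₀ B₀' P :=
  mul_pos hV₀ (Real.rpow_pos_of_pos hy _)

/-- The relative compression `V(P)/V₀ = (1 + B₀' P / B₀)^{-1/B₀'}` does not depend on `V₀`:
`V(P; V₀) = V₀ · V(P; 1)`. [cite: Poirier1991, §4.2 eq. (4.7)] -/
theorem murnaghanVolume_eq_mul_unit (V₀ B₀ B₀' P : ℝ) :
    murnaghanVolume V₀ B₀ B₀' P = V₀ * murnaghanVolume 1 B₀ B₀' P := by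
  simp [murnaghanVolume]

/-- COMPRESSION: `V(P) ≤ V₀` for `P ≥ 0` (`V₀ ≥ 0`, `B₀ > 0`, `B₀' > 0`).
[cite: Poirier1991, §4.2 eq. (4.7)] -/
theorem murnaghanVolume_le_self {V₀ B₀ B₀' P : ℝ} (hV₀ : 0 ≤ V₀) (hB₀ : 0 < B₀) (hB : 0 < B₀')
    (hP : 0 ≤ P) : murnaghanVolume V₀ B₀ B₀' P ≤ V₀ := by
  unfold murnaghanVolume
  have h1 : 1 ≤ 1 + B₀' * P / B₀ := one_le_murnaghanBase hB₀ hB.le hP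
  have he : -(1 / B₀') ≤ 0 := by
    have : 0 < 1 / B₀' := one_div_pos.mpr hB
    linarith
  have h2 : (1 + B₀' * P / B₀) ^ (-(1 / B₀')) ≤ 1 := Real.rpow_le_one_of_one_le_of_nonpos h1 he
  exact mul_le_of_le_one_right hV₀ h2

/-- ANTITONE IN PRESSURE: `P₁ ≤ P₂ ⇒ V(P₂) ≤ V(P₁)` (`V₀ ≥ 0`, `B₀ > 0`, `B₀' > 0`, `P₁ ≥ 0`).
[cite: Poirier1991, §4.2 eq. (4.7)] -/
theorem murnaghanVolume_antitone_pressure {V₀ B₀ B₀' P₁ P₂ : ℝ} (hV₀ : 0 ≤ V₀) (hB₀ : 0 < B₀)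
    (hB : 0 < B₀') (hP₁ : 0 ≤ P₁) (hP : P₁ ≤ P₂) :
    murnaghanVolume V₀ B₀ B₀' P₂ ≤ murnaghanVolume V₀ B₀ B₀' P₁ := by
  unfold murnaghanVolume
  have h1 : 0 < 1 + B₀' * P₁ / B₀ := lt_of_lt_of_le one_pos (one_le_murnaghanBase hB₀ hB.le hP₁)
  have h12 : 1 + B₀' * P₁ / B₀ ≤ 1 + B₀' * P₂ / B₀ := by
    have : B₀' * P₁ / B₀ ≤ B₀' * P₂ / B₀ :=
      div_le_div_of_nonneg_right (mul_le_mul_of_nonneg_left hP hB.le) hB₀.le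
    linarith
  have he : -(1 / B₀') ≤ 0 := by
    have : 0 < 1 / B₀' := one_div_pos.mpr hB
    linarith
  exact mul_le_mul_of_nonneg_left (Real.rpow_le_rpow_of_nonpos h1 h12 he) hV₀

/-- MONOTONE IN THE BULK MODULUS: `B₁ ≤ B₂ ⇒ V(P; B₁) ≤ V(P; B₂)` at fixed `P ≥ 0`, `B₀' > 0`
(`0 < B₁`, `V₀ ≥ 0`): a stiffer solid is compressed less. [cite: Poirier1991, §4.2 eq. (4.7)] -/
theorem murnaghanVolume_mono_bulkModulus {V₀ B₁ B₂ B₀' P : ℝ} (hV₀ : 0 ≤ V₀) (hB₁ : 0 < B₁)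
    (hB12 : B₁ ≤ B₂) (hB : 0 < B₀') (hP : 0 ≤ P) :
    murnaghanVolume V₀ B₁ B₀' P ≤ murnaghanVolume V₀ B₂ B₀' P := by
  unfold murnaghanVolume
  have hB₂ : 0 < B₂ := lt_of_lt_of_le hB₁ hB12
  have h2 : 0 < 1 + B₀' * P / B₂ := lt_of_lt_of_le one_pos (one_le_murnaghanBase hB₂ hB.le hP)
  have h21 : 1 + B₀' * P / B₂ ≤ 1 + B₀' * P / B₁ := by
    have : B₀' * P / B₂ ≤ B₀' * P / B₁ :=
      div_le_div_of_nonneg_left (mul_nonneg hB.le hP) hB₁ hB12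
    linarith
  have he : -(1 / B₀') ≤ 0 := by
    have : 0 < 1 / B₀' := one_div_pos.mpr hB
    linarith
  exact mul_le_mul_of_nonneg_left (Real.rpow_le_rpow_of_nonpos h2 h21 he) hV₀

/-- MONOTONE IN `B₀'`: `b₁ ≤ b₂ ⇒ V(P; B₀' = b₁) ≤ V(P; B₀' = b₂)` at fixed `P ≥ 0`, `B₀ > 0`
(`0 < b₁`, `V₀ ≥ 0`): a modulus that stiffens faster with pressure compresses less.  Proof:
Bernoulli `(1 + b₂ u)^{b₁/b₂} ≤ 1 + b₁ u` with `u = P/B₀ ≥ 0`, then raise to the power `1/b₁`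
and invert. [cite: Poirier1991, §4.2 eq. (4.7)] -/
theorem murnaghanVolume_mono_Bprime {V₀ B₀ b₁ b₂ P : ℝ} (hV₀ : 0 ≤ V₀) (hB₀ : 0 < B₀)
    (hb₁ : 0 < b₁) (hb12 : b₁ ≤ b₂) (hP : 0 ≤ P) :
    murnaghanVolume V₀ B₀ b₁ P ≤ murnaghanVolume V₀ B₀ b₂ P := by
  unfold murnaghanVolume
  have hb₂ : 0 < b₂ := lt_of_lt_of_le hb₁ hb12
  set u : ℝ := P / B₀ with hu
  have hu0 : 0 ≤ u := div_nonneg hP hB₀.le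
  have hx₁ : 1 + b₁ * P / B₀ = 1 + b₁ * u := by rw [hu, mul_div_assoc]
  have hx₂ : 1 + b₂ * P / B₀ = 1 + b₂ * u := by rw [hu, mul_div_assoc]
  rw [hx₁, hx₂]
  have hy₁ : 0 < 1 + b₁ * u := by nlinarith
  have hy₂ : 0 < 1 + b₂ * u := by nlinarith
  -- Bernoulli: (1 + b₂ u)^{b₁/b₂} ≤ 1 + (b₁/b₂)(b₂ u) = 1 + b₁ u
  have hp0 : 0 ≤ b₁ / b₂ := div_nonneg hb₁.le hb₂.le
  have hp1 : b₁ / b₂ ≤ 1 := (div_le_one hb₂).mpr hb12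
  have hs : (-1 : ℝ) ≤ b₂ * u := by nlinarith
  have hbern : (1 + b₂ * u) ^ (b₁ / b₂) ≤ 1 + b₁ * u := by
    have h := rpow_one_add_le_one_add_mul_self hs hp0 hp1
    have heq : b₁ / b₂ * (b₂ * u) = b₁ * u := by
      field_simp
    rw [heq] at h
    exact h
  -- raise both sides to the power 1/b₁ ≥ 0
  have hA : (1 + b₂ * u) ^ (1 / b₂) ≤ (1 + b₁ * u) ^ (1 / b₁) := by
    have h := Real.rpow_le_rpow (Real.rpow_nonneg hy₂.le _) hbern (one_div_pos.mpr hb₁).le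
    rw [← Real.rpow_mul hy₂.le] at h
    have hexp : b₁ / b₂ * (1 / b₁) = 1 / b₂ := by
      field_simp
    rw [hexp] at h
    exact h
  have hApos : 0 < (1 + b₂ * u) ^ (1 / b₂) := Real.rpow_pos_of_pos hy₂ _
  -- invert
  have hinv : ((1 + b₁ * u) ^ (1 / b₁))⁻¹ ≤ ((1 + b₂ * u) ^ (1 / b₂))⁻¹ :=
    inv_anti₀ hApos hA
  rw [Real.rpow_neg hy₁.le, Real.rpow_neg hy₂.le]
  exact mul_le_mul_of_nonneg_left hinv hV₀

/-- THE CORNER RULE FOR COMPARATOR INTERVALS: on the physical domain, if `P ∈ [P_lo, P_hi]`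
(`P_lo ≥ 0`), `B₀ ∈ [B_lo, B_hi]` (`B_lo > 0`) and `B₀' ∈ [b_lo, b_hi]` (`b_lo > 0`), then
`V(P; B₀, B₀')` lies between the two corner values `V(P_hi; B_lo, b_lo)` and `V(P_lo; B_hi, b_hi)`
(both of which are attained, so the interval is sharp).  This is the exact content of quoting a
volume-at-pressure comparator as the interval spanned by the extreme admissible `(B₀, B₀', P)`.
[cite: Poirier1991, §4.2 eq. (4.7)] -/
theorem murnaghanVolume_mem_Icc_of_box {V₀ P Plo Phi B₀ Blo Bhi B₀' blo bhi : ℝ} (hV₀ : 0 ≤ V₀)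
    (hPlo : 0 ≤ Plo) (hBlo : 0 < Blo) (hblo : 0 < blo) (hP : P ∈ Icc Plo Phi)
    (hB : B₀ ∈ Icc Blo Bhi) (hb : B₀' ∈ Icc blo bhi) :
    murnaghanVolume V₀ B₀ B₀' P ∈
      Icc (murnaghanVolume V₀ Blo blo Phi) (murnaghanVolume V₀ Bhi bhi Plo) := by
  obtain ⟨hP1, hP2⟩ := hP
  obtain ⟨hB1, hB2⟩ := hB
  obtain ⟨hb1, hb2⟩ := hb
  have hP0 : 0 ≤ P := le_trans hPlo hP1
  have hB₀ : 0 < B₀ := lt_of_lt_of_le hBlo hB1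
  have hB₀' : 0 < B₀' := lt_of_lt_of_le hblo hb1
  have hBhi : 0 < Bhi := lt_of_lt_of_le hB₀ hB2
  have hbhi : 0 < bhi := lt_of_lt_of_le hB₀' hb2
  refine ⟨?_, ?_⟩
  · calc murnaghanVolume V₀ Blo blo Phi
        ≤ murnaghanVolume V₀ Blo blo P := murnaghanVolume_antitone_pressure hV₀ hBlo hblo hP0 hP2
      _ ≤ murnaghanVolume V₀ B₀ blo P := murnaghanVolume_mono_bulkModulus hV₀ hBlo hB1 hblo hP0
      _ ≤ murnaghanVolume V₀ B₀ B₀' P := murnaghanVolume_mono_Bprime hV₀ hB₀ hblo hb1 hP0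
  · calc murnaghanVolume V₀ B₀ B₀' P
        ≤ murnaghanVolume V₀ Bhi B₀' P := murnaghanVolume_mono_bulkModulus hV₀ hB₀ hB2 hB₀' hP0
      _ ≤ murnaghanVolume V₀ Bhi bhi P := murnaghanVolume_mono_Bprime hV₀ hBhi hB₀' hb2 hP0
      _ ≤ murnaghanVolume V₀ Bhi bhi Plo := murnaghanVolume_antitone_pressure hV₀ hBhi hbhi hPlo hP1

/-- RESTART (SELF-SIMILARITY) PROPERTY OF THE MURNAGHAN LAW: re-referencing the equation of state
at any pressure `P₁` of the physical domain — reference volume `V(P₁)`, reference bulk modulus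
`K(P₁) = B₀ + B₀' P₁` (the linear law `murnaghan_bulkModulus_linear`), same `B₀'` — reproduces the
same volume at every `P₂`: `V(P₂) = V(P₁) · (1 + B₀' (P₂ - P₁)/(B₀ + B₀' P₁))^{-1/B₀'}`.  This is the
identity used to step a printed `V(P₁)` to a nearby pressure with the local modulus.
(`B₀ > 0`, `B₀' ≥ 0`, `P₁, P₂ ≥ 0`.) [cite: Poirier1991, §4.2 eqs. (4.4), (4.7)] -/
theorem murnaghanVolume_restart {V₀ B₀ B₀' P₁ P₂ : ℝ} (hB₀ : 0 < B₀) (hB : 0 ≤ B₀')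
    (hP₁ : 0 ≤ P₁) (hP₂ : 0 ≤ P₂) :
    murnaghanVolume V₀ B₀ B₀' P₂ =
      murnaghanVolume (murnaghanVolume V₀ B₀ B₀' P₁) (B₀ + B₀' * P₁) B₀' (P₂ - P₁) := by
  unfold murnaghanVolume
  have hK₁ : 0 < B₀ + B₀' * P₁ := by nlinarith [mul_nonneg hB hP₁]
  have hx : 0 ≤ 1 + B₀' * P₁ / B₀ := by
    have : 0 ≤ B₀' * P₁ / B₀ := div_nonneg (mul_nonneg hB hP₁) hB₀.le
    linarith
  have hy : 0 ≤ 1 + B₀' * (P₂ - P₁) / (B₀ + B₀' * P₁) := by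
    have h : 1 + B₀' * (P₂ - P₁) / (B₀ + B₀' * P₁) = (B₀ + B₀' * P₂) / (B₀ + B₀' * P₁) := by
      field_simp
      ring
    rw [h]
    exact div_nonneg (by nlinarith [mul_nonneg hB hP₂]) hK₁.le
  have hxy : (1 + B₀' * P₁ / B₀) * (1 + B₀' * (P₂ - P₁) / (B₀ + B₀' * P₁)) = 1 + B₀' * P₂ / B₀ := by
    field_simp
    ring
  rw [mul_assoc, ← Real.mul_rpow hx hy, hxy]

/-! ## Comparator intervals II: the inverse Vinet law

The Vinet law has no closed-form inverse.  Writing `P = 3 B₀ g_η(x)` with the dimensionless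
shape `g_η(x) = (1 - x) x⁻² e^{η (1 - x)}`, `x = (V/V₀)^{1/3}`, `η = (3/2)(B₀' - 1)`
[cite: CohenGulserenHemley2000, eq. (4)], the shape is continuous and STRICTLY DECREASING on the
compression range `0 < x ≤ 1` whenever `η ≥ 0` (i.e. `B₀' ≥ 1`), vanishes at `x = 1` and is
unbounded as `x → 0⁺`; hence for every `P ≥ 0` (and `B₀ > 0`) there is exactly one volume
`V(P) ∈ (0, V₀]` with `P(V(P)) = P`.  We define `vinetVolume` as that root and prove the same
package as for Murnaghan: `P(V(P)) = P`, `V(P(V)) = V`, `0 < V(P) ≤ V₀`, antitone in `P`,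
monotone in `B₀`, monotone in `B₀'`, whence the exact CORNER RULE `vinetVolume_mem_Icc_of_box`
for Vinet-fitted comparators (a printed `(V₀, B₀, B₀')` box, a pressure known up to a gauge
interval).  Elementary consequences of the printed law (no new facts); the standing hypothesis
`B₀' ≥ 1` is exactly where the argument uses that `e^{η(1-x)}` decreases in `x` and increases
in `η` on `x ≤ 1`. -/

/-- The dimensionless VINET PRESSURE SHAPE `g_η(x) = (1 - x) x⁻² e^{η (1 - x)}`, so that
`P(V) = 3 B₀ · g_η((V/V₀)^{1/3})` with `η = (3/2)(B₀' - 1)`.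
[cite: CohenGulserenHemley2000, eq. (4)] -/
def vinetShape (η x : ℝ) : ℝ := (1 - x) / x ^ 2 * exp (η * (1 - x))

/-- `P(V) = 3 B₀ g_η(x)`, `x = (V/V₀)^{1/3}`. [cite: CohenGulserenHemley2000, eq. (4)] -/
theorem vinetPressure_eq_shape (V₀ B₀ B₀' V : ℝ) :
    vinetPressure V₀ B₀ B₀' V = 3 * B₀ * vinetShape (vinetEta B₀') (vinetX V₀ V) := by
  unfold vinetPressure vinetShape
  ring

/-- `g_η(1) = 0` (zero pressure at `V = V₀`). [cite: CohenGulserenHemley2000, eq. (4)] -/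
theorem vinetShape_one (η : ℝ) : vinetShape η 1 = 0 := by
  simp [vinetShape]

/-- `g_η(x) ≥ 0` on the compression range `x ≤ 1`.
[cite: CohenGulserenHemley2000, eq. (4) (elementary consequence)] -/
theorem vinetShape_nonneg {x : ℝ} (hx : x ≤ 1) (η : ℝ) : 0 ≤ vinetShape η x :=
  mul_nonneg (div_nonneg (sub_nonneg.mpr hx) (sq_nonneg x)) (exp_pos _).le

/-- `g_η(x) > 0` for `x < 1`, `x ≠ 0` (compression gives positive pressure).
[cite: CohenGulserenHemley2000, eq. (4) (elementary consequence)] -/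
theorem vinetShape_pos {x : ℝ} (hx0 : x ≠ 0) (hx : x < 1) (η : ℝ) : 0 < vinetShape η x :=
  mul_pos (div_pos (sub_pos.mpr hx) (by positivity)) (exp_pos _)

/-- `g_η(x) < 0` for `x > 1` (expansion gives negative pressure).
[cite: CohenGulserenHemley2000, eq. (4) (elementary consequence)] -/
theorem vinetShape_neg {x : ℝ} (hx : 1 < x) (η : ℝ) : vinetShape η x < 0 :=
  mul_neg_of_neg_of_pos (div_neg_of_neg_of_pos (sub_neg.mpr hx) (by positivity)) (exp_pos _)

/-- MONOTONE IN `η` ON THE COMPRESSION RANGE: `x ≤ 1`, `η₁ ≤ η₂ ⇒ g_{η₁}(x) ≤ g_{η₂}(x)`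
(a larger `B₀'` gives a larger pressure at the same compression).
[cite: CohenGulserenHemley2000, eq. (4) (elementary consequence)] -/
theorem vinetShape_mono_eta {η₁ η₂ x : ℝ} (hx : x ≤ 1) (hη : η₁ ≤ η₂) :
    vinetShape η₁ x ≤ vinetShape η₂ x := by
  unfold vinetShape
  have h1 : 0 ≤ (1 - x) / x ^ 2 := div_nonneg (sub_nonneg.mpr hx) (sq_nonneg x)
  have h2 : exp (η₁ * (1 - x)) ≤ exp (η₂ * (1 - x)) :=
    exp_le_exp.mpr (mul_le_mul_of_nonneg_right hη (sub_nonneg.mpr hx))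
  exact mul_le_mul_of_nonneg_left h2 h1

/-- THE VINET PRESSURE SHAPE IS STRICTLY DECREASING ON `0 < x ≤ 1` WHEN `η ≥ 0`:
`(1 - x) x⁻²` is strictly decreasing and nonnegative there and `e^{η(1-x)}` is positive and
decreasing. [cite: CohenGulserenHemley2000, eq. (4) (elementary consequence)] -/
theorem vinetShape_strictAntiOn {η : ℝ} (hη : 0 ≤ η) : StrictAntiOn (vinetShape η) (Ioc 0 1) := by
  intro x₁ hx₁ x₂ hx₂ hlt
  obtain ⟨h1pos, h1le⟩ := hx₁
  obtain ⟨h2pos, h2le⟩ := hx₂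
  have hA : (1 - x₂) / x₂ ^ 2 < (1 - x₁) / x₁ ^ 2 := by
    rw [div_lt_div_iff₀ (by positivity) (by positivity)]
    have key : (1 - x₁) * x₂ ^ 2 - (1 - x₂) * x₁ ^ 2 = (x₂ - x₁) * (x₁ + x₂ * (1 - x₁)) := by
      ring
    have hfac : 0 < x₁ + x₂ * (1 - x₁) := by
      have := mul_nonneg h2pos.le (sub_nonneg.mpr h1le)
      linarith
    have hpos : 0 < (x₂ - x₁) * (x₁ + x₂ * (1 - x₁)) := mul_pos (sub_pos.mpr hlt) hfac
    linarith
  have hA₂ : 0 ≤ (1 - x₂) / x₂ ^ 2 := div_nonneg (sub_nonneg.mpr h2le) (sq_nonneg x₂)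
  have hE : exp (η * (1 - x₂)) ≤ exp (η * (1 - x₁)) :=
    exp_le_exp.mpr (mul_le_mul_of_nonneg_left (by linarith) hη)
  have hE₁ : 0 < exp (η * (1 - x₁)) := exp_pos _
  show (1 - x₂) / x₂ ^ 2 * exp (η * (1 - x₂)) < (1 - x₁) / x₁ ^ 2 * exp (η * (1 - x₁))
  calc (1 - x₂) / x₂ ^ 2 * exp (η * (1 - x₂))
      ≤ (1 - x₂) / x₂ ^ 2 * exp (η * (1 - x₁)) := mul_le_mul_of_nonneg_left hE hA₂
    _ < (1 - x₁) / x₁ ^ 2 * exp (η * (1 - x₁)) := mul_lt_mul_of_pos_right hA hE₁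

/-- Continuity of the shape on `[a, 1]`, `a > 0`. [folklore] -/
private lemma vinetShape_continuousOn (η : ℝ) {a : ℝ} (ha : 0 < a) :
    ContinuousOn (vinetShape η) (Icc a 1) := by
  have h : ∀ x ∈ Icc a 1, x ^ 2 ≠ 0 := fun x hx => pow_ne_zero 2 (lt_of_lt_of_le ha hx.1).ne'
  show ContinuousOn (fun x => (1 - x) / x ^ 2 * exp (η * (1 - x))) (Icc a 1)
  refine ContinuousOn.mul ?_ ?_
  · exact (continuousOn_const.sub continuousOn_id).div (continuousOn_id.pow 2) h
  · exact (continuous_exp.comp (continuous_const.mul (continuous_const.sub continuous_id))).continuousOn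

/-- EXISTENCE OF THE COMPRESSION ROOT: for `η ≥ 0` and `p ≥ 0` there is `x ∈ (0, 1]` with
`g_η(x) = p` (intermediate value theorem on `[a, 1]` with `a = 1/(2(p+1))`, where
`g_η(a) ≥ (1-a)/a² ≥ p` and `g_η(1) = 0`).
[cite: CohenGulserenHemley2000, eq. (4) (elementary consequence)] -/
theorem exists_vinetShape_eq {η p : ℝ} (hη : 0 ≤ η) (hp : 0 ≤ p) :
    ∃ x ∈ Ioc (0 : ℝ) 1, vinetShape η x = p := by
  set a : ℝ := 1 / (2 * (p + 1)) with ha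
  have hp1 : 0 < p + 1 := by linarith
  have ha0 : 0 < a := by rw [ha]; positivity
  have hdef : a * (2 * (p + 1)) = 1 := by rw [ha]; field_simp
  have hdef' : 2 * a * p + 2 * a = 1 := by linarith [hdef]
  have hap : 0 ≤ a * p := mul_nonneg ha0.le hp
  have ha2 : 2 * a ≤ 1 := by nlinarith
  have hpa : p * a ≤ 1 / 2 := by nlinarith
  have ha1 : a ≤ 1 := by linarith
  have hga : p ≤ vinetShape η a := by
    have h1 : 1 ≤ exp (η * (1 - a)) := one_le_exp (mul_nonneg hη (by linarith))
    have h2 : p ≤ (1 - a) / a ^ 2 := by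
      rw [le_div_iff₀ (by positivity)]
      have h3 : p * a ^ 2 = p * a * a := by ring
      have h4 : p * a * a ≤ 1 / 2 * a := mul_le_mul_of_nonneg_right hpa ha0.le
      rw [h3]
      linarith
    have h3 : 0 ≤ (1 - a) / a ^ 2 := div_nonneg (by linarith) (sq_nonneg a)
    calc p ≤ (1 - a) / a ^ 2 := h2
      _ = (1 - a) / a ^ 2 * 1 := (mul_one _).symm
      _ ≤ (1 - a) / a ^ 2 * exp (η * (1 - a)) := mul_le_mul_of_nonneg_left h1 h3
  have hg1 : vinetShape η 1 ≤ p := by rw [vinetShape_one]; exact hp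
  obtain ⟨x, hx, hxp⟩ := intermediate_value_Icc' ha1 (vinetShape_continuousOn η ha0) ⟨hg1, hga⟩
  exact ⟨x, ⟨lt_of_lt_of_le ha0 hx.1, hx.2⟩, hxp⟩

/-- `η = (3/2)(B₀' - 1) ≥ 0` iff `B₀' ≥ 1`; the nonnegativity used throughout. [folklore] -/
private lemma vinetEta_nonneg {B₀' : ℝ} (hB : 1 ≤ B₀') : 0 ≤ vinetEta B₀' := by
  unfold vinetEta
  linarith

/-- `x = (V/V₀)^{1/3} ≤ 1` for `0 < V ≤ V₀`. [folklore] -/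
private lemma vinetX_le_one {V₀ V : ℝ} (hV₀ : 0 < V₀) (hV : 0 < V) (hle : V ≤ V₀) :
    vinetX V₀ V ≤ 1 :=
  Real.rpow_le_one (div_pos hV hV₀).le ((div_le_one hV₀).mpr hle) (by norm_num)

/-- `x = (V/V₀)^{1/3} < 1` for `0 < V < V₀`. [folklore] -/
private lemma vinetX_lt_one {V₀ V : ℝ} (hV₀ : 0 < V₀) (hV : 0 < V) (hlt : V < V₀) :
    vinetX V₀ V < 1 :=
  Real.rpow_lt_one (div_pos hV hV₀).le ((div_lt_one hV₀).mpr hlt) (by norm_num)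

/-- `1 < x = (V/V₀)^{1/3}` for `V > V₀ > 0`. [folklore] -/
private lemma one_lt_vinetX {V₀ V : ℝ} (hV₀ : 0 < V₀) (hlt : V₀ < V) : 1 < vinetX V₀ V :=
  Real.one_lt_rpow ((one_lt_div hV₀).mpr hlt) (by norm_num)

/-- `x` is strictly increasing in `V` (`V ≥ 0`, `V₀ > 0`). [folklore] -/
private lemma vinetX_lt_vinetX {V₀ V₁ V₂ : ℝ} (hV₀ : 0 < V₀) (hV₁ : 0 ≤ V₁) (hlt : V₁ < V₂) :
    vinetX V₀ V₁ < vinetX V₀ V₂ :=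
  Real.rpow_lt_rpow (div_nonneg hV₁ hV₀.le) (div_lt_div_of_pos_right hlt hV₀) (by norm_num)

/-- SIGN OF THE VINET PRESSURE: compression (`0 < V < V₀`) gives `P > 0` for `B₀ > 0`.
[cite: CohenGulserenHemley2000, eq. (4)] -/
theorem vinetPressure_pos {V₀ B₀ V : ℝ} (hV₀ : 0 < V₀) (hB₀ : 0 < B₀) (hV : 0 < V) (hlt : V < V₀)
    (B₀' : ℝ) : 0 < vinetPressure V₀ B₀ B₀' V := by
  rw [vinetPressure_eq_shape]
  exact mul_pos (by positivity)
    (vinetShape_pos (vinetX_pos hV₀ hV).ne' (vinetX_lt_one hV₀ hV hlt) _)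

/-- SIGN OF THE VINET PRESSURE: expansion (`V > V₀`) gives `P < 0` for `B₀ > 0`, so every root of
`P(V) = P ≥ 0` lies in `(0, V₀]`. [cite: CohenGulserenHemley2000, eq. (4)] -/
theorem vinetPressure_neg {V₀ B₀ V : ℝ} (hV₀ : 0 < V₀) (hB₀ : 0 < B₀) (hlt : V₀ < V) (B₀' : ℝ) :
    vinetPressure V₀ B₀ B₀' V < 0 := by
  rw [vinetPressure_eq_shape]
  exact mul_neg_of_pos_of_neg (by positivity) (vinetShape_neg (one_lt_vinetX hV₀ hlt) _)

/-- THE VINET PRESSURE IS STRICTLY DECREASING IN VOLUME ON THE COMPRESSION BRANCH `0 < V ≤ V₀`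
(`B₀ > 0`, `B₀' ≥ 1`). [cite: CohenGulserenHemley2000, eq. (4) (elementary consequence)] -/
theorem vinetPressure_strictAntiOn {V₀ B₀ B₀' : ℝ} (hV₀ : 0 < V₀) (hB₀ : 0 < B₀) (hB : 1 ≤ B₀') :
    StrictAntiOn (vinetPressure V₀ B₀ B₀') (Ioc 0 V₀) := by
  intro V₁ hV₁ V₂ hV₂ hlt
  have hx₁ : vinetX V₀ V₁ ∈ Ioc (0 : ℝ) 1 :=
    ⟨vinetX_pos hV₀ hV₁.1, vinetX_le_one hV₀ hV₁.1 hV₁.2⟩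
  have hx₂ : vinetX V₀ V₂ ∈ Ioc (0 : ℝ) 1 :=
    ⟨vinetX_pos hV₀ hV₂.1, vinetX_le_one hV₀ hV₂.1 hV₂.2⟩
  have hxlt : vinetX V₀ V₁ < vinetX V₀ V₂ := vinetX_lt_vinetX hV₀ hV₁.1.le hlt
  show vinetPressure V₀ B₀ B₀' V₂ < vinetPressure V₀ B₀ B₀' V₁
  rw [vinetPressure_eq_shape, vinetPressure_eq_shape]
  exact mul_lt_mul_of_pos_left (vinetShape_strictAntiOn (vinetEta_nonneg hB) hx₁ hx₂ hxlt)
    (by positivity)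

/-- THE VINET LINEAR COMPRESSION AT PRESSURE `P`: the (unique) `x ∈ (0, 1]` with
`3 B₀ g_η(x) = P`, `η = (3/2)(B₀' - 1)` — meaningful for `B₀ > 0`, `B₀' ≥ 1`, `P ≥ 0`
(junk value otherwise). [cite: CohenGulserenHemley2000, eq. (4) (its implicit inverse)] -/
def vinetXAtPressure (B₀ B₀' P : ℝ) : ℝ :=
  Function.invFunOn (vinetShape (vinetEta B₀')) (Ioc 0 1) (P / (3 * B₀))

/-- VINET VOLUME–PRESSURE RELATION `V(P) = V₀ · x(P)³`: the inverse of eq. (4) on the compression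
branch `0 < V ≤ V₀` (no closed form exists; defined as the root).
[cite: CohenGulserenHemley2000, eq. (4) (its implicit inverse)] -/
def vinetVolume (V₀ B₀ B₀' P : ℝ) : ℝ := V₀ * vinetXAtPressure B₀ B₀' P ^ 3

/-- Defining property of `x(P)`: `x(P) ∈ (0, 1]` and `g_η(x(P)) = P/(3B₀)` (`B₀ > 0`, `B₀' ≥ 1`,
`P ≥ 0`). [cite: CohenGulserenHemley2000, eq. (4)] -/
theorem vinetXAtPressure_spec {B₀ B₀' P : ℝ} (hB₀ : 0 < B₀) (hB : 1 ≤ B₀') (hP : 0 ≤ P) :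
    vinetXAtPressure B₀ B₀' P ∈ Ioc (0 : ℝ) 1 ∧
      vinetShape (vinetEta B₀') (vinetXAtPressure B₀ B₀' P) = P / (3 * B₀) :=
  Function.invFunOn_pos (exists_vinetShape_eq (vinetEta_nonneg hB) (div_nonneg hP (by positivity)))

/-- UNIQUENESS: any `x ∈ (0, 1]` solving `g_η(x) = P/(3B₀)` is `x(P)`.
[cite: CohenGulserenHemley2000, eq. (4) (elementary consequence)] -/
theorem vinetXAtPressure_eq_of_shape_eq {B₀ B₀' P x : ℝ} (hB₀ : 0 < B₀) (hB : 1 ≤ B₀')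
    (hP : 0 ≤ P) (hx : x ∈ Ioc (0 : ℝ) 1)
    (hshape : vinetShape (vinetEta B₀') x = P / (3 * B₀)) : vinetXAtPressure B₀ B₀' P = x := by
  obtain ⟨hmem, heq⟩ := vinetXAtPressure_spec hB₀ hB hP
  exact (vinetShape_strictAntiOn (vinetEta_nonneg hB)).injOn hmem hx (heq.trans hshape.symm)

/-- `x(V(P)) = x(P)`: the linear compression of the volume `V₀ x³` is `x` (`x ≥ 0`). [folklore] -/
private lemma vinetX_vinetVolume {V₀ B₀ B₀' P : ℝ} (hV₀ : 0 < V₀)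
    (hx : 0 ≤ vinetXAtPressure B₀ B₀' P) :
    vinetX V₀ (vinetVolume V₀ B₀ B₀' P) = vinetXAtPressure B₀ B₀' P := by
  unfold vinetX vinetVolume
  rw [mul_div_cancel_left₀ _ hV₀.ne', show ((1 : ℝ) / 3) = ((3 : ℕ) : ℝ)⁻¹ by norm_num,
    Real.pow_rpow_inv_natCast hx (by norm_num)]

/-- THE ROOT SOLVES THE EQUATION OF STATE: `P(V(P)) = P` for every `P ≥ 0`
(`V₀ > 0`, `B₀ > 0`, `B₀' ≥ 1`). [cite: CohenGulserenHemley2000, eq. (4)] -/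
theorem vinetPressure_vinetVolume {V₀ B₀ B₀' P : ℝ} (hV₀ : 0 < V₀) (hB₀ : 0 < B₀) (hB : 1 ≤ B₀')
    (hP : 0 ≤ P) : vinetPressure V₀ B₀ B₀' (vinetVolume V₀ B₀ B₀' P) = P := by
  obtain ⟨hmem, heq⟩ := vinetXAtPressure_spec hB₀ hB hP
  rw [vinetPressure_eq_shape, vinetX_vinetVolume hV₀ hmem.1.le, heq]
  field_simp

/-- THE ROOT IS THE INVERSE ON THE COMPRESSION BRANCH: `V(P(V)) = V` for every `0 < V ≤ V₀`
(`B₀ > 0`, `B₀' ≥ 1`). [cite: CohenGulserenHemley2000, eq. (4)] -/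
theorem vinetVolume_vinetPressure {V₀ B₀ B₀' V : ℝ} (hV₀ : 0 < V₀) (hB₀ : 0 < B₀) (hB : 1 ≤ B₀')
    (hV : V ∈ Ioc 0 V₀) : vinetVolume V₀ B₀ B₀' (vinetPressure V₀ B₀ B₀' V) = V := by
  obtain ⟨hVpos, hVle⟩ := hV
  have hxmem : vinetX V₀ V ∈ Ioc (0 : ℝ) 1 := ⟨vinetX_pos hV₀ hVpos, vinetX_le_one hV₀ hVpos hVle⟩
  have hP : 0 ≤ vinetPressure V₀ B₀ B₀' V := by
    rw [vinetPressure_eq_shape]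
    exact mul_nonneg (by positivity) (vinetShape_nonneg hxmem.2 _)
  have hshape : vinetShape (vinetEta B₀') (vinetX V₀ V) = vinetPressure V₀ B₀ B₀' V / (3 * B₀) := by
    rw [vinetPressure_eq_shape]
    field_simp
  have hx : vinetXAtPressure B₀ B₀' (vinetPressure V₀ B₀ B₀' V) = vinetX V₀ V :=
    vinetXAtPressure_eq_of_shape_eq hB₀ hB hP hxmem hshape
  unfold vinetVolume
  rw [hx, vinetX_pow_three hV₀ hVpos]
  field_simp

/-- UNIQUENESS OF THE VOLUME AT PRESSURE: the only `V ∈ (0, V₀]` with `P(V) = P` is `V(P)`.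
[cite: CohenGulserenHemley2000, eq. (4) (elementary consequence)] -/
theorem eq_vinetVolume_of_vinetPressure_eq {V₀ B₀ B₀' V P : ℝ} (hV₀ : 0 < V₀) (hB₀ : 0 < B₀)
    (hB : 1 ≤ B₀') (hV : V ∈ Ioc 0 V₀) (h : vinetPressure V₀ B₀ B₀' V = P) :
    V = vinetVolume V₀ B₀ B₀' P := by
  rw [← h, vinetVolume_vinetPressure hV₀ hB₀ hB hV]

/-- `V(0) = V₀` (`B₀ > 0`, `B₀' ≥ 1`). [cite: CohenGulserenHemley2000, eq. (4)] -/
theorem vinetVolume_zero {B₀ B₀' : ℝ} (hB₀ : 0 < B₀) (hB : 1 ≤ B₀') (V₀ : ℝ) :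
    vinetVolume V₀ B₀ B₀' 0 = V₀ := by
  have hx : vinetXAtPressure B₀ B₀' 0 = 1 :=
    vinetXAtPressure_eq_of_shape_eq hB₀ hB le_rfl ⟨one_pos, le_rfl⟩ (by rw [vinetShape_one]; simp)
  simp [vinetVolume, hx]

/-- `V(P) > 0` (`V₀ > 0`, `B₀ > 0`, `B₀' ≥ 1`, `P ≥ 0`).
[cite: CohenGulserenHemley2000, eq. (4) (elementary consequence)] -/
theorem vinetVolume_pos {V₀ B₀ B₀' P : ℝ} (hV₀ : 0 < V₀) (hB₀ : 0 < B₀) (hB : 1 ≤ B₀')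
    (hP : 0 ≤ P) : 0 < vinetVolume V₀ B₀ B₀' P :=
  mul_pos hV₀ (pow_pos (vinetXAtPressure_spec hB₀ hB hP).1.1 3)

/-- COMPRESSION: `V(P) ≤ V₀` for `P ≥ 0` (`V₀ ≥ 0`, `B₀ > 0`, `B₀' ≥ 1`).
[cite: CohenGulserenHemley2000, eq. (4) (elementary consequence)] -/
theorem vinetVolume_le_self {V₀ B₀ B₀' P : ℝ} (hV₀ : 0 ≤ V₀) (hB₀ : 0 < B₀) (hB : 1 ≤ B₀')
    (hP : 0 ≤ P) : vinetVolume V₀ B₀ B₀' P ≤ V₀ := by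
  obtain ⟨hmem, _⟩ := vinetXAtPressure_spec hB₀ hB hP
  unfold vinetVolume
  exact mul_le_of_le_one_right hV₀ (pow_le_one₀ hmem.1.le hmem.2)

/-- The relative compression `V(P)/V₀ = x(P)³` does not depend on `V₀`:
`V(P; V₀) = V₀ · V(P; 1)`. [cite: CohenGulserenHemley2000, eq. (4) (elementary consequence)] -/
theorem vinetVolume_eq_mul_unit (V₀ B₀ B₀' P : ℝ) :
    vinetVolume V₀ B₀ B₀' P = V₀ * vinetVolume 1 B₀ B₀' P := by
  simp [vinetVolume]

/-- `x(P)` IS ANTITONE IN PRESSURE: `0 ≤ P₁ ≤ P₂ ⇒ x(P₂) ≤ x(P₁)` (`B₀ > 0`, `B₀' ≥ 1`).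
[cite: CohenGulserenHemley2000, eq. (4) (elementary consequence)] -/
theorem vinetXAtPressure_antitone_pressure {B₀ B₀' P₁ P₂ : ℝ} (hB₀ : 0 < B₀) (hB : 1 ≤ B₀')
    (hP₁ : 0 ≤ P₁) (hP : P₁ ≤ P₂) :
    vinetXAtPressure B₀ B₀' P₂ ≤ vinetXAtPressure B₀ B₀' P₁ := by
  have hP₂ : 0 ≤ P₂ := le_trans hP₁ hP
  obtain ⟨hm₁, he₁⟩ := vinetXAtPressure_spec hB₀ hB hP₁
  obtain ⟨hm₂, he₂⟩ := vinetXAtPressure_spec hB₀ hB hP₂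
  refine ((vinetShape_strictAntiOn (vinetEta_nonneg hB)).le_iff_ge hm₁ hm₂).mp ?_
  rw [he₁, he₂]
  exact div_le_div_of_nonneg_right hP (by positivity)

/-- `x(P)` IS MONOTONE IN THE BULK MODULUS: `0 < B₁ ≤ B₂ ⇒ x(P; B₁) ≤ x(P; B₂)` at fixed
`P ≥ 0`, `B₀' ≥ 1` (a stiffer solid is compressed less).
[cite: CohenGulserenHemley2000, eq. (4) (elementary consequence)] -/
theorem vinetXAtPressure_mono_bulkModulus {B₁ B₂ B₀' P : ℝ} (hB₁ : 0 < B₁) (hB12 : B₁ ≤ B₂)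
    (hB : 1 ≤ B₀') (hP : 0 ≤ P) :
    vinetXAtPressure B₁ B₀' P ≤ vinetXAtPressure B₂ B₀' P := by
  have hB₂ : 0 < B₂ := lt_of_lt_of_le hB₁ hB12
  obtain ⟨hm₁, he₁⟩ := vinetXAtPressure_spec hB₁ hB hP
  obtain ⟨hm₂, he₂⟩ := vinetXAtPressure_spec hB₂ hB hP
  refine ((vinetShape_strictAntiOn (vinetEta_nonneg hB)).le_iff_ge hm₂ hm₁).mp ?_
  rw [he₁, he₂]
  exact div_le_div_of_nonneg_left hP (by positivity) (by linarith)

/-- `x(P)` IS MONOTONE IN `B₀'`: `1 ≤ b₁ ≤ b₂ ⇒ x(P; B₀' = b₁) ≤ x(P; B₀' = b₂)` at fixed `P ≥ 0`,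
`B₀ > 0` (a modulus that stiffens faster with pressure compresses less).  Proof: at the `b₁`-root
the `b₂`-shape is at least `P/(3B₀)` (`vinetShape_mono_eta`), and the `b₂`-shape is strictly
decreasing. [cite: CohenGulserenHemley2000, eq. (4) (elementary consequence)] -/
theorem vinetXAtPressure_mono_Bprime {B₀ b₁ b₂ P : ℝ} (hB₀ : 0 < B₀) (hb₁ : 1 ≤ b₁)
    (hb12 : b₁ ≤ b₂) (hP : 0 ≤ P) :
    vinetXAtPressure B₀ b₁ P ≤ vinetXAtPressure B₀ b₂ P := by
  have hb₂ : 1 ≤ b₂ := le_trans hb₁ hb12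
  obtain ⟨hm₁, he₁⟩ := vinetXAtPressure_spec hB₀ hb₁ hP
  obtain ⟨hm₂, he₂⟩ := vinetXAtPressure_spec hB₀ hb₂ hP
  refine ((vinetShape_strictAntiOn (vinetEta_nonneg hb₂)).le_iff_ge hm₂ hm₁).mp ?_
  rw [he₂, ← he₁]
  exact vinetShape_mono_eta hm₁.2 (by unfold vinetEta; linarith)

/-- ANTITONE IN PRESSURE: `0 ≤ P₁ ≤ P₂ ⇒ V(P₂) ≤ V(P₁)` (`V₀ ≥ 0`, `B₀ > 0`, `B₀' ≥ 1`).
[cite: CohenGulserenHemley2000, eq. (4) (its inverse)] -/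
theorem vinetVolume_antitone_pressure {V₀ B₀ B₀' P₁ P₂ : ℝ} (hV₀ : 0 ≤ V₀) (hB₀ : 0 < B₀)
    (hB : 1 ≤ B₀') (hP₁ : 0 ≤ P₁) (hP : P₁ ≤ P₂) :
    vinetVolume V₀ B₀ B₀' P₂ ≤ vinetVolume V₀ B₀ B₀' P₁ := by
  have hP₂ : 0 ≤ P₂ := le_trans hP₁ hP
  have hx := vinetXAtPressure_antitone_pressure hB₀ hB hP₁ hP
  have h0 : 0 ≤ vinetXAtPressure B₀ B₀' P₂ := (vinetXAtPressure_spec hB₀ hB hP₂).1.1.le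
  unfold vinetVolume
  exact mul_le_mul_of_nonneg_left (pow_le_pow_left₀ h0 hx 3) hV₀

/-- MONOTONE IN THE BULK MODULUS: `0 < B₁ ≤ B₂ ⇒ V(P; B₁) ≤ V(P; B₂)` at fixed `P ≥ 0`,
`B₀' ≥ 1` (`V₀ ≥ 0`). [cite: CohenGulserenHemley2000, eq. (4) (its inverse)] -/
theorem vinetVolume_mono_bulkModulus {V₀ B₁ B₂ B₀' P : ℝ} (hV₀ : 0 ≤ V₀) (hB₁ : 0 < B₁)
    (hB12 : B₁ ≤ B₂) (hB : 1 ≤ B₀') (hP : 0 ≤ P) :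
    vinetVolume V₀ B₁ B₀' P ≤ vinetVolume V₀ B₂ B₀' P := by
  have hx := vinetXAtPressure_mono_bulkModulus hB₁ hB12 hB hP
  have h0 : 0 ≤ vinetXAtPressure B₁ B₀' P := (vinetXAtPressure_spec hB₁ hB hP).1.1.le
  unfold vinetVolume
  exact mul_le_mul_of_nonneg_left (pow_le_pow_left₀ h0 hx 3) hV₀

/-- MONOTONE IN `B₀'`: `1 ≤ b₁ ≤ b₂ ⇒ V(P; B₀' = b₁) ≤ V(P; B₀' = b₂)` at fixed `P ≥ 0`, `B₀ > 0`
(`V₀ ≥ 0`). [cite: CohenGulserenHemley2000, eq. (4) (its inverse)] -/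
theorem vinetVolume_mono_Bprime {V₀ B₀ b₁ b₂ P : ℝ} (hV₀ : 0 ≤ V₀) (hB₀ : 0 < B₀) (hb₁ : 1 ≤ b₁)
    (hb12 : b₁ ≤ b₂) (hP : 0 ≤ P) :
    vinetVolume V₀ B₀ b₁ P ≤ vinetVolume V₀ B₀ b₂ P := by
  have hx := vinetXAtPressure_mono_Bprime hB₀ hb₁ hb12 hP
  have h0 : 0 ≤ vinetXAtPressure B₀ b₁ P := (vinetXAtPressure_spec hB₀ hb₁ hP).1.1.le
  unfold vinetVolume
  exact mul_le_mul_of_nonneg_left (pow_le_pow_left₀ h0 hx 3) hV₀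

/-- THE CORNER RULE FOR VINET COMPARATOR INTERVALS: on the physical domain, if `P ∈ [P_lo, P_hi]`
(`P_lo ≥ 0`), `B₀ ∈ [B_lo, B_hi]` (`B_lo > 0`) and `B₀' ∈ [b_lo, b_hi]` (`b_lo ≥ 1`), then
`V(P; B₀, B₀')` lies between the two corner values `V(P_hi; B_lo, b_lo)` and `V(P_lo; B_hi, b_hi)`
(both attained, so the interval is sharp): a Vinet-fitted `(B₀ ± δB₀, B₀' ± δB₀')` pair and a
pressure gauge interval propagate to an exact volume interval by two root evaluations.
[cite: CohenGulserenHemley2000, eq. (4) (its inverse)] -/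
theorem vinetVolume_mem_Icc_of_box {V₀ P Plo Phi B₀ Blo Bhi B₀' blo bhi : ℝ} (hV₀ : 0 ≤ V₀)
    (hPlo : 0 ≤ Plo) (hBlo : 0 < Blo) (hblo : 1 ≤ blo) (hP : P ∈ Icc Plo Phi)
    (hB : B₀ ∈ Icc Blo Bhi) (hb : B₀' ∈ Icc blo bhi) :
    vinetVolume V₀ B₀ B₀' P ∈
      Icc (vinetVolume V₀ Blo blo Phi) (vinetVolume V₀ Bhi bhi Plo) := by
  obtain ⟨hP1, hP2⟩ := hP
  obtain ⟨hB1, hB2⟩ := hB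
  obtain ⟨hb1, hb2⟩ := hb
  have hP0 : 0 ≤ P := le_trans hPlo hP1
  have hB₀ : 0 < B₀ := lt_of_lt_of_le hBlo hB1
  have hB₀' : 1 ≤ B₀' := le_trans hblo hb1
  have hBhi : 0 < Bhi := lt_of_lt_of_le hB₀ hB2
  have hbhi : 1 ≤ bhi := le_trans hB₀' hb2
  refine ⟨?_, ?_⟩
  · calc vinetVolume V₀ Blo blo Phi
        ≤ vinetVolume V₀ Blo blo P := vinetVolume_antitone_pressure hV₀ hBlo hblo hP0 hP2
      _ ≤ vinetVolume V₀ B₀ blo P := vinetVolume_mono_bulkModulus hV₀ hBlo hB1 hblo hP0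
      _ ≤ vinetVolume V₀ B₀ B₀' P := vinetVolume_mono_Bprime hV₀ hB₀ hblo hb1 hP0
  · calc vinetVolume V₀ B₀ B₀' P
        ≤ vinetVolume V₀ Bhi B₀' P := vinetVolume_mono_bulkModulus hV₀ hB₀ hB2 hB₀' hP0
      _ ≤ vinetVolume V₀ Bhi bhi P := vinetVolume_mono_Bprime hV₀ hBhi hB₀' hb2 hP0
      _ ≤ vinetVolume V₀ Bhi bhi Plo := vinetVolume_antitone_pressure hV₀ hBhi hbhi hPlo hP1

/-! ## Comparator intervals III: monotonicity and the inverse of the third-order Birch–Murnaghan law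

In the variable `q = (V₀/V)^{1/3} ≥ 1` (compression) the third-order Birch–Murnaghan pressure reads
`P = B₀ · h(q)`, `h(q) = (3/2)(q⁷ - q⁵)[1 + (3/4)(B₀' - 4)(q² - 1)]`
[cite: Poirier1991, §4.3.3 eq. (4.42)].  For `B₀' ≥ 4` every factor is nonnegative and increasing
on `q ≥ 1`, so `h` is STRICTLY INCREASING there, vanishes at `q = 1` and is unbounded; hence for
`B₀ > 0`, `P ≥ 0` there is exactly one volume `V(P) ∈ (0, V₀]` with `P(V(P)) = P`, defined below as
`birchMurnaghan3Volume`, with the same monotonicity package and CORNER RULE as for Murnaghan and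
Vinet.  For `B₀' < 4` the bracket `1 + (3/4)(B₀' - 4)(q² - 1)` VANISHES at the finite
compression `q_c² = 1 + 4/(3(4 - B₀'))`, so the printed third-order law returns to `P = 0` at a
volume `V_c ∈ (0, V₀)` and is NOT monotone on `(0, V₀]`
(`birchMurnaghan3Pressure_eq_zero_of_lt_four`): a comparator fitted with `B₀' < 4` may only be
inverted on `[V_c, V₀]`.  Elementary consequences
of the printed law (no new facts). -/

/-- The dimensionless THIRD-ORDER BIRCH–MURNAGHAN PRESSURE SHAPE in the compression variable
`q = (V₀/V)^{1/3}`: `h(q) = (3/2)(q⁷ - q⁵)[1 + (3/4)(B₀' - 4)(q² - 1)]`, so that `P = B₀ h(q)`.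
[cite: Poirier1991, §4.3.3 eq. (4.42)] -/
def birchMurnaghan3Shape (B₀' q : ℝ) : ℝ :=
  3 / 2 * (q ^ 7 - q ^ 5) * (1 + 3 / 4 * (B₀' - 4) * (q ^ 2 - 1))

/-- `P(V) = B₀ h(q)`, `q = (V₀/V)^{1/3}` (`V₀, V > 0`). [cite: Poirier1991, §4.3.3 eq. (4.42)] -/
theorem birchMurnaghan3Pressure_eq_shape {V₀ V : ℝ} (hV₀ : 0 < V₀) (hV : 0 < V) (B₀ B₀' : ℝ) :
    birchMurnaghan3Pressure V₀ B₀ B₀' V = B₀ * birchMurnaghan3Shape B₀' (cubeRootRatio V₀ V) := by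
  rw [birchMurnaghan3Pressure_eq_cubeRootRatio hV₀ hV, eulerianStrain_eq_cubeRootRatio hV₀ hV,
    birchMurnaghan3Shape]
  ring

/-- `h(1) = 0` (zero pressure at `V = V₀`). [cite: Poirier1991, §4.3.3 eq. (4.42)] -/
theorem birchMurnaghan3Shape_one (B₀' : ℝ) : birchMurnaghan3Shape B₀' 1 = 0 := by
  simp [birchMurnaghan3Shape]

/-- `h(q) ≥ 0` on the compression range `q ≥ 1` when `B₀' ≥ 4`.
[cite: Poirier1991, §4.3.3 eq. (4.42) (elementary consequence)] -/
theorem birchMurnaghan3Shape_nonneg {B₀' q : ℝ} (hB : 4 ≤ B₀') (hq : 1 ≤ q) :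
    0 ≤ birchMurnaghan3Shape B₀' q := by
  unfold birchMurnaghan3Shape
  have hq2 : 0 ≤ q ^ 2 - 1 := by nlinarith
  have h75 : 0 ≤ q ^ 7 - q ^ 5 := by
    have : q ^ 7 - q ^ 5 = q ^ 5 * (q ^ 2 - 1) := by ring
    rw [this]; exact mul_nonneg (by positivity) hq2
  have hbr : 0 ≤ 1 + 3 / 4 * (B₀' - 4) * (q ^ 2 - 1) := by
    have : 0 ≤ 3 / 4 * (B₀' - 4) * (q ^ 2 - 1) := by
      apply mul_nonneg (by linarith) hq2
    linarith
  positivity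

/-- MONOTONE IN `B₀'` ON THE COMPRESSION RANGE: `q ≥ 1`, `b₁ ≤ b₂ ⇒ h_{b₁}(q) ≤ h_{b₂}(q)`.
[cite: Poirier1991, §4.3.3 eq. (4.42) (elementary consequence)] -/
theorem birchMurnaghan3Shape_mono_Bprime {b₁ b₂ q : ℝ} (hq : 1 ≤ q) (hb : b₁ ≤ b₂) :
    birchMurnaghan3Shape b₁ q ≤ birchMurnaghan3Shape b₂ q := by
  unfold birchMurnaghan3Shape
  have hq2 : 0 ≤ q ^ 2 - 1 := by nlinarith
  have h75 : 0 ≤ 3 / 2 * (q ^ 7 - q ^ 5) := by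
    have : q ^ 7 - q ^ 5 = q ^ 5 * (q ^ 2 - 1) := by ring
    rw [this]; exact mul_nonneg (by norm_num) (mul_nonneg (by positivity) hq2)
  apply mul_le_mul_of_nonneg_left _ h75
  nlinarith [mul_nonneg (sub_nonneg.mpr hb) hq2]

/-- THE THIRD-ORDER BIRCH–MURNAGHAN SHAPE IS STRICTLY INCREASING ON `q ≥ 1` WHEN `B₀' ≥ 4`:
`q⁵(q² - 1)` is strictly increasing and nonnegative there and the bracket is increasing and `≥ 1`.
[cite: Poirier1991, §4.3.3 eq. (4.42) (elementary consequence)] -/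
theorem birchMurnaghan3Shape_strictMonoOn {B₀' : ℝ} (hB : 4 ≤ B₀') :
    StrictMonoOn (birchMurnaghan3Shape B₀') (Ici 1) := by
  intro q₁ hq₁ q₂ hq₂ hlt
  have h1 : (1 : ℝ) ≤ q₁ := hq₁
  have h2 : (1 : ℝ) ≤ q₂ := hq₂
  have hA : q₁ ^ 7 - q₁ ^ 5 < q₂ ^ 7 - q₂ ^ 5 := by
    have e₁ : q₁ ^ 7 - q₁ ^ 5 = q₁ ^ 5 * (q₁ ^ 2 - 1) := by ring
    have e₂ : q₂ ^ 7 - q₂ ^ 5 = q₂ ^ 5 * (q₂ ^ 2 - 1) := by ring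
    rw [e₁, e₂]
    have h5 : q₁ ^ 5 ≤ q₂ ^ 5 := pow_le_pow_left₀ (by linarith) hlt.le 5
    have hsq : q₁ ^ 2 - 1 < q₂ ^ 2 - 1 := by nlinarith
    calc q₁ ^ 5 * (q₁ ^ 2 - 1) ≤ q₂ ^ 5 * (q₁ ^ 2 - 1) :=
          mul_le_mul_of_nonneg_right h5 (by nlinarith)
      _ < q₂ ^ 5 * (q₂ ^ 2 - 1) := mul_lt_mul_of_pos_left hsq (by positivity)
  have hA₁ : 0 ≤ q₁ ^ 7 - q₁ ^ 5 := by
    have : q₁ ^ 7 - q₁ ^ 5 = q₁ ^ 5 * (q₁ ^ 2 - 1) := by ring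
    rw [this]; exact mul_nonneg (by positivity) (by nlinarith)
  have hBk : 1 + 3 / 4 * (B₀' - 4) * (q₁ ^ 2 - 1) ≤ 1 + 3 / 4 * (B₀' - 4) * (q₂ ^ 2 - 1) := by
    have : 3 / 4 * (B₀' - 4) * (q₁ ^ 2 - 1) ≤ 3 / 4 * (B₀' - 4) * (q₂ ^ 2 - 1) :=
      mul_le_mul_of_nonneg_left (by nlinarith) (by linarith)
    linarith
  have hBk₂ : 0 < 1 + 3 / 4 * (B₀' - 4) * (q₂ ^ 2 - 1) := by
    have : 0 ≤ 3 / 4 * (B₀' - 4) * (q₂ ^ 2 - 1) := mul_nonneg (by linarith) (by nlinarith)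
    linarith
  show 3 / 2 * (q₁ ^ 7 - q₁ ^ 5) * (1 + 3 / 4 * (B₀' - 4) * (q₁ ^ 2 - 1)) <
    3 / 2 * (q₂ ^ 7 - q₂ ^ 5) * (1 + 3 / 4 * (B₀' - 4) * (q₂ ^ 2 - 1))
  calc 3 / 2 * (q₁ ^ 7 - q₁ ^ 5) * (1 + 3 / 4 * (B₀' - 4) * (q₁ ^ 2 - 1))
      ≤ 3 / 2 * (q₁ ^ 7 - q₁ ^ 5) * (1 + 3 / 4 * (B₀' - 4) * (q₂ ^ 2 - 1)) :=
        mul_le_mul_of_nonneg_left hBk (by positivity)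
    _ < 3 / 2 * (q₂ ^ 7 - q₂ ^ 5) * (1 + 3 / 4 * (B₀' - 4) * (q₂ ^ 2 - 1)) :=
        mul_lt_mul_of_pos_right (by linarith) hBk₂

/-- EXISTENCE OF THE COMPRESSION ROOT: for `B₀' ≥ 4` and `p ≥ 0` there is `q ≥ 1` with `h(q) = p`
(intermediate value theorem on `[1, 1 + p]`, where `h(1 + p) ≥ (3/2)((1+p)² - 1) ≥ p`).
[cite: Poirier1991, §4.3.3 eq. (4.42) (elementary consequence)] -/
theorem exists_birchMurnaghan3Shape_eq {B₀' p : ℝ} (hB : 4 ≤ B₀') (hp : 0 ≤ p) :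
    ∃ q ∈ Ici (1 : ℝ), birchMurnaghan3Shape B₀' q = p := by
  set Q : ℝ := 1 + p with hQ
  have hQ1 : 1 ≤ Q := by rw [hQ]; linarith
  have hcont : ContinuousOn (birchMurnaghan3Shape B₀') (Icc 1 Q) := by
    show ContinuousOn (fun q => 3 / 2 * (q ^ 7 - q ^ 5) * (1 + 3 / 4 * (B₀' - 4) * (q ^ 2 - 1)))
      (Icc 1 Q)
    exact Continuous.continuousOn (by continuity)
  have hgQ : p ≤ birchMurnaghan3Shape B₀' Q := by
    unfold birchMurnaghan3Shape
    have hQ2 : 0 ≤ Q ^ 2 - 1 := by nlinarith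
    have hQ5 : 1 ≤ Q ^ 5 := one_le_pow₀ hQ1
    have h75 : Q ^ 2 - 1 ≤ Q ^ 7 - Q ^ 5 := by
      have : Q ^ 7 - Q ^ 5 = Q ^ 5 * (Q ^ 2 - 1) := by ring
      rw [this]
      calc Q ^ 2 - 1 = 1 * (Q ^ 2 - 1) := (one_mul _).symm
        _ ≤ Q ^ 5 * (Q ^ 2 - 1) := mul_le_mul_of_nonneg_right hQ5 hQ2
    have hbr : 1 ≤ 1 + 3 / 4 * (B₀' - 4) * (Q ^ 2 - 1) := by
      have : 0 ≤ 3 / 4 * (B₀' - 4) * (Q ^ 2 - 1) := mul_nonneg (by linarith) hQ2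
      linarith
    have hp' : p ≤ 3 / 2 * (Q ^ 2 - 1) := by rw [hQ]; nlinarith
    calc p ≤ 3 / 2 * (Q ^ 2 - 1) := hp'
      _ ≤ 3 / 2 * (Q ^ 7 - Q ^ 5) := by linarith
      _ = 3 / 2 * (Q ^ 7 - Q ^ 5) * 1 := (mul_one _).symm
      _ ≤ 3 / 2 * (Q ^ 7 - Q ^ 5) * (1 + 3 / 4 * (B₀' - 4) * (Q ^ 2 - 1)) :=
          mul_le_mul_of_nonneg_left hbr (by linarith)
  have hg1 : birchMurnaghan3Shape B₀' 1 ≤ p := by rw [birchMurnaghan3Shape_one]; exact hp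
  obtain ⟨q, hq, hqp⟩ := intermediate_value_Icc hQ1 hcont ⟨hg1, hgQ⟩
  exact ⟨q, hq.1, hqp⟩

/-- THE `B₀' < 4` CAVEAT: for `B₀' < 4` the printed third-order Birch–Murnaghan pressure VANISHES
AGAIN at the finite compression `q_c = (1 + 4/(3(4 - B₀')))^{1/2} > 1`, i.e. at the volume
`V_c = V₀ q_c⁻³ ∈ (0, V₀)`; so the law is not monotone on `(0, V₀]` and a `B₀' < 4` fit may only be
inverted above `V_c`. [cite: Poirier1991, §4.3.3 eq. (4.42) (elementary consequence)] -/
theorem birchMurnaghan3Pressure_eq_zero_of_lt_four {V₀ B₀' : ℝ} (hV₀ : 0 < V₀) (hB : B₀' < 4)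
    (B₀ : ℝ) :
    ∃ V ∈ Ioo 0 V₀, birchMurnaghan3Pressure V₀ B₀ B₀' V = 0 := by
  set s : ℝ := 1 + 4 / (3 * (4 - B₀')) with hs
  have h4 : 0 < 4 - B₀' := by linarith
  have hs1 : 1 < s := by
    rw [hs]
    have : 0 < 4 / (3 * (4 - B₀')) := by positivity
    linarith
  have hs0 : 0 < s := by linarith
  -- q_c = s^{1/2}, V_c = V₀ / q_c³ = V₀ · s^{-3/2}
  set V : ℝ := V₀ * s ^ (-(3 : ℝ) / 2) with hV
  have hVpos : 0 < V := mul_pos hV₀ (Real.rpow_pos_of_pos hs0 _)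
  have hVlt : V < V₀ := by
    have : s ^ (-(3 : ℝ) / 2) < 1 :=
      Real.rpow_lt_one_of_one_lt_of_neg hs1 (by norm_num)
    calc V = V₀ * s ^ (-(3 : ℝ) / 2) := hV
      _ < V₀ * 1 := mul_lt_mul_of_pos_left this hV₀
      _ = V₀ := mul_one _
  refine ⟨V, ⟨hVpos, hVlt⟩, ?_⟩
  -- q² = (V₀/V)^{2/3} = s
  have hratio : V₀ / V = s ^ ((3 : ℝ) / 2) := by
    rw [hV, ← div_div, div_self hV₀.ne', one_div, ← Real.rpow_neg hs0.le]
    norm_num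
  have hq2 : (V₀ / V) ^ ((2 : ℝ) / 3) = s := by
    rw [hratio, ← Real.rpow_mul hs0.le]
    norm_num
  rw [birchMurnaghan3Pressure_eq_density_form hV₀ hVpos, hq2, hs]
  field_simp
  ring

/-- `q = (V₀/V)^{1/3} ≥ 1` for `0 < V ≤ V₀`. [folklore] -/
private lemma one_le_cubeRootRatio {V₀ V : ℝ} (hV : 0 < V) (hle : V ≤ V₀) :
    1 ≤ cubeRootRatio V₀ V :=
  Real.one_le_rpow ((one_le_div hV).mpr hle) (by norm_num)

/-- `q` is strictly decreasing in `V` (`V₀ > 0`, `V > 0`). [folklore] -/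
private lemma cubeRootRatio_lt_cubeRootRatio {V₀ V₁ V₂ : ℝ} (hV₀ : 0 < V₀) (hV₁ : 0 < V₁)
    (hlt : V₁ < V₂) : cubeRootRatio V₀ V₂ < cubeRootRatio V₀ V₁ :=
  Real.rpow_lt_rpow (div_pos hV₀ (lt_trans hV₁ hlt)).le (div_lt_div_of_pos_left hV₀ hV₁ hlt)
    (by norm_num)

/-- THE THIRD-ORDER BIRCH–MURNAGHAN PRESSURE IS STRICTLY DECREASING IN VOLUME ON THE COMPRESSION
BRANCH `0 < V ≤ V₀` when `B₀ > 0`, `B₀' ≥ 4`. [cite: Poirier1991, §4.3.3 eq. (4.42) (elementary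
consequence)] -/
theorem birchMurnaghan3Pressure_strictAntiOn {V₀ B₀ B₀' : ℝ} (hV₀ : 0 < V₀) (hB₀ : 0 < B₀)
    (hB : 4 ≤ B₀') : StrictAntiOn (birchMurnaghan3Pressure V₀ B₀ B₀') (Ioc 0 V₀) := by
  intro V₁ hV₁ V₂ hV₂ hlt
  have hq₁ : cubeRootRatio V₀ V₁ ∈ Ici (1 : ℝ) := one_le_cubeRootRatio hV₁.1 hV₁.2
  have hq₂ : cubeRootRatio V₀ V₂ ∈ Ici (1 : ℝ) := one_le_cubeRootRatio hV₂.1 hV₂.2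
  have hqlt : cubeRootRatio V₀ V₂ < cubeRootRatio V₀ V₁ :=
    cubeRootRatio_lt_cubeRootRatio hV₀ hV₁.1 hlt
  show birchMurnaghan3Pressure V₀ B₀ B₀' V₂ < birchMurnaghan3Pressure V₀ B₀ B₀' V₁
  rw [birchMurnaghan3Pressure_eq_shape hV₀ hV₂.1, birchMurnaghan3Pressure_eq_shape hV₀ hV₁.1]
  exact mul_lt_mul_of_pos_left (birchMurnaghan3Shape_strictMonoOn hB hq₂ hq₁ hqlt) hB₀

/-- SIGN: compression (`0 < V < V₀`) gives `P > 0` for `B₀ > 0`, `B₀' ≥ 4`.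
[cite: Poirier1991, §4.3.3 eq. (4.42) (elementary consequence)] -/
theorem birchMurnaghan3Pressure_pos {V₀ B₀ B₀' V : ℝ} (hV₀ : 0 < V₀) (hB₀ : 0 < B₀) (hB : 4 ≤ B₀')
    (hV : 0 < V) (hlt : V < V₀) : 0 < birchMurnaghan3Pressure V₀ B₀ B₀' V := by
  have h := birchMurnaghan3Pressure_strictAntiOn hV₀ hB₀ hB ⟨hV, hlt.le⟩ ⟨hV₀, le_rfl⟩ hlt
  rwa [birchMurnaghan3Pressure_self hV₀] at h

/-- THE BIRCH–MURNAGHAN LINEAR COMPRESSION AT PRESSURE `P`: the (unique) `q ≥ 1` with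
`B₀ h(q) = P` — meaningful for `B₀ > 0`, `B₀' ≥ 4`, `P ≥ 0` (junk value otherwise).
[cite: Poirier1991, §4.3.3 eq. (4.42) (its implicit inverse)] -/
def birchMurnaghan3QAtPressure (B₀ B₀' P : ℝ) : ℝ :=
  Function.invFunOn (birchMurnaghan3Shape B₀') (Ici 1) (P / B₀)

/-- THIRD-ORDER BIRCH–MURNAGHAN VOLUME–PRESSURE RELATION `V(P) = V₀ / q(P)³`: the inverse of
eq. (4.42) on the compression branch `0 < V ≤ V₀` (no closed form; defined as the root).
[cite: Poirier1991, §4.3.3 eq. (4.42) (its implicit inverse)] -/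
def birchMurnaghan3Volume (V₀ B₀ B₀' P : ℝ) : ℝ := V₀ / birchMurnaghan3QAtPressure B₀ B₀' P ^ 3

/-- Defining property of `q(P)`: `q(P) ≥ 1` and `h(q(P)) = P/B₀` (`B₀ > 0`, `B₀' ≥ 4`, `P ≥ 0`).
[cite: Poirier1991, §4.3.3 eq. (4.42) (elementary consequence)] -/
theorem birchMurnaghan3QAtPressure_spec {B₀ B₀' P : ℝ} (hB₀ : 0 < B₀) (hB : 4 ≤ B₀') (hP : 0 ≤ P) :
    birchMurnaghan3QAtPressure B₀ B₀' P ∈ Ici (1 : ℝ) ∧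
      birchMurnaghan3Shape B₀' (birchMurnaghan3QAtPressure B₀ B₀' P) = P / B₀ :=
  Function.invFunOn_pos (exists_birchMurnaghan3Shape_eq hB (div_nonneg hP hB₀.le))

/-- UNIQUENESS: any `q ≥ 1` solving `h(q) = P/B₀` is `q(P)`.
[cite: Poirier1991, §4.3.3 eq. (4.42) (elementary consequence)] -/
theorem birchMurnaghan3QAtPressure_eq_of_shape_eq {B₀ B₀' P q : ℝ} (hB₀ : 0 < B₀) (hB : 4 ≤ B₀')
    (hP : 0 ≤ P) (hq : q ∈ Ici (1 : ℝ)) (hshape : birchMurnaghan3Shape B₀' q = P / B₀) :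
    birchMurnaghan3QAtPressure B₀ B₀' P = q := by
  obtain ⟨hmem, heq⟩ := birchMurnaghan3QAtPressure_spec hB₀ hB hP
  exact (birchMurnaghan3Shape_strictMonoOn hB).injOn hmem hq (heq.trans hshape.symm)

/-- `q(V(P)) = q(P)`: the compression ratio of `V₀/q³` is `q` (`q > 0`, `V₀ > 0`). [folklore] -/
private lemma cubeRootRatio_birchMurnaghan3Volume {V₀ B₀ B₀' P : ℝ} (hV₀ : 0 < V₀)
    (hq : 0 < birchMurnaghan3QAtPressure B₀ B₀' P) :
    cubeRootRatio V₀ (birchMurnaghan3Volume V₀ B₀ B₀' P) = birchMurnaghan3QAtPressure B₀ B₀' P := by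
  unfold cubeRootRatio birchMurnaghan3Volume
  rw [div_div_eq_mul_div, mul_div_cancel_left₀ _ hV₀.ne',
    show ((1 : ℝ) / 3) = ((3 : ℕ) : ℝ)⁻¹ by norm_num, Real.pow_rpow_inv_natCast hq.le (by norm_num)]

/-- THE ROOT SOLVES THE EQUATION OF STATE: `P(V(P)) = P` for every `P ≥ 0`
(`V₀ > 0`, `B₀ > 0`, `B₀' ≥ 4`). [cite: Poirier1991, §4.3.3 eq. (4.42) (elementary consequence)] -/
theorem birchMurnaghan3Pressure_birchMurnaghan3Volume {V₀ B₀ B₀' P : ℝ} (hV₀ : 0 < V₀)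
    (hB₀ : 0 < B₀) (hB : 4 ≤ B₀') (hP : 0 ≤ P) :
    birchMurnaghan3Pressure V₀ B₀ B₀' (birchMurnaghan3Volume V₀ B₀ B₀' P) = P := by
  obtain ⟨hmem, heq⟩ := birchMurnaghan3QAtPressure_spec hB₀ hB hP
  have hq0 : 0 < birchMurnaghan3QAtPressure B₀ B₀' P := lt_of_lt_of_le one_pos hmem
  have hVpos : 0 < birchMurnaghan3Volume V₀ B₀ B₀' P := div_pos hV₀ (pow_pos hq0 3)
  rw [birchMurnaghan3Pressure_eq_shape hV₀ hVpos, cubeRootRatio_birchMurnaghan3Volume hV₀ hq0, heq]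
  field_simp

/-- THE ROOT IS THE INVERSE ON THE COMPRESSION BRANCH: `V(P(V)) = V` for every `0 < V ≤ V₀`
(`B₀ > 0`, `B₀' ≥ 4`). [cite: Poirier1991, §4.3.3 eq. (4.42) (elementary consequence)] -/
theorem birchMurnaghan3Volume_birchMurnaghan3Pressure {V₀ B₀ B₀' V : ℝ} (hV₀ : 0 < V₀)
    (hB₀ : 0 < B₀) (hB : 4 ≤ B₀') (hV : V ∈ Ioc 0 V₀) :
    birchMurnaghan3Volume V₀ B₀ B₀' (birchMurnaghan3Pressure V₀ B₀ B₀' V) = V := by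
  obtain ⟨hVpos, hVle⟩ := hV
  have hqmem : cubeRootRatio V₀ V ∈ Ici (1 : ℝ) := one_le_cubeRootRatio hVpos hVle
  have hP : 0 ≤ birchMurnaghan3Pressure V₀ B₀ B₀' V := by
    rw [birchMurnaghan3Pressure_eq_shape hV₀ hVpos]
    exact mul_nonneg hB₀.le (birchMurnaghan3Shape_nonneg hB hqmem)
  have hshape : birchMurnaghan3Shape B₀' (cubeRootRatio V₀ V) =
      birchMurnaghan3Pressure V₀ B₀ B₀' V / B₀ := by
    rw [birchMurnaghan3Pressure_eq_shape hV₀ hVpos]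
    field_simp
  have hq : birchMurnaghan3QAtPressure B₀ B₀' (birchMurnaghan3Pressure V₀ B₀ B₀' V) =
      cubeRootRatio V₀ V :=
    birchMurnaghan3QAtPressure_eq_of_shape_eq hB₀ hB hP hqmem hshape
  unfold birchMurnaghan3Volume
  rw [hq, cubeRootRatio_pow_three hV₀ hVpos]
  field_simp

/-- UNIQUENESS OF THE VOLUME AT PRESSURE: the only `V ∈ (0, V₀]` with `P(V) = P` is `V(P)`
(`B₀ > 0`, `B₀' ≥ 4`). [cite: Poirier1991, §4.3.3 eq. (4.42) (elementary consequence)] -/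
theorem eq_birchMurnaghan3Volume_of_pressure_eq {V₀ B₀ B₀' V P : ℝ} (hV₀ : 0 < V₀)
    (hB₀ : 0 < B₀) (hB : 4 ≤ B₀') (hV : V ∈ Ioc 0 V₀)
    (h : birchMurnaghan3Pressure V₀ B₀ B₀' V = P) : V = birchMurnaghan3Volume V₀ B₀ B₀' P := by
  rw [← h, birchMurnaghan3Volume_birchMurnaghan3Pressure hV₀ hB₀ hB hV]

/-- `V(0) = V₀` (`B₀ > 0`, `B₀' ≥ 4`).
[cite: Poirier1991, §4.3.3 eq. (4.42) (elementary consequence)] -/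
theorem birchMurnaghan3Volume_zero {B₀ B₀' : ℝ} (hB₀ : 0 < B₀) (hB : 4 ≤ B₀') (V₀ : ℝ) :
    birchMurnaghan3Volume V₀ B₀ B₀' 0 = V₀ := by
  have hq : birchMurnaghan3QAtPressure B₀ B₀' 0 = 1 :=
    birchMurnaghan3QAtPressure_eq_of_shape_eq hB₀ hB le_rfl Set.self_mem_Ici
      (by rw [birchMurnaghan3Shape_one]; simp)
  simp [birchMurnaghan3Volume, hq]

/-- `V(P) > 0` (`V₀ > 0`, `B₀ > 0`, `B₀' ≥ 4`, `P ≥ 0`).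
[cite: Poirier1991, §4.3.3 eq. (4.42) (elementary consequence)] -/
theorem birchMurnaghan3Volume_pos {V₀ B₀ B₀' P : ℝ} (hV₀ : 0 < V₀) (hB₀ : 0 < B₀) (hB : 4 ≤ B₀')
    (hP : 0 ≤ P) : 0 < birchMurnaghan3Volume V₀ B₀ B₀' P :=
  div_pos hV₀ (pow_pos (lt_of_lt_of_le one_pos (birchMurnaghan3QAtPressure_spec hB₀ hB hP).1) 3)

/-- COMPRESSION: `V(P) ≤ V₀` for `P ≥ 0` (`V₀ ≥ 0`, `B₀ > 0`, `B₀' ≥ 4`).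
[cite: Poirier1991, §4.3.3 eq. (4.42) (elementary consequence)] -/
theorem birchMurnaghan3Volume_le_self {V₀ B₀ B₀' P : ℝ} (hV₀ : 0 ≤ V₀) (hB₀ : 0 < B₀)
    (hB : 4 ≤ B₀') (hP : 0 ≤ P) : birchMurnaghan3Volume V₀ B₀ B₀' P ≤ V₀ := by
  have hq1 : (1 : ℝ) ≤ birchMurnaghan3QAtPressure B₀ B₀' P :=
    (birchMurnaghan3QAtPressure_spec hB₀ hB hP).1
  unfold birchMurnaghan3Volume
  exact div_le_self hV₀ (one_le_pow₀ hq1)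

/-- The relative compression `V(P)/V₀ = q(P)⁻³` does not depend on `V₀`:
`V(P; V₀) = V₀ · V(P; 1)`. [cite: Poirier1991, §4.3.3 eq. (4.42) (elementary consequence)] -/
theorem birchMurnaghan3Volume_eq_mul_unit (V₀ B₀ B₀' P : ℝ) :
    birchMurnaghan3Volume V₀ B₀ B₀' P = V₀ * birchMurnaghan3Volume 1 B₀ B₀' P := by
  unfold birchMurnaghan3Volume
  ring

/-- `q(P)` IS MONOTONE IN PRESSURE: `0 ≤ P₁ ≤ P₂ ⇒ q(P₁) ≤ q(P₂)` (`B₀ > 0`, `B₀' ≥ 4`).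
[cite: Poirier1991, §4.3.3 eq. (4.42) (elementary consequence)] -/
theorem birchMurnaghan3QAtPressure_mono_pressure {B₀ B₀' P₁ P₂ : ℝ} (hB₀ : 0 < B₀) (hB : 4 ≤ B₀')
    (hP₁ : 0 ≤ P₁) (hP : P₁ ≤ P₂) :
    birchMurnaghan3QAtPressure B₀ B₀' P₁ ≤ birchMurnaghan3QAtPressure B₀ B₀' P₂ := by
  have hP₂ : 0 ≤ P₂ := le_trans hP₁ hP
  obtain ⟨hm₁, he₁⟩ := birchMurnaghan3QAtPressure_spec hB₀ hB hP₁
  obtain ⟨hm₂, he₂⟩ := birchMurnaghan3QAtPressure_spec hB₀ hB hP₂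
  refine ((birchMurnaghan3Shape_strictMonoOn hB).le_iff_le hm₁ hm₂).mp ?_
  rw [he₁, he₂]
  exact div_le_div_of_nonneg_right hP hB₀.le

/-- `q(P)` IS ANTITONE IN THE BULK MODULUS: `0 < B₁ ≤ B₂ ⇒ q(P; B₂) ≤ q(P; B₁)` at fixed `P ≥ 0`,
`B₀' ≥ 4`. [cite: Poirier1991, §4.3.3 eq. (4.42) (elementary consequence)] -/
theorem birchMurnaghan3QAtPressure_antitone_bulkModulus {B₁ B₂ B₀' P : ℝ} (hB₁ : 0 < B₁)
    (hB12 : B₁ ≤ B₂) (hB : 4 ≤ B₀') (hP : 0 ≤ P) :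
    birchMurnaghan3QAtPressure B₂ B₀' P ≤ birchMurnaghan3QAtPressure B₁ B₀' P := by
  have hB₂ : 0 < B₂ := lt_of_lt_of_le hB₁ hB12
  obtain ⟨hm₁, he₁⟩ := birchMurnaghan3QAtPressure_spec hB₁ hB hP
  obtain ⟨hm₂, he₂⟩ := birchMurnaghan3QAtPressure_spec hB₂ hB hP
  refine ((birchMurnaghan3Shape_strictMonoOn hB).le_iff_le hm₂ hm₁).mp ?_
  rw [he₁, he₂]
  exact div_le_div_of_nonneg_left hP hB₁ hB12

/-- `q(P)` IS ANTITONE IN `B₀'`: `4 ≤ b₁ ≤ b₂ ⇒ q(P; b₂) ≤ q(P; b₁)` at fixed `P ≥ 0`, `B₀ > 0`.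
[cite: Poirier1991, §4.3.3 eq. (4.42) (elementary consequence)] -/
theorem birchMurnaghan3QAtPressure_antitone_Bprime {B₀ b₁ b₂ P : ℝ} (hB₀ : 0 < B₀) (hb₁ : 4 ≤ b₁)
    (hb12 : b₁ ≤ b₂) (hP : 0 ≤ P) :
    birchMurnaghan3QAtPressure B₀ b₂ P ≤ birchMurnaghan3QAtPressure B₀ b₁ P := by
  have hb₂ : 4 ≤ b₂ := le_trans hb₁ hb12
  obtain ⟨hm₁, he₁⟩ := birchMurnaghan3QAtPressure_spec hB₀ hb₁ hP
  obtain ⟨hm₂, he₂⟩ := birchMurnaghan3QAtPressure_spec hB₀ hb₂ hP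
  refine ((birchMurnaghan3Shape_strictMonoOn hb₂).le_iff_le hm₂ hm₁).mp ?_
  rw [he₂, ← he₁]
  exact birchMurnaghan3Shape_mono_Bprime hm₁ hb12

/-- Volumes from compressions: `1 ≤ q₁ ≤ q₂ ⇒ V₀/q₂³ ≤ V₀/q₁³` (`V₀ ≥ 0`). [folklore] -/
private lemma div_cube_antitone {V₀ q₁ q₂ : ℝ} (hV₀ : 0 ≤ V₀) (hq₁ : 1 ≤ q₁) (hle : q₁ ≤ q₂) :
    V₀ / q₂ ^ 3 ≤ V₀ / q₁ ^ 3 :=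
  div_le_div_of_nonneg_left hV₀ (pow_pos (lt_of_lt_of_le one_pos hq₁) 3)
    (pow_le_pow_left₀ (le_trans zero_le_one hq₁) hle 3)

/-- ANTITONE IN PRESSURE: `0 ≤ P₁ ≤ P₂ ⇒ V(P₂) ≤ V(P₁)` (`V₀ ≥ 0`, `B₀ > 0`, `B₀' ≥ 4`).
[cite: Poirier1991, §4.3.3 eq. (4.42) (its inverse)] -/
theorem birchMurnaghan3Volume_antitone_pressure {V₀ B₀ B₀' P₁ P₂ : ℝ} (hV₀ : 0 ≤ V₀) (hB₀ : 0 < B₀)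
    (hB : 4 ≤ B₀') (hP₁ : 0 ≤ P₁) (hP : P₁ ≤ P₂) :
    birchMurnaghan3Volume V₀ B₀ B₀' P₂ ≤ birchMurnaghan3Volume V₀ B₀ B₀' P₁ := by
  unfold birchMurnaghan3Volume
  exact div_cube_antitone hV₀ (birchMurnaghan3QAtPressure_spec hB₀ hB hP₁).1
    (birchMurnaghan3QAtPressure_mono_pressure hB₀ hB hP₁ hP)

/-- MONOTONE IN THE BULK MODULUS: `0 < B₁ ≤ B₂ ⇒ V(P; B₁) ≤ V(P; B₂)` at fixed `P ≥ 0`,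
`B₀' ≥ 4` (`V₀ ≥ 0`). [cite: Poirier1991, §4.3.3 eq. (4.42) (its inverse)] -/
theorem birchMurnaghan3Volume_mono_bulkModulus {V₀ B₁ B₂ B₀' P : ℝ} (hV₀ : 0 ≤ V₀) (hB₁ : 0 < B₁)
    (hB12 : B₁ ≤ B₂) (hB : 4 ≤ B₀') (hP : 0 ≤ P) :
    birchMurnaghan3Volume V₀ B₁ B₀' P ≤ birchMurnaghan3Volume V₀ B₂ B₀' P := by
  have hB₂ : 0 < B₂ := lt_of_lt_of_le hB₁ hB12
  unfold birchMurnaghan3Volume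
  exact div_cube_antitone hV₀ (birchMurnaghan3QAtPressure_spec hB₂ hB hP).1
    (birchMurnaghan3QAtPressure_antitone_bulkModulus hB₁ hB12 hB hP)

/-- MONOTONE IN `B₀'`: `4 ≤ b₁ ≤ b₂ ⇒ V(P; B₀' = b₁) ≤ V(P; B₀' = b₂)` at fixed `P ≥ 0`, `B₀ > 0`
(`V₀ ≥ 0`). [cite: Poirier1991, §4.3.3 eq. (4.42) (its inverse)] -/
theorem birchMurnaghan3Volume_mono_Bprime {V₀ B₀ b₁ b₂ P : ℝ} (hV₀ : 0 ≤ V₀) (hB₀ : 0 < B₀)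
    (hb₁ : 4 ≤ b₁) (hb12 : b₁ ≤ b₂) (hP : 0 ≤ P) :
    birchMurnaghan3Volume V₀ B₀ b₁ P ≤ birchMurnaghan3Volume V₀ B₀ b₂ P := by
  have hb₂ : 4 ≤ b₂ := le_trans hb₁ hb12
  unfold birchMurnaghan3Volume
  exact div_cube_antitone hV₀ (birchMurnaghan3QAtPressure_spec hB₀ hb₂ hP).1
    (birchMurnaghan3QAtPressure_antitone_Bprime hB₀ hb₁ hb12 hP)

/-- THE CORNER RULE FOR THIRD-ORDER BIRCH–MURNAGHAN COMPARATOR INTERVALS: on the physical domain, if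
`P ∈ [P_lo, P_hi]` (`P_lo ≥ 0`), `B₀ ∈ [B_lo, B_hi]` (`B_lo > 0`) and `B₀' ∈ [b_lo, b_hi]`
(`b_lo ≥ 4`), then `V(P; B₀, B₀')` lies between the corner values `V(P_hi; B_lo, b_lo)` and
`V(P_lo; B_hi, b_hi)` (both attained): a DFT `E(V)`-fit `(B₀ ± δB₀, B₀' ± δB₀')` and a pressure
interval propagate to an exact volume interval by two root evaluations.
[cite: Poirier1991, §4.3.3 eq. (4.42) (its inverse)] -/
theorem birchMurnaghan3Volume_mem_Icc_of_box {V₀ P Plo Phi B₀ Blo Bhi B₀' blo bhi : ℝ}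
    (hV₀ : 0 ≤ V₀) (hPlo : 0 ≤ Plo) (hBlo : 0 < Blo) (hblo : 4 ≤ blo) (hP : P ∈ Icc Plo Phi)
    (hB : B₀ ∈ Icc Blo Bhi) (hb : B₀' ∈ Icc blo bhi) :
    birchMurnaghan3Volume V₀ B₀ B₀' P ∈
      Icc (birchMurnaghan3Volume V₀ Blo blo Phi) (birchMurnaghan3Volume V₀ Bhi bhi Plo) := by
  obtain ⟨hP1, hP2⟩ := hP
  obtain ⟨hB1, hB2⟩ := hB
  obtain ⟨hb1, hb2⟩ := hb
  have hP0 : 0 ≤ P := le_trans hPlo hP1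
  have hB₀ : 0 < B₀ := lt_of_lt_of_le hBlo hB1
  have hB₀' : 4 ≤ B₀' := le_trans hblo hb1
  have hBhi : 0 < Bhi := lt_of_lt_of_le hB₀ hB2
  have hbhi : 4 ≤ bhi := le_trans hB₀' hb2
  refine ⟨?_, ?_⟩
  · calc birchMurnaghan3Volume V₀ Blo blo Phi
        ≤ birchMurnaghan3Volume V₀ Blo blo P :=
          birchMurnaghan3Volume_antitone_pressure hV₀ hBlo hblo hP0 hP2
      _ ≤ birchMurnaghan3Volume V₀ B₀ blo P :=
          birchMurnaghan3Volume_mono_bulkModulus hV₀ hBlo hB1 hblo hP0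
      _ ≤ birchMurnaghan3Volume V₀ B₀ B₀' P :=
          birchMurnaghan3Volume_mono_Bprime hV₀ hB₀ hblo hb1 hP0
  · calc birchMurnaghan3Volume V₀ B₀ B₀' P
        ≤ birchMurnaghan3Volume V₀ Bhi B₀' P :=
          birchMurnaghan3Volume_mono_bulkModulus hV₀ hB₀ hB2 hB₀' hP0
      _ ≤ birchMurnaghan3Volume V₀ Bhi bhi P :=
          birchMurnaghan3Volume_mono_Bprime hV₀ hBhi hB₀' hb2 hP0
      _ ≤ birchMurnaghan3Volume V₀ Bhi bhi Plo :=
          birchMurnaghan3Volume_antitone_pressure hV₀ hBhi hbhi hPlo hP1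

/-! ## The `B₀' < 4` branch of the third-order Birch–Murnaghan law: its monotone domain

For `B₀' < 4` write `β = (3/4)(4 - B₀') > 0` and `u = q² - 1 ≥ 0`; then
`h(q) = (3/2) q⁵ · u (1 - β u)`, and `u (1 - β u)` increases exactly while `u ≤ 1/(2β)`.  Hence the
printed shape is STRICTLY INCREASING — so the law is invertible — on the compressions
`1 ≤ q² ≤ S`, `S = 1 + 1/(2β) = 1 + 2/(3(4 - B₀'))`, which is HALF-WAY (in `q²`) to the spurious
zero `q_c² = 1 + 4/(3(4 - B₀'))` of `birchMurnaghan3Pressure_eq_zero_of_lt_four`.  Equivalently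
`P(V)` is strictly decreasing on `[V_m, V₀]`, `V_m = V₀ / S^{3/2}`, taking there every pressure
`0 ≤ P ≤ P_m = B₀ S^{5/2} / (2 (4 - B₀'))` exactly once; the restricted inverse
`birchMurnaghan3RestrictedVolume` obeys the same monotonicity package and CORNER RULE as the
`B₀' ≥ 4` root.  (`B₀' = 3.7`: `V_m / V₀ = 0.173`, `P_m = 31 B₀`; `B₀' = 3.5`: `0.281`, `8.3 B₀`;
`B₀' = 3`: `0.465`, `1.79 B₀`.)  Elementary consequences of the printed law (no new facts). -/

/-- For `B₀' < 4`: the SQUARED COMPRESSION LIMIT `S = 1 + 2/(3(4 - B₀'))` of the monotone branch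
of the third-order Birch–Murnaghan shape (`q² ≤ S`).
[cite: Poirier1991, §4.3.3 eq. (4.42) (elementary consequence)] -/
def birchMurnaghan3MonotoneSqLimit (B₀' : ℝ) : ℝ := 1 + 2 / (3 * (4 - B₀'))

/-- The COMPRESSION LIMIT `Q = √S` of the monotone branch (`B₀' < 4`).
[cite: Poirier1991, §4.3.3 eq. (4.42) (elementary consequence)] -/
def birchMurnaghan3MonotoneQLimit (B₀' : ℝ) : ℝ := Real.sqrt (birchMurnaghan3MonotoneSqLimit B₀')

/-- The VOLUME LIMIT `V_m = V₀ / Q³` of the monotone branch (`B₀' < 4`).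
[cite: Poirier1991, §4.3.3 eq. (4.42) (elementary consequence)] -/
def birchMurnaghan3MonotoneVolume (V₀ B₀' : ℝ) : ℝ := V₀ / birchMurnaghan3MonotoneQLimit B₀' ^ 3

/-- The PRESSURE LIMIT `P_m = B₀ h(Q)` of the monotone branch (`B₀' < 4`): the largest pressure for
which the restricted inverse is defined. [cite: Poirier1991, §4.3.3 eq. (4.42) (elementary
consequence)] -/
def birchMurnaghan3MonotonePressure (B₀ B₀' : ℝ) : ℝ :=
  B₀ * birchMurnaghan3Shape B₀' (birchMurnaghan3MonotoneQLimit B₀')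

/-- `S > 1` for `B₀' < 4`. [cite: Poirier1991, §4.3.3 eq. (4.42) (elementary consequence)] -/
theorem one_lt_birchMurnaghan3MonotoneSqLimit {B₀' : ℝ} (hB : B₀' < 4) :
    1 < birchMurnaghan3MonotoneSqLimit B₀' := by
  unfold birchMurnaghan3MonotoneSqLimit
  have : 0 < 2 / (3 * (4 - B₀')) := by
    have h4 : 0 < 4 - B₀' := by linarith
    positivity
  linarith

/-- HALF-WAY TO THE SPURIOUS ZERO: `S < q_c² = 1 + 4/(3(4 - B₀'))` (`B₀' < 4`).
[cite: Poirier1991, §4.3.3 eq. (4.42) (elementary consequence)] -/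
theorem birchMurnaghan3MonotoneSqLimit_lt_zeroSq {B₀' : ℝ} (hB : B₀' < 4) :
    birchMurnaghan3MonotoneSqLimit B₀' < 1 + 4 / (3 * (4 - B₀')) := by
  unfold birchMurnaghan3MonotoneSqLimit
  have h4 : 0 < 3 * (4 - B₀') := by linarith
  have : 2 / (3 * (4 - B₀')) < 4 / (3 * (4 - B₀')) := div_lt_div_of_pos_right (by norm_num) h4
  linarith

/-- `S` is monotone in `B₀'` below 4: `b₁ ≤ b₂ < 4 ⇒ S(b₁) ≤ S(b₂)`.
[cite: Poirier1991, §4.3.3 eq. (4.42) (elementary consequence)] -/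
theorem birchMurnaghan3MonotoneSqLimit_mono {b₁ b₂ : ℝ} (hb : b₁ ≤ b₂) (hb₂ : b₂ < 4) :
    birchMurnaghan3MonotoneSqLimit b₁ ≤ birchMurnaghan3MonotoneSqLimit b₂ := by
  unfold birchMurnaghan3MonotoneSqLimit
  have h₂ : 0 < 3 * (4 - b₂) := by linarith
  have : 2 / (3 * (4 - b₁)) ≤ 2 / (3 * (4 - b₂)) :=
    div_le_div_of_nonneg_left (by norm_num) h₂ (by linarith)
  linarith

/-- `Q > 1` for `B₀' < 4`. [cite: Poirier1991, §4.3.3 eq. (4.42) (elementary consequence)] -/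
theorem one_lt_birchMurnaghan3MonotoneQLimit {B₀' : ℝ} (hB : B₀' < 4) :
    1 < birchMurnaghan3MonotoneQLimit B₀' := by
  unfold birchMurnaghan3MonotoneQLimit
  rw [show (1 : ℝ) = Real.sqrt 1 by simp]
  exact Real.sqrt_lt_sqrt zero_le_one (one_lt_birchMurnaghan3MonotoneSqLimit hB)

/-- `Q > 0` for `B₀' < 4`. [cite: Poirier1991, §4.3.3 eq. (4.42) (elementary consequence)] -/
theorem birchMurnaghan3MonotoneQLimit_pos {B₀' : ℝ} (hB : B₀' < 4) :
    0 < birchMurnaghan3MonotoneQLimit B₀' :=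
  lt_trans one_pos (one_lt_birchMurnaghan3MonotoneQLimit hB)

/-- `Q² = S` (`B₀' < 4`). [cite: Poirier1991, §4.3.3 eq. (4.42) (elementary consequence)] -/
theorem birchMurnaghan3MonotoneQLimit_sq {B₀' : ℝ} (hB : B₀' < 4) :
    birchMurnaghan3MonotoneQLimit B₀' ^ 2 = birchMurnaghan3MonotoneSqLimit B₀' :=
  Real.sq_sqrt (le_of_lt (lt_trans one_pos (one_lt_birchMurnaghan3MonotoneSqLimit hB)))

/-- `Q` is monotone in `B₀'` below 4. [cite: Poirier1991, §4.3.3 eq. (4.42) (elementary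
consequence)] -/
theorem birchMurnaghan3MonotoneQLimit_mono {b₁ b₂ : ℝ} (hb : b₁ ≤ b₂) (hb₂ : b₂ < 4) :
    birchMurnaghan3MonotoneQLimit b₁ ≤ birchMurnaghan3MonotoneQLimit b₂ :=
  Real.sqrt_le_sqrt (birchMurnaghan3MonotoneSqLimit_mono hb hb₂)

/-- The shape in factored form: `h(q) = (3/2) q⁵ · (q² - 1)(1 - (3/4)(4 - B₀')(q² - 1))`.
[cite: Poirier1991, §4.3.3 eq. (4.42) (elementary consequence)] -/
theorem birchMurnaghan3Shape_eq_factored (B₀' q : ℝ) :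
    birchMurnaghan3Shape B₀' q =
      3 / 2 * q ^ 5 * ((q ^ 2 - 1) * (1 - 3 / 4 * (4 - B₀') * (q ^ 2 - 1))) := by
  unfold birchMurnaghan3Shape
  ring

/-- On the monotone branch `1 ≤ q ≤ Q` (`B₀' < 4`): `(3/4)(4 - B₀')(q² - 1) ≤ 1/2`.
[cite: Poirier1991, §4.3.3 eq. (4.42) (elementary consequence)] -/
private lemma beta_mul_le_half {B₀' q : ℝ} (hB : B₀' < 4)
    (hq : q ∈ Icc 1 (birchMurnaghan3MonotoneQLimit B₀')) :
    3 / 4 * (4 - B₀') * (q ^ 2 - 1) ≤ 1 / 2 := by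
  obtain ⟨hq1, hqQ⟩ := hq
  have h4 : 0 < 4 - B₀' := by linarith
  have hq2 : q ^ 2 ≤ birchMurnaghan3MonotoneSqLimit B₀' := by
    rw [← birchMurnaghan3MonotoneQLimit_sq hB]
    exact pow_le_pow_left₀ (by linarith) hqQ 2
  unfold birchMurnaghan3MonotoneSqLimit at hq2
  have hu : q ^ 2 - 1 ≤ 2 / (3 * (4 - B₀')) := by linarith
  calc 3 / 4 * (4 - B₀') * (q ^ 2 - 1) ≤ 3 / 4 * (4 - B₀') * (2 / (3 * (4 - B₀'))) :=
        mul_le_mul_of_nonneg_left hu (by positivity)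
    _ = 1 / 2 := by field_simp; ring

/-- FOR `B₀' < 4` THE THIRD-ORDER BIRCH–MURNAGHAN SHAPE IS STRICTLY INCREASING ON `1 ≤ q ≤ Q`,
`Q² = 1 + 2/(3(4 - B₀'))`. [cite: Poirier1991, §4.3.3 eq. (4.42) (elementary consequence)] -/
theorem birchMurnaghan3Shape_strictMonoOn_of_lt_four {B₀' : ℝ} (hB : B₀' < 4) :
    StrictMonoOn (birchMurnaghan3Shape B₀') (Icc 1 (birchMurnaghan3MonotoneQLimit B₀')) := by
  intro q₁ hq₁ q₂ hq₂ hlt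
  have h1 : (1 : ℝ) ≤ q₁ := hq₁.1
  have h2 : (1 : ℝ) ≤ q₂ := hq₂.1
  set β : ℝ := 3 / 4 * (4 - B₀') with hβ
  have h4 : 0 < 4 - B₀' := by linarith
  have hβpos : 0 < β := by rw [hβ]; positivity
  set u₁ : ℝ := q₁ ^ 2 - 1 with hu₁
  set u₂ : ℝ := q₂ ^ 2 - 1 with hu₂
  have hu₁0 : 0 ≤ u₁ := by rw [hu₁]; nlinarith
  have hult : u₁ < u₂ := by rw [hu₁, hu₂]; nlinarith
  have hβu₂ : β * u₂ ≤ 1 / 2 := by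
    have := beta_mul_le_half hB hq₂
    rw [hβ, hu₂]; linarith
  have hβu₁ : β * u₁ ≤ 1 / 2 := by
    have := beta_mul_le_half hB hq₁
    rw [hβ, hu₁]; linarith
  -- φ(u) = u (1 - β u) is nonnegative at u₁ and strictly larger at u₂
  have hφ₁ : 0 ≤ u₁ * (1 - β * u₁) := mul_nonneg hu₁0 (by linarith)
  have hφlt : u₁ * (1 - β * u₁) < u₂ * (1 - β * u₂) := by
    have hsum : β * (u₁ + u₂) < 1 := by nlinarith
    have : u₂ * (1 - β * u₂) - u₁ * (1 - β * u₁) = (u₂ - u₁) * (1 - β * (u₁ + u₂)) := by ring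
    nlinarith [mul_pos (sub_pos.mpr hult) (sub_pos.mpr hsum)]
  have hq5 : q₁ ^ 5 ≤ q₂ ^ 5 := pow_le_pow_left₀ (by linarith) hlt.le 5
  have hq5pos : 0 < q₂ ^ 5 := by positivity
  rw [birchMurnaghan3Shape_eq_factored, birchMurnaghan3Shape_eq_factored]
  show 3 / 2 * q₁ ^ 5 * (u₁ * (1 - β * u₁)) < 3 / 2 * q₂ ^ 5 * (u₂ * (1 - β * u₂))
  calc 3 / 2 * q₁ ^ 5 * (u₁ * (1 - β * u₁))
      ≤ 3 / 2 * q₂ ^ 5 * (u₁ * (1 - β * u₁)) :=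
        mul_le_mul_of_nonneg_right (by linarith) hφ₁
    _ < 3 / 2 * q₂ ^ 5 * (u₂ * (1 - β * u₂)) :=
        mul_lt_mul_of_pos_left hφlt (by positivity)

/-- `h(q) ≥ 0` on the monotone branch `1 ≤ q ≤ Q` (`B₀' < 4`).
[cite: Poirier1991, §4.3.3 eq. (4.42) (elementary consequence)] -/
theorem birchMurnaghan3Shape_nonneg_of_lt_four {B₀' q : ℝ} (hB : B₀' < 4)
    (hq : q ∈ Icc 1 (birchMurnaghan3MonotoneQLimit B₀')) : 0 ≤ birchMurnaghan3Shape B₀' q := by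
  have h1mem : (1 : ℝ) ∈ Icc 1 (birchMurnaghan3MonotoneQLimit B₀') :=
    ⟨le_rfl, (one_lt_birchMurnaghan3MonotoneQLimit hB).le⟩
  have := (birchMurnaghan3Shape_strictMonoOn_of_lt_four hB).monotoneOn h1mem hq hq.1
  rwa [birchMurnaghan3Shape_one] at this

/-- THE SHAPE AT THE COMPRESSION LIMIT: `h(Q) = Q⁵ / (2(4 - B₀'))` (`B₀' < 4`), i.e.
`P_m = B₀ Q⁵ / (2(4 - B₀')) = B₀ S^{5/2} / (2(4 - B₀'))`.
[cite: Poirier1991, §4.3.3 eq. (4.42) (elementary consequence)] -/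
theorem birchMurnaghan3Shape_monotoneQLimit {B₀' : ℝ} (hB : B₀' < 4) :
    birchMurnaghan3Shape B₀' (birchMurnaghan3MonotoneQLimit B₀') =
      birchMurnaghan3MonotoneQLimit B₀' ^ 5 / (2 * (4 - B₀')) := by
  set Q := birchMurnaghan3MonotoneQLimit B₀' with hQ
  have h4 : 4 - B₀' ≠ 0 := by linarith
  have hQ2 : Q ^ 2 = 1 + 2 / (3 * (4 - B₀')) := by
    rw [hQ, birchMurnaghan3MonotoneQLimit_sq hB]; rfl
  rw [birchMurnaghan3Shape_eq_factored, hQ2]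
  field_simp
  ring

/-- `P_m = B₀ Q⁵ / (2(4 - B₀'))` (`B₀' < 4`). [cite: Poirier1991, §4.3.3 eq. (4.42) (elementary
consequence)] -/
theorem birchMurnaghan3MonotonePressure_eq {B₀' : ℝ} (hB : B₀' < 4) (B₀ : ℝ) :
    birchMurnaghan3MonotonePressure B₀ B₀' =
      B₀ * birchMurnaghan3MonotoneQLimit B₀' ^ 5 / (2 * (4 - B₀')) := by
  rw [birchMurnaghan3MonotonePressure, birchMurnaghan3Shape_monotoneQLimit hB]
  ring

/-- `P_m ≥ 0` for `B₀ ≥ 0`, `B₀' < 4`. [cite: Poirier1991, §4.3.3 eq. (4.42) (elementary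
consequence)] -/
theorem birchMurnaghan3MonotonePressure_nonneg {B₀ B₀' : ℝ} (hB₀ : 0 ≤ B₀) (hB : B₀' < 4) :
    0 ≤ birchMurnaghan3MonotonePressure B₀ B₀' :=
  mul_nonneg hB₀ (birchMurnaghan3Shape_nonneg_of_lt_four hB
    ⟨(one_lt_birchMurnaghan3MonotoneQLimit hB).le, le_rfl⟩)

/-- `P_m` is monotone in `B₀` (`B₀' < 4`). [cite: Poirier1991, §4.3.3 eq. (4.42) (elementary
consequence)] -/
theorem birchMurnaghan3MonotonePressure_mono_bulkModulus {B₁ B₂ B₀' : ℝ} (hB12 : B₁ ≤ B₂)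
    (hB : B₀' < 4) :
    birchMurnaghan3MonotonePressure B₁ B₀' ≤ birchMurnaghan3MonotonePressure B₂ B₀' :=
  mul_le_mul_of_nonneg_right hB12 (birchMurnaghan3Shape_nonneg_of_lt_four hB
    ⟨(one_lt_birchMurnaghan3MonotoneQLimit hB).le, le_rfl⟩)

/-- `P_m` is monotone in `B₀'` below 4 (`B₀ ≥ 0`): a softer `B₀'` has the smaller monotone range.
[cite: Poirier1991, §4.3.3 eq. (4.42) (elementary consequence)] -/
theorem birchMurnaghan3MonotonePressure_mono_Bprime {B₀ b₁ b₂ : ℝ} (hB₀ : 0 ≤ B₀) (hb : b₁ ≤ b₂)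
    (hb₂ : b₂ < 4) :
    birchMurnaghan3MonotonePressure B₀ b₁ ≤ birchMurnaghan3MonotonePressure B₀ b₂ := by
  have hb₁ : b₁ < 4 := lt_of_le_of_lt hb hb₂
  unfold birchMurnaghan3MonotonePressure
  apply mul_le_mul_of_nonneg_left _ hB₀
  have hQ₁ : 1 ≤ birchMurnaghan3MonotoneQLimit b₁ := (one_lt_birchMurnaghan3MonotoneQLimit hb₁).le
  have hQ12 : birchMurnaghan3MonotoneQLimit b₁ ≤ birchMurnaghan3MonotoneQLimit b₂ :=
    birchMurnaghan3MonotoneQLimit_mono hb hb₂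
  calc birchMurnaghan3Shape b₁ (birchMurnaghan3MonotoneQLimit b₁)
      ≤ birchMurnaghan3Shape b₂ (birchMurnaghan3MonotoneQLimit b₁) :=
        birchMurnaghan3Shape_mono_Bprime hQ₁ hb
    _ ≤ birchMurnaghan3Shape b₂ (birchMurnaghan3MonotoneQLimit b₂) :=
        (birchMurnaghan3Shape_strictMonoOn_of_lt_four hb₂).monotoneOn ⟨hQ₁, hQ12⟩
          ⟨le_trans hQ₁ hQ12, le_rfl⟩ hQ12

/-- EXISTENCE OF THE RESTRICTED ROOT: for `B₀' < 4` and `0 ≤ p ≤ h(Q)` there is `q ∈ [1, Q]` with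
`h(q) = p` (intermediate value theorem). [cite: Poirier1991, §4.3.3 eq. (4.42) (elementary
consequence)] -/
theorem exists_birchMurnaghan3Shape_eq_of_lt_four {B₀' p : ℝ} (hB : B₀' < 4) (hp : 0 ≤ p)
    (hpQ : p ≤ birchMurnaghan3Shape B₀' (birchMurnaghan3MonotoneQLimit B₀')) :
    ∃ q ∈ Icc 1 (birchMurnaghan3MonotoneQLimit B₀'), birchMurnaghan3Shape B₀' q = p := by
  have hQ1 : 1 ≤ birchMurnaghan3MonotoneQLimit B₀' := (one_lt_birchMurnaghan3MonotoneQLimit hB).le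
  have hcont : ContinuousOn (birchMurnaghan3Shape B₀') (Icc 1 (birchMurnaghan3MonotoneQLimit B₀')) := by
    show ContinuousOn (fun q => 3 / 2 * (q ^ 7 - q ^ 5) * (1 + 3 / 4 * (B₀' - 4) * (q ^ 2 - 1)))
      (Icc 1 (birchMurnaghan3MonotoneQLimit B₀'))
    exact Continuous.continuousOn (by continuity)
  have hg1 : birchMurnaghan3Shape B₀' 1 ≤ p := by rw [birchMurnaghan3Shape_one]; exact hp
  exact intermediate_value_Icc hQ1 hcont ⟨hg1, hpQ⟩

/-- THE RESTRICTED BIRCH–MURNAGHAN LINEAR COMPRESSION AT PRESSURE `P` for `B₀' < 4`: the (unique)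
`q ∈ [1, Q]` with `B₀ h(q) = P` — meaningful for `B₀ > 0`, `B₀' < 4`, `0 ≤ P ≤ P_m` (junk value
otherwise). [cite: Poirier1991, §4.3.3 eq. (4.42) (its implicit inverse on the monotone branch)] -/
def birchMurnaghan3RestrictedQAtPressure (B₀ B₀' P : ℝ) : ℝ :=
  Function.invFunOn (birchMurnaghan3Shape B₀') (Icc 1 (birchMurnaghan3MonotoneQLimit B₀')) (P / B₀)

/-- THE RESTRICTED VOLUME–PRESSURE RELATION `V(P) = V₀ / q(P)³` for `B₀' < 4` (inverse of eq. (4.42)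
on `[V_m, V₀]`). [cite: Poirier1991, §4.3.3 eq. (4.42) (its implicit inverse on the monotone
branch)] -/
def birchMurnaghan3RestrictedVolume (V₀ B₀ B₀' P : ℝ) : ℝ :=
  V₀ / birchMurnaghan3RestrictedQAtPressure B₀ B₀' P ^ 3

/-- Defining property of the restricted root: `q(P) ∈ [1, Q]` and `h(q(P)) = P/B₀`
(`B₀ > 0`, `B₀' < 4`, `0 ≤ P ≤ P_m`). [cite: Poirier1991, §4.3.3 eq. (4.42) (elementary
consequence)] -/
theorem birchMurnaghan3RestrictedQAtPressure_spec {B₀ B₀' P : ℝ} (hB₀ : 0 < B₀) (hB : B₀' < 4)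
    (hP : 0 ≤ P) (hPm : P ≤ birchMurnaghan3MonotonePressure B₀ B₀') :
    birchMurnaghan3RestrictedQAtPressure B₀ B₀' P ∈ Icc 1 (birchMurnaghan3MonotoneQLimit B₀') ∧
      birchMurnaghan3Shape B₀' (birchMurnaghan3RestrictedQAtPressure B₀ B₀' P) = P / B₀ := by
  have hpQ : P / B₀ ≤ birchMurnaghan3Shape B₀' (birchMurnaghan3MonotoneQLimit B₀') := by
    rw [div_le_iff₀ hB₀, mul_comm]
    exact hPm
  exact Function.invFunOn_pos (exists_birchMurnaghan3Shape_eq_of_lt_four hB (div_nonneg hP hB₀.le) hpQ)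

/-- UNIQUENESS of the restricted root: any `q ∈ [1, Q]` solving `h(q) = P/B₀` is `q(P)`.
[cite: Poirier1991, §4.3.3 eq. (4.42) (elementary consequence)] -/
theorem birchMurnaghan3RestrictedQAtPressure_eq_of_shape_eq {B₀ B₀' P q : ℝ} (hB₀ : 0 < B₀)
    (hB : B₀' < 4) (hP : 0 ≤ P) (hPm : P ≤ birchMurnaghan3MonotonePressure B₀ B₀')
    (hq : q ∈ Icc 1 (birchMurnaghan3MonotoneQLimit B₀'))
    (hshape : birchMurnaghan3Shape B₀' q = P / B₀) :
    birchMurnaghan3RestrictedQAtPressure B₀ B₀' P = q := by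
  obtain ⟨hmem, heq⟩ := birchMurnaghan3RestrictedQAtPressure_spec hB₀ hB hP hPm
  exact (birchMurnaghan3Shape_strictMonoOn_of_lt_four hB).injOn hmem hq (heq.trans hshape.symm)

/-- `q((V₀/q'³)) = q'`: the compression ratio of `V₀/q³` is `q` (`q > 0`, `V₀ > 0`). [folklore] -/
private lemma cubeRootRatio_div_cube {V₀ q : ℝ} (hV₀ : 0 < V₀) (hq : 0 < q) :
    cubeRootRatio V₀ (V₀ / q ^ 3) = q := by
  unfold cubeRootRatio
  rw [div_div_eq_mul_div, mul_div_cancel_left₀ _ hV₀.ne',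
    show ((1 : ℝ) / 3) = ((3 : ℕ) : ℝ)⁻¹ by norm_num, Real.pow_rpow_inv_natCast hq.le (by norm_num)]

/-- `q ≤ Q` when `V ≥ V₀/Q³` (`V₀, V, Q > 0`). [folklore] -/
private lemma cubeRootRatio_le_of_div_cube_le {V₀ V Q : ℝ} (hV₀ : 0 < V₀) (hV : 0 < V) (hQ : 0 < Q)
    (hle : V₀ / Q ^ 3 ≤ V) : cubeRootRatio V₀ V ≤ Q := by
  have hratio : V₀ / V ≤ Q ^ 3 := by
    rw [div_le_iff₀ hV]
    have := (div_le_iff₀ (pow_pos hQ 3)).mp hle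
    linarith
  unfold cubeRootRatio
  calc (V₀ / V) ^ ((1 : ℝ) / 3) ≤ (Q ^ 3) ^ ((1 : ℝ) / 3) :=
        Real.rpow_le_rpow (div_pos hV₀ hV).le hratio (by norm_num)
    _ = Q := by
        rw [show ((1 : ℝ) / 3) = ((3 : ℕ) : ℝ)⁻¹ by norm_num, Real.pow_rpow_inv_natCast hQ.le (by norm_num)]

/-- `V_m > 0` (`V₀ > 0`, `B₀' < 4`). [cite: Poirier1991, §4.3.3 eq. (4.42) (elementary
consequence)] -/
theorem birchMurnaghan3MonotoneVolume_pos {V₀ B₀' : ℝ} (hV₀ : 0 < V₀) (hB : B₀' < 4) :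
    0 < birchMurnaghan3MonotoneVolume V₀ B₀' :=
  div_pos hV₀ (pow_pos (birchMurnaghan3MonotoneQLimit_pos hB) 3)

/-- `V_m < V₀` (`V₀ > 0`, `B₀' < 4`). [cite: Poirier1991, §4.3.3 eq. (4.42) (elementary
consequence)] -/
theorem birchMurnaghan3MonotoneVolume_lt_self {V₀ B₀' : ℝ} (hV₀ : 0 < V₀) (hB : B₀' < 4) :
    birchMurnaghan3MonotoneVolume V₀ B₀' < V₀ := by
  unfold birchMurnaghan3MonotoneVolume
  have hQ3 : 1 < birchMurnaghan3MonotoneQLimit B₀' ^ 3 :=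
    one_lt_pow₀ (one_lt_birchMurnaghan3MonotoneQLimit hB) (by norm_num)
  rw [div_lt_iff₀ (lt_trans one_pos hQ3)]
  nlinarith

/-- For `V ∈ [V_m, V₀]` the compression `q = (V₀/V)^{1/3}` lies in `[1, Q]`. [folklore] -/
private lemma cubeRootRatio_mem_Icc_of_mem {V₀ B₀' V : ℝ} (hV₀ : 0 < V₀) (hB : B₀' < 4)
    (hV : V ∈ Icc (birchMurnaghan3MonotoneVolume V₀ B₀') V₀) :
    cubeRootRatio V₀ V ∈ Icc 1 (birchMurnaghan3MonotoneQLimit B₀') := by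
  have hVpos : 0 < V := lt_of_lt_of_le (birchMurnaghan3MonotoneVolume_pos hV₀ hB) hV.1
  exact ⟨one_le_cubeRootRatio hVpos hV.2,
    cubeRootRatio_le_of_div_cube_le hV₀ hVpos (birchMurnaghan3MonotoneQLimit_pos hB) hV.1⟩

/-- FOR `B₀' < 4` THE THIRD-ORDER BIRCH–MURNAGHAN PRESSURE IS STRICTLY DECREASING IN VOLUME ON
`[V_m, V₀]`, `V_m = V₀ / S^{3/2}` (`V₀ > 0`, `B₀ > 0`). [cite: Poirier1991, §4.3.3 eq. (4.42)
(elementary consequence)] -/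
theorem birchMurnaghan3Pressure_strictAntiOn_of_lt_four {V₀ B₀ B₀' : ℝ} (hV₀ : 0 < V₀)
    (hB₀ : 0 < B₀) (hB : B₀' < 4) :
    StrictAntiOn (birchMurnaghan3Pressure V₀ B₀ B₀')
      (Icc (birchMurnaghan3MonotoneVolume V₀ B₀') V₀) := by
  intro V₁ hV₁ V₂ hV₂ hlt
  have hV₁pos : 0 < V₁ := lt_of_lt_of_le (birchMurnaghan3MonotoneVolume_pos hV₀ hB) hV₁.1
  have hV₂pos : 0 < V₂ := lt_of_lt_of_le (birchMurnaghan3MonotoneVolume_pos hV₀ hB) hV₂.1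
  have hq₁ := cubeRootRatio_mem_Icc_of_mem hV₀ hB hV₁
  have hq₂ := cubeRootRatio_mem_Icc_of_mem hV₀ hB hV₂
  have hqlt : cubeRootRatio V₀ V₂ < cubeRootRatio V₀ V₁ :=
    cubeRootRatio_lt_cubeRootRatio hV₀ hV₁pos hlt
  show birchMurnaghan3Pressure V₀ B₀ B₀' V₂ < birchMurnaghan3Pressure V₀ B₀ B₀' V₁
  rw [birchMurnaghan3Pressure_eq_shape hV₀ hV₂pos, birchMurnaghan3Pressure_eq_shape hV₀ hV₁pos]
  exact mul_lt_mul_of_pos_left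
    (birchMurnaghan3Shape_strictMonoOn_of_lt_four hB hq₂ hq₁ hqlt) hB₀

/-- THE PRESSURE AT THE VOLUME LIMIT IS `P_m`: `P(V_m) = P_m` (`V₀ > 0`, `B₀' < 4`).
[cite: Poirier1991, §4.3.3 eq. (4.42) (elementary consequence)] -/
theorem birchMurnaghan3Pressure_monotoneVolume {V₀ B₀' : ℝ} (hV₀ : 0 < V₀) (hB : B₀' < 4)
    (B₀ : ℝ) :
    birchMurnaghan3Pressure V₀ B₀ B₀' (birchMurnaghan3MonotoneVolume V₀ B₀') =
      birchMurnaghan3MonotonePressure B₀ B₀' := by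
  rw [birchMurnaghan3Pressure_eq_shape hV₀ (birchMurnaghan3MonotoneVolume_pos hV₀ hB),
    birchMurnaghan3MonotoneVolume, cubeRootRatio_div_cube hV₀ (birchMurnaghan3MonotoneQLimit_pos hB),
    birchMurnaghan3MonotonePressure]

/-- RANGE ON THE MONOTONE DOMAIN: `0 ≤ P(V) ≤ P_m` for `V ∈ [V_m, V₀]` (`V₀ > 0`, `B₀ > 0`,
`B₀' < 4`). [cite: Poirier1991, §4.3.3 eq. (4.42) (elementary consequence)] -/
theorem birchMurnaghan3Pressure_mem_Icc_of_lt_four {V₀ B₀ B₀' V : ℝ} (hV₀ : 0 < V₀) (hB₀ : 0 < B₀)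
    (hB : B₀' < 4) (hV : V ∈ Icc (birchMurnaghan3MonotoneVolume V₀ B₀') V₀) :
    birchMurnaghan3Pressure V₀ B₀ B₀' V ∈ Icc 0 (birchMurnaghan3MonotonePressure B₀ B₀') := by
  have hanti := (birchMurnaghan3Pressure_strictAntiOn_of_lt_four hV₀ hB₀ hB).antitoneOn
  have hVm : birchMurnaghan3MonotoneVolume V₀ B₀' ∈ Icc (birchMurnaghan3MonotoneVolume V₀ B₀') V₀ :=
    ⟨le_rfl, (birchMurnaghan3MonotoneVolume_lt_self hV₀ hB).le⟩
  have hV₀mem : V₀ ∈ Icc (birchMurnaghan3MonotoneVolume V₀ B₀') V₀ :=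
    ⟨(birchMurnaghan3MonotoneVolume_lt_self hV₀ hB).le, le_rfl⟩
  refine ⟨?_, ?_⟩
  · have := hanti hV hV₀mem hV.2
    rwa [birchMurnaghan3Pressure_self hV₀] at this
  · have := hanti hVm hV hV.1
    rwa [birchMurnaghan3Pressure_monotoneVolume hV₀ hB] at this

/-- THE RESTRICTED ROOT SOLVES THE EQUATION OF STATE: `P(V(P)) = P` for `0 ≤ P ≤ P_m`
(`V₀ > 0`, `B₀ > 0`, `B₀' < 4`). [cite: Poirier1991, §4.3.3 eq. (4.42) (elementary consequence)] -/
theorem birchMurnaghan3Pressure_restrictedVolume {V₀ B₀ B₀' P : ℝ} (hV₀ : 0 < V₀) (hB₀ : 0 < B₀)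
    (hB : B₀' < 4) (hP : 0 ≤ P) (hPm : P ≤ birchMurnaghan3MonotonePressure B₀ B₀') :
    birchMurnaghan3Pressure V₀ B₀ B₀' (birchMurnaghan3RestrictedVolume V₀ B₀ B₀' P) = P := by
  obtain ⟨hmem, heq⟩ := birchMurnaghan3RestrictedQAtPressure_spec hB₀ hB hP hPm
  have hq0 : 0 < birchMurnaghan3RestrictedQAtPressure B₀ B₀' P := lt_of_lt_of_le one_pos hmem.1
  have hVpos : 0 < birchMurnaghan3RestrictedVolume V₀ B₀ B₀' P := div_pos hV₀ (pow_pos hq0 3)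
  rw [birchMurnaghan3Pressure_eq_shape hV₀ hVpos, birchMurnaghan3RestrictedVolume,
    cubeRootRatio_div_cube hV₀ hq0, heq]
  field_simp

/-- THE RESTRICTED ROOT IS THE INVERSE ON `[V_m, V₀]`: `V(P(V)) = V` there (`B₀ > 0`, `B₀' < 4`).
[cite: Poirier1991, §4.3.3 eq. (4.42) (elementary consequence)] -/
theorem birchMurnaghan3RestrictedVolume_pressure {V₀ B₀ B₀' V : ℝ} (hV₀ : 0 < V₀) (hB₀ : 0 < B₀)
    (hB : B₀' < 4) (hV : V ∈ Icc (birchMurnaghan3MonotoneVolume V₀ B₀') V₀) :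
    birchMurnaghan3RestrictedVolume V₀ B₀ B₀' (birchMurnaghan3Pressure V₀ B₀ B₀' V) = V := by
  have hVpos : 0 < V := lt_of_lt_of_le (birchMurnaghan3MonotoneVolume_pos hV₀ hB) hV.1
  have hqmem := cubeRootRatio_mem_Icc_of_mem hV₀ hB hV
  have hPmem := birchMurnaghan3Pressure_mem_Icc_of_lt_four hV₀ hB₀ hB hV
  have hshape : birchMurnaghan3Shape B₀' (cubeRootRatio V₀ V) =
      birchMurnaghan3Pressure V₀ B₀ B₀' V / B₀ := by
    rw [birchMurnaghan3Pressure_eq_shape hV₀ hVpos]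
    field_simp
  have hq : birchMurnaghan3RestrictedQAtPressure B₀ B₀' (birchMurnaghan3Pressure V₀ B₀ B₀' V) =
      cubeRootRatio V₀ V :=
    birchMurnaghan3RestrictedQAtPressure_eq_of_shape_eq hB₀ hB hPmem.1 hPmem.2 hqmem hshape
  unfold birchMurnaghan3RestrictedVolume
  rw [hq, cubeRootRatio_pow_three hV₀ hVpos]
  field_simp

/-- UNIQUENESS OF THE VOLUME AT PRESSURE on the monotone domain: the only `V ∈ [V_m, V₀]` with
`P(V) = P` is `V(P)` (`B₀ > 0`, `B₀' < 4`). [cite: Poirier1991, §4.3.3 eq. (4.42) (elementary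
consequence)] -/
theorem eq_birchMurnaghan3RestrictedVolume_of_pressure_eq {V₀ B₀ B₀' V P : ℝ} (hV₀ : 0 < V₀)
    (hB₀ : 0 < B₀) (hB : B₀' < 4) (hV : V ∈ Icc (birchMurnaghan3MonotoneVolume V₀ B₀') V₀)
    (h : birchMurnaghan3Pressure V₀ B₀ B₀' V = P) :
    V = birchMurnaghan3RestrictedVolume V₀ B₀ B₀' P := by
  rw [← h, birchMurnaghan3RestrictedVolume_pressure hV₀ hB₀ hB hV]

/-- `V(0) = V₀` on the restricted branch (`B₀ > 0`, `B₀' < 4`).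
[cite: Poirier1991, §4.3.3 eq. (4.42) (elementary consequence)] -/
theorem birchMurnaghan3RestrictedVolume_zero {B₀ B₀' : ℝ} (hB₀ : 0 < B₀) (hB : B₀' < 4) (V₀ : ℝ) :
    birchMurnaghan3RestrictedVolume V₀ B₀ B₀' 0 = V₀ := by
  have hq : birchMurnaghan3RestrictedQAtPressure B₀ B₀' 0 = 1 :=
    birchMurnaghan3RestrictedQAtPressure_eq_of_shape_eq hB₀ hB le_rfl
      (birchMurnaghan3MonotonePressure_nonneg hB₀.le hB)
      ⟨le_rfl, (one_lt_birchMurnaghan3MonotoneQLimit hB).le⟩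
      (by rw [birchMurnaghan3Shape_one]; simp)
  simp [birchMurnaghan3RestrictedVolume, hq]

/-- The restricted root lies in the monotone domain: `V_m ≤ V(P) ≤ V₀` for `0 ≤ P ≤ P_m`
(`V₀ ≥ 0`, `B₀ > 0`, `B₀' < 4`). [cite: Poirier1991, §4.3.3 eq. (4.42) (elementary consequence)] -/
theorem birchMurnaghan3RestrictedVolume_mem_Icc {V₀ B₀ B₀' P : ℝ} (hV₀ : 0 ≤ V₀) (hB₀ : 0 < B₀)
    (hB : B₀' < 4) (hP : 0 ≤ P) (hPm : P ≤ birchMurnaghan3MonotonePressure B₀ B₀') :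
    birchMurnaghan3RestrictedVolume V₀ B₀ B₀' P ∈ Icc (birchMurnaghan3MonotoneVolume V₀ B₀') V₀ := by
  obtain ⟨⟨hq1, hqQ⟩, _⟩ := birchMurnaghan3RestrictedQAtPressure_spec hB₀ hB hP hPm
  set q := birchMurnaghan3RestrictedQAtPressure B₀ B₀' P with hqdef
  have hq0 : 0 < q := lt_of_lt_of_le one_pos hq1
  unfold birchMurnaghan3RestrictedVolume birchMurnaghan3MonotoneVolume
  rw [← hqdef]
  refine ⟨?_, ?_⟩
  · exact div_le_div_of_nonneg_left hV₀ (pow_pos hq0 3) (pow_le_pow_left₀ hq0.le hqQ 3)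
  · calc V₀ / q ^ 3 ≤ V₀ / 1 :=
          div_le_div_of_nonneg_left hV₀ one_pos (one_le_pow₀ hq1)
      _ = V₀ := div_one _

/-- The relative compression `V(P)/V₀ = q(P)⁻³` does not depend on `V₀`:
`V(P; V₀) = V₀ · V(P; 1)`. [cite: Poirier1991, §4.3.3 eq. (4.42) (elementary consequence)] -/
theorem birchMurnaghan3RestrictedVolume_eq_mul_unit (V₀ B₀ B₀' P : ℝ) :
    birchMurnaghan3RestrictedVolume V₀ B₀ B₀' P = V₀ * birchMurnaghan3RestrictedVolume 1 B₀ B₀' P := by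
  unfold birchMurnaghan3RestrictedVolume
  ring

/-- MONOTONE IN PRESSURE (compression root): `0 ≤ P₁ ≤ P₂ ≤ P_m ⇒ q(P₁) ≤ q(P₂)` (`B₀ > 0`,
`B₀' < 4`). [cite: Poirier1991, §4.3.3 eq. (4.42) (elementary consequence)] -/
theorem birchMurnaghan3RestrictedQAtPressure_mono_pressure {B₀ B₀' P₁ P₂ : ℝ} (hB₀ : 0 < B₀)
    (hB : B₀' < 4) (hP₁ : 0 ≤ P₁) (hP : P₁ ≤ P₂) (hP₂ : P₂ ≤ birchMurnaghan3MonotonePressure B₀ B₀') :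
    birchMurnaghan3RestrictedQAtPressure B₀ B₀' P₁ ≤ birchMurnaghan3RestrictedQAtPressure B₀ B₀' P₂ := by
  obtain ⟨hm₁, he₁⟩ := birchMurnaghan3RestrictedQAtPressure_spec hB₀ hB hP₁ (le_trans hP hP₂)
  obtain ⟨hm₂, he₂⟩ := birchMurnaghan3RestrictedQAtPressure_spec hB₀ hB (le_trans hP₁ hP) hP₂
  rw [← (birchMurnaghan3Shape_strictMonoOn_of_lt_four hB).le_iff_le hm₁ hm₂, he₁, he₂]
  exact div_le_div_of_nonneg_right hP hB₀.le

/-- ANTITONE IN THE BULK MODULUS (compression root): `0 < B₁ ≤ B₂`, `0 ≤ P ≤ P_m(B₁)` ⇒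
`q(P; B₂) ≤ q(P; B₁)` (`B₀' < 4`). [cite: Poirier1991, §4.3.3 eq. (4.42) (elementary consequence)] -/
theorem birchMurnaghan3RestrictedQAtPressure_antitone_bulkModulus {B₁ B₂ B₀' P : ℝ} (hB₁ : 0 < B₁)
    (hB12 : B₁ ≤ B₂) (hB : B₀' < 4) (hP : 0 ≤ P) (hPm : P ≤ birchMurnaghan3MonotonePressure B₁ B₀') :
    birchMurnaghan3RestrictedQAtPressure B₂ B₀' P ≤ birchMurnaghan3RestrictedQAtPressure B₁ B₀' P := by
  have hB₂ : 0 < B₂ := lt_of_lt_of_le hB₁ hB12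
  have hPm₂ : P ≤ birchMurnaghan3MonotonePressure B₂ B₀' :=
    le_trans hPm (birchMurnaghan3MonotonePressure_mono_bulkModulus hB12 hB)
  obtain ⟨hm₁, he₁⟩ := birchMurnaghan3RestrictedQAtPressure_spec hB₁ hB hP hPm
  obtain ⟨hm₂, he₂⟩ := birchMurnaghan3RestrictedQAtPressure_spec hB₂ hB hP hPm₂
  rw [← (birchMurnaghan3Shape_strictMonoOn_of_lt_four hB).le_iff_le hm₂ hm₁, he₁, he₂]
  exact div_le_div_of_nonneg_left hP hB₁ hB12

/-- ANTITONE IN `B₀'` (compression root): `b₁ ≤ b₂ < 4`, `0 ≤ P ≤ P_m(b₁)` ⇒ `q_{b₂}(P) ≤ q_{b₁}(P)`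
(`B₀ > 0`): the stiffening law reaches a given pressure at a smaller compression.
[cite: Poirier1991, §4.3.3 eq. (4.42) (elementary consequence)] -/
theorem birchMurnaghan3RestrictedQAtPressure_antitone_Bprime {B₀ b₁ b₂ P : ℝ} (hB₀ : 0 < B₀)
    (hb : b₁ ≤ b₂) (hb₂ : b₂ < 4) (hP : 0 ≤ P) (hPm : P ≤ birchMurnaghan3MonotonePressure B₀ b₁) :
    birchMurnaghan3RestrictedQAtPressure B₀ b₂ P ≤ birchMurnaghan3RestrictedQAtPressure B₀ b₁ P := by
  have hb₁ : b₁ < 4 := lt_of_le_of_lt hb hb₂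
  have hPm₂ : P ≤ birchMurnaghan3MonotonePressure B₀ b₂ :=
    le_trans hPm (birchMurnaghan3MonotonePressure_mono_Bprime hB₀.le hb hb₂)
  obtain ⟨hm₁, he₁⟩ := birchMurnaghan3RestrictedQAtPressure_spec hB₀ hb₁ hP hPm
  obtain ⟨hm₂, he₂⟩ := birchMurnaghan3RestrictedQAtPressure_spec hB₀ hb₂ hP hPm₂
  -- q_{b₁} lies in the (larger) monotone domain of b₂
  have hm₁' : birchMurnaghan3RestrictedQAtPressure B₀ b₁ P ∈ Icc 1 (birchMurnaghan3MonotoneQLimit b₂) :=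
    ⟨hm₁.1, le_trans hm₁.2 (birchMurnaghan3MonotoneQLimit_mono hb hb₂)⟩
  rw [← (birchMurnaghan3Shape_strictMonoOn_of_lt_four hb₂).le_iff_le hm₂ hm₁', he₂, ← he₁]
  exact birchMurnaghan3Shape_mono_Bprime hm₁.1 hb

/-- MONOTONE IN PRESSURE: `0 ≤ P₁ ≤ P₂ ≤ P_m ⇒ V(P₂) ≤ V(P₁)` on the restricted branch
(`V₀ ≥ 0`, `B₀ > 0`, `B₀' < 4`). [cite: Poirier1991, §4.3.3 eq. (4.42) (elementary consequence)] -/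
theorem birchMurnaghan3RestrictedVolume_antitone_pressure {V₀ B₀ B₀' P₁ P₂ : ℝ} (hV₀ : 0 ≤ V₀)
    (hB₀ : 0 < B₀) (hB : B₀' < 4) (hP₁ : 0 ≤ P₁) (hP : P₁ ≤ P₂)
    (hP₂ : P₂ ≤ birchMurnaghan3MonotonePressure B₀ B₀') :
    birchMurnaghan3RestrictedVolume V₀ B₀ B₀' P₂ ≤ birchMurnaghan3RestrictedVolume V₀ B₀ B₀' P₁ := by
  have hq₁ : 0 < birchMurnaghan3RestrictedQAtPressure B₀ B₀' P₁ := lt_of_lt_of_le one_pos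
    (birchMurnaghan3RestrictedQAtPressure_spec hB₀ hB hP₁ (le_trans hP hP₂)).1.1
  unfold birchMurnaghan3RestrictedVolume
  exact div_le_div_of_nonneg_left hV₀ (pow_pos hq₁ 3) (pow_le_pow_left₀ hq₁.le
    (birchMurnaghan3RestrictedQAtPressure_mono_pressure hB₀ hB hP₁ hP hP₂) 3)

/-- MONOTONE IN THE BULK MODULUS: `0 < B₁ ≤ B₂`, `0 ≤ P ≤ P_m(B₁)` ⇒ `V(P; B₁) ≤ V(P; B₂)` on the
restricted branch (`V₀ ≥ 0`, `B₀' < 4`). [cite: Poirier1991, §4.3.3 eq. (4.42) (elementary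
consequence)] -/
theorem birchMurnaghan3RestrictedVolume_mono_bulkModulus {V₀ B₁ B₂ B₀' P : ℝ} (hV₀ : 0 ≤ V₀)
    (hB₁ : 0 < B₁) (hB12 : B₁ ≤ B₂) (hB : B₀' < 4) (hP : 0 ≤ P)
    (hPm : P ≤ birchMurnaghan3MonotonePressure B₁ B₀') :
    birchMurnaghan3RestrictedVolume V₀ B₁ B₀' P ≤ birchMurnaghan3RestrictedVolume V₀ B₂ B₀' P := by
  have hB₂ : 0 < B₂ := lt_of_lt_of_le hB₁ hB12
  have hPm₂ : P ≤ birchMurnaghan3MonotonePressure B₂ B₀' :=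
    le_trans hPm (birchMurnaghan3MonotonePressure_mono_bulkModulus hB12 hB)
  have hq₂ : 0 < birchMurnaghan3RestrictedQAtPressure B₂ B₀' P := lt_of_lt_of_le one_pos
    (birchMurnaghan3RestrictedQAtPressure_spec hB₂ hB hP hPm₂).1.1
  unfold birchMurnaghan3RestrictedVolume
  exact div_le_div_of_nonneg_left hV₀ (pow_pos hq₂ 3) (pow_le_pow_left₀ hq₂.le
    (birchMurnaghan3RestrictedQAtPressure_antitone_bulkModulus hB₁ hB12 hB hP hPm) 3)

/-- MONOTONE IN `B₀'`: `b₁ ≤ b₂ < 4`, `0 ≤ P ≤ P_m(b₁)` ⇒ `V(P; b₁) ≤ V(P; b₂)` on the restricted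
branch (`V₀ ≥ 0`, `B₀ > 0`). [cite: Poirier1991, §4.3.3 eq. (4.42) (elementary consequence)] -/
theorem birchMurnaghan3RestrictedVolume_mono_Bprime {V₀ B₀ b₁ b₂ P : ℝ} (hV₀ : 0 ≤ V₀)
    (hB₀ : 0 < B₀) (hb : b₁ ≤ b₂) (hb₂ : b₂ < 4) (hP : 0 ≤ P)
    (hPm : P ≤ birchMurnaghan3MonotonePressure B₀ b₁) :
    birchMurnaghan3RestrictedVolume V₀ B₀ b₁ P ≤ birchMurnaghan3RestrictedVolume V₀ B₀ b₂ P := by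
  have hPm₂ : P ≤ birchMurnaghan3MonotonePressure B₀ b₂ :=
    le_trans hPm (birchMurnaghan3MonotonePressure_mono_Bprime hB₀.le hb hb₂)
  have hq₂ : 0 < birchMurnaghan3RestrictedQAtPressure B₀ b₂ P := lt_of_lt_of_le one_pos
    (birchMurnaghan3RestrictedQAtPressure_spec hB₀ hb₂ hP hPm₂).1.1
  unfold birchMurnaghan3RestrictedVolume
  exact div_le_div_of_nonneg_left hV₀ (pow_pos hq₂ 3) (pow_le_pow_left₀ hq₂.le
    (birchMurnaghan3RestrictedQAtPressure_antitone_Bprime hB₀ hb hb₂ hP hPm) 3)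

/-- CORNER RULE ON THE RESTRICTED BRANCH (`B₀' < 4`): for a box `P ∈ [P_lo, P_hi]` (`P_lo ≥ 0`),
`B₀ ∈ [B_lo, B_hi]` (`B_lo > 0`), `B₀' ∈ [b_lo, b_hi]` (`b_hi < 4`) whose largest pressure stays
inside the smallest monotone range, `P_hi ≤ P_m(B_lo, b_lo)`, the volume lies between the two
extreme corners: `V(P_hi; B_lo, b_lo) ≤ V(P; B₀, B₀') ≤ V(P_lo; B_hi, b_hi)`.
[cite: Poirier1991, §4.3.3 eq. (4.42) (elementary consequence)] -/
theorem birchMurnaghan3RestrictedVolume_mem_Icc_of_box {V₀ P Plo Phi B₀ Blo Bhi B₀' blo bhi : ℝ}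
    (hV₀ : 0 ≤ V₀) (hBlo : 0 < Blo) (hbhi : bhi < 4) (hPlo : 0 ≤ Plo)
    (hP1 : Plo ≤ P) (hP2 : P ≤ Phi) (hB1 : Blo ≤ B₀) (hB2 : B₀ ≤ Bhi)
    (hb1 : blo ≤ B₀') (hb2 : B₀' ≤ bhi)
    (hPhi : Phi ≤ birchMurnaghan3MonotonePressure Blo blo) :
    birchMurnaghan3RestrictedVolume V₀ B₀ B₀' P ∈
      Icc (birchMurnaghan3RestrictedVolume V₀ Blo blo Phi)
        (birchMurnaghan3RestrictedVolume V₀ Bhi bhi Plo) := by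
  have hB₀ : 0 < B₀ := lt_of_lt_of_le hBlo hB1
  have hblt : blo < 4 := lt_of_le_of_lt (le_trans hb1 hb2) hbhi
  have hBlt : B₀' < 4 := lt_of_le_of_lt hb2 hbhi
  have hP0 : 0 ≤ P := le_trans hPlo hP1
  -- the domain conditions propagate along the chain of comparisons
  have hPm1 : P ≤ birchMurnaghan3MonotonePressure Blo blo := le_trans hP2 hPhi
  have hPm2 : P ≤ birchMurnaghan3MonotonePressure B₀ blo :=
    le_trans hPm1 (birchMurnaghan3MonotonePressure_mono_bulkModulus hB1 hblt)
  have hPm3 : P ≤ birchMurnaghan3MonotonePressure B₀ B₀' :=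
    le_trans hPm2 (birchMurnaghan3MonotonePressure_mono_Bprime hB₀.le hb1 hBlt)
  have hPm4 : Plo ≤ birchMurnaghan3MonotonePressure B₀ B₀' := le_trans hP1 hPm3
  have hPm5 : Plo ≤ birchMurnaghan3MonotonePressure Bhi B₀' :=
    le_trans hPm4 (birchMurnaghan3MonotonePressure_mono_bulkModulus hB2 hBlt)
  refine ⟨?_, ?_⟩
  · calc birchMurnaghan3RestrictedVolume V₀ Blo blo Phi
        ≤ birchMurnaghan3RestrictedVolume V₀ Blo blo P :=
          birchMurnaghan3RestrictedVolume_antitone_pressure hV₀ hBlo hblt hP0 hP2 hPhi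
      _ ≤ birchMurnaghan3RestrictedVolume V₀ B₀ blo P :=
          birchMurnaghan3RestrictedVolume_mono_bulkModulus hV₀ hBlo hB1 hblt hP0 hPm1
      _ ≤ birchMurnaghan3RestrictedVolume V₀ B₀ B₀' P :=
          birchMurnaghan3RestrictedVolume_mono_Bprime hV₀ hB₀ hb1 hBlt hP0 hPm2
  · calc birchMurnaghan3RestrictedVolume V₀ B₀ B₀' P
        ≤ birchMurnaghan3RestrictedVolume V₀ B₀ B₀' Plo :=
          birchMurnaghan3RestrictedVolume_antitone_pressure hV₀ hB₀ hBlt hPlo hP1 hPm3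
      _ ≤ birchMurnaghan3RestrictedVolume V₀ Bhi B₀' Plo :=
          birchMurnaghan3RestrictedVolume_mono_bulkModulus hV₀ hB₀ hB2 hBlt hPlo hPm4
      _ ≤ birchMurnaghan3RestrictedVolume V₀ Bhi bhi Plo :=
          birchMurnaghan3RestrictedVolume_mono_Bprime hV₀ (lt_of_lt_of_le hB₀ hB2) hb2 hbhi hPlo hPm5

/-! ## Linear-compressibility bounds for the Murnaghan law

For the inverse Murnaghan law `V(P) = V₀ (1 + B₀' P/B₀)^{-1/B₀'}` the logarithmic compression is
`ln(V₀/V(P)) = (1/B₀') ln(1 + B₀' P/B₀)`, and the elementary bounds `1 - 1/y ≤ ln y ≤ y - 1` give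
`P/(B₀ + B₀' P) ≤ ln(V₀/V(P)) ≤ P/B₀` and `1 - V(P)/V₀ ≤ P/B₀`: the LINEAR COMPRESSIBILITY ESTIMATE
`Δ ln V ≈ -κ_V P` (`κ_V = 1/B₀`) never under-states the compression of a solid whose bulk modulus
grows with pressure (`B₀' > 0`), and over-states it by at most the factor `(B₀ + B₀' P)/B₀`.
(This is the inequality behind the «Δ ln V from compressibility alone ≤ κ_V P» screening estimates.)
Elementary consequences of the printed law (no new facts). -/

/-- `V₀ / V(P) = (1 + B₀' P / B₀)^{1/B₀'}` (`V₀ > 0`, positive base).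
[cite: Poirier1991, §4.2 eq. (4.7) (elementary consequence)] -/
theorem div_murnaghanVolume_eq_rpow {V₀ B₀ B₀' P : ℝ} (hV₀ : 0 < V₀) (hy : 0 < 1 + B₀' * P / B₀) :
    V₀ / murnaghanVolume V₀ B₀ B₀' P = (1 + B₀' * P / B₀) ^ (1 / B₀') := by
  unfold murnaghanVolume
  rw [Real.rpow_neg hy.le, ← div_eq_mul_inv, div_div_eq_mul_div, mul_div_cancel_left₀ _ hV₀.ne']

/-- THE LOGARITHMIC COMPRESSION OF THE MURNAGHAN LAW: `ln(V₀/V(P)) = (1/B₀') ln(1 + B₀' P/B₀)`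
(`V₀ > 0`, positive base). [cite: Poirier1991, §4.2 eq. (4.7) (elementary consequence)] -/
theorem log_div_murnaghanVolume {V₀ B₀ B₀' P : ℝ} (hV₀ : 0 < V₀) (hy : 0 < 1 + B₀' * P / B₀) :
    Real.log (V₀ / murnaghanVolume V₀ B₀ B₀' P) = 1 / B₀' * Real.log (1 + B₀' * P / B₀) := by
  rw [div_murnaghanVolume_eq_rpow hV₀ hy, Real.log_rpow hy]

/-- UPPER BOUND — THE LINEAR COMPRESSIBILITY ESTIMATE NEVER UNDER-STATES THE MURNAGHAN COMPRESSION: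
`ln(V₀/V(P)) ≤ P/B₀ = κ_V P` (`V₀ > 0`, `B₀ > 0`, `B₀' > 0`, `P ≥ 0`).
[cite: Poirier1991, §4.2 eq. (4.7) (elementary consequence)] -/
theorem log_div_murnaghanVolume_le {V₀ B₀ B₀' P : ℝ} (hV₀ : 0 < V₀) (hB₀ : 0 < B₀) (hB : 0 < B₀')
    (hP : 0 ≤ P) : Real.log (V₀ / murnaghanVolume V₀ B₀ B₀' P) ≤ P / B₀ := by
  have hy : 0 < 1 + B₀' * P / B₀ := lt_of_lt_of_le one_pos (one_le_murnaghanBase hB₀ hB.le hP)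
  rw [log_div_murnaghanVolume hV₀ hy]
  have hlog : Real.log (1 + B₀' * P / B₀) ≤ B₀' * P / B₀ := by
    have := Real.log_le_sub_one_of_pos hy
    linarith
  calc 1 / B₀' * Real.log (1 + B₀' * P / B₀) ≤ 1 / B₀' * (B₀' * P / B₀) :=
        mul_le_mul_of_nonneg_left hlog (one_div_pos.mpr hB).le
    _ = P / B₀ := by field_simp

/-- LOWER BOUND: `P/(B₀ + B₀' P) ≤ ln(V₀/V(P))` (`V₀ > 0`, `B₀ > 0`, `B₀' > 0`, `P ≥ 0`) — the linear
estimate over-states the compression by at most the factor `(B₀ + B₀' P)/B₀ = K(P)/B₀`.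
[cite: Poirier1991, §4.2 eq. (4.7) (elementary consequence)] -/
theorem le_log_div_murnaghanVolume {V₀ B₀ B₀' P : ℝ} (hV₀ : 0 < V₀) (hB₀ : 0 < B₀) (hB : 0 < B₀')
    (hP : 0 ≤ P) : P / (B₀ + B₀' * P) ≤ Real.log (V₀ / murnaghanVolume V₀ B₀ B₀' P) := by
  have hy : 0 < 1 + B₀' * P / B₀ := lt_of_lt_of_le one_pos (one_le_murnaghanBase hB₀ hB.le hP)
  have hK : 0 < B₀ + B₀' * P := by nlinarith [mul_nonneg hB.le hP]
  rw [log_div_murnaghanVolume hV₀ hy]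
  have hlog : 1 - (1 + B₀' * P / B₀)⁻¹ ≤ Real.log (1 + B₀' * P / B₀) :=
    Real.one_sub_inv_le_log_of_pos hy
  have heq : 1 / B₀' * (1 - (1 + B₀' * P / B₀)⁻¹) = P / (B₀ + B₀' * P) := by
    field_simp
    ring
  calc P / (B₀ + B₀' * P) = 1 / B₀' * (1 - (1 + B₀' * P / B₀)⁻¹) := heq.symm
    _ ≤ 1 / B₀' * Real.log (1 + B₀' * P / B₀) :=
        mul_le_mul_of_nonneg_left hlog (one_div_pos.mpr hB).le

/-- THE RELATIVE VOLUME CHANGE IS BOUNDED BY THE LINEAR ESTIMATE: `1 - V(P)/V₀ ≤ P/B₀ = κ_V P`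
(`V₀ > 0`, `B₀ > 0`, `B₀' > 0`, `P ≥ 0`). [cite: Poirier1991, §4.2 eq. (4.7) (elementary
consequence)] -/
theorem one_sub_murnaghanVolume_div_le {V₀ B₀ B₀' P : ℝ} (hV₀ : 0 < V₀) (hB₀ : 0 < B₀) (hB : 0 < B₀')
    (hP : 0 ≤ P) : 1 - murnaghanVolume V₀ B₀ B₀' P / V₀ ≤ P / B₀ := by
  have hy : 0 < 1 + B₀' * P / B₀ := lt_of_lt_of_le one_pos (one_le_murnaghanBase hB₀ hB.le hP)
  have hVpos : 0 < murnaghanVolume V₀ B₀ B₀' P := murnaghanVolume_pos hV₀ hy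
  -- V/V₀ = exp(-ln(V₀/V)) ≥ 1 - ln(V₀/V) ≥ 1 - P/B₀
  have hratio : murnaghanVolume V₀ B₀ B₀' P / V₀ =
      Real.exp (-Real.log (V₀ / murnaghanVolume V₀ B₀ B₀' P)) := by
    rw [Real.exp_neg, Real.exp_log (div_pos hV₀ hVpos), inv_div]
  have h1 : 1 - Real.log (V₀ / murnaghanVolume V₀ B₀ B₀' P) ≤ murnaghanVolume V₀ B₀ B₀' P / V₀ := by
    rw [hratio]
    have := Real.add_one_le_exp (-Real.log (V₀ / murnaghanVolume V₀ B₀ B₀' P))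
    linarith
  have h2 := log_div_murnaghanVolume_le hV₀ hB₀ hB hP
  linarith

/-- Two-sided form: `V₀ e^{-P/B₀} ≤ V(P) ≤ V₀ e^{-P/(B₀ + B₀' P)}` (`V₀ > 0`, `B₀ > 0`, `B₀' > 0`,
`P ≥ 0`). [cite: Poirier1991, §4.2 eq. (4.7) (elementary consequence)] -/
theorem murnaghanVolume_mem_Icc_exp {V₀ B₀ B₀' P : ℝ} (hV₀ : 0 < V₀) (hB₀ : 0 < B₀) (hB : 0 < B₀')
    (hP : 0 ≤ P) :
    murnaghanVolume V₀ B₀ B₀' P ∈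
      Icc (V₀ * Real.exp (-(P / B₀))) (V₀ * Real.exp (-(P / (B₀ + B₀' * P)))) := by
  have hy : 0 < 1 + B₀' * P / B₀ := lt_of_lt_of_le one_pos (one_le_murnaghanBase hB₀ hB.le hP)
  have hVpos : 0 < murnaghanVolume V₀ B₀ B₀' P := murnaghanVolume_pos hV₀ hy
  set L := Real.log (V₀ / murnaghanVolume V₀ B₀ B₀' P) with hL
  have hV : murnaghanVolume V₀ B₀ B₀' P = V₀ * Real.exp (-L) := by
    rw [hL, Real.exp_neg, Real.exp_log (div_pos hV₀ hVpos), inv_div, mul_div_cancel₀ _ hV₀.ne']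
  rw [hV]
  refine ⟨mul_le_mul_of_nonneg_left (Real.exp_le_exp.mpr ?_) hV₀.le,
    mul_le_mul_of_nonneg_left (Real.exp_le_exp.mpr ?_) hV₀.le⟩
  · have := log_div_murnaghanVolume_le hV₀ hB₀ hB hP
    linarith
  · have := le_log_div_murnaghanVolume hV₀ hB₀ hB hP
    linarith

/-! ## The linear-compressibility estimate bounds the compression of every stiffening solid

If the bulk modulus of a pressure–volume law never falls below its zero-pressure value under
compression, `K(v) = -v P'(v) ≥ B₀` for `v ∈ [V, V₀]`, then integrating `dP = -K d ln v` from
`V₀` down to `V` gives `P(V) ≥ B₀ ln(V₀/V)`, i.e. `ln(V₀/V) ≤ P/B₀ = κ_V P`: the LINEAR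
COMPRESSIBILITY ESTIMATE never under-states the compression, WHATEVER THE EQUATION-OF-STATE FORM.
We prove this comparison principle for an arbitrary differentiable pressure–volume law, and then —
by elementary inequalities on their printed shape functions, without calculus — for the Vinet form
(`B₀' ≥ 1`) and the third-order Birch–Murnaghan form (`B₀' ≥ 4`), with the corollaries
`ln(V₀/V(P)) ≤ P/B₀`, `1 - V(P)/V₀ ≤ P/B₀` and `V(P) ≥ V₀ e^{-P/B₀}` for their inverse laws
(the Murnaghan case is `log_div_murnaghanVolume_le` above).  Elementary consequences of the printed
laws (no new facts). -/

/-- COMPARISON PRINCIPLE (form-independent): if a pressure–volume law `P` vanishes at `V₀` and its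
bulk modulus `K(v) = -v P'(v)` is at least `B₀` at every `v ∈ [V, V₀]` (`V > 0`), then
`B₀ ln(V₀/V) ≤ P(V)` — the function `v ↦ P(v) + B₀ ln v` has derivative `(B₀ - K(v))/v ≤ 0`.
An elementary integration of the definition `K = -V dP/dV` of the isothermal bulk modulus.
[cite: Poirier1991, §4.4 eq. (4.46) (elementary consequence of the definition `K = -V dP/dV`)] -/
theorem mul_log_div_le_of_bulkModulus_ge {P P' : ℝ → ℝ} {V₀ V B₀ : ℝ} (hV : 0 < V) (hVV₀ : V ≤ V₀)
    (hP₀ : P V₀ = 0) (hderiv : ∀ v ∈ Icc V V₀, HasDerivAt P (P' v) v)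
    (hK : ∀ v ∈ Icc V V₀, B₀ ≤ -v * P' v) : B₀ * Real.log (V₀ / V) ≤ P V := by
  have hd : ∀ v ∈ Icc V V₀,
      HasDerivAt (fun w => P w + B₀ * Real.log w) (P' v + B₀ * v⁻¹) v := fun v hv =>
    (hderiv v hv).add ((Real.hasDerivAt_log (lt_of_lt_of_le hV hv.1).ne').const_mul B₀)
  have hφ : AntitoneOn (fun w => P w + B₀ * Real.log w) (Icc V V₀) := by
    refine antitoneOn_of_deriv_nonpos (convex_Icc V V₀) ?_ ?_ ?_
    · exact fun v hv => (hd v hv).continuousAt.continuousWithinAt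
    · exact fun v hv => (hd v (interior_subset hv)).differentiableAt.differentiableWithinAt
    · intro v hv
      have hv' : v ∈ Icc V V₀ := interior_subset hv
      have hv0 : 0 < v := lt_of_lt_of_le hV hv'.1
      rw [(hd v hv').deriv]
      have hKv := hK v hv'
      have heq : P' v + B₀ * v⁻¹ = (v * P' v + B₀) / v := by
        field_simp
      rw [heq]
      exact div_nonpos_iff.mpr (Or.inr ⟨by linarith, hv0.le⟩)
  have h := hφ ⟨le_rfl, hVV₀⟩ ⟨hVV₀, le_rfl⟩ hVV₀
  have hV₀ : 0 < V₀ := lt_of_lt_of_le hV hVV₀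
  simp only [hP₀, zero_add] at h
  rw [Real.log_div hV₀.ne' hV.ne']
  linarith

/-- Corollary in compressibility form: under the same hypotheses and `B₀ > 0`,
`ln(V₀/V) ≤ P(V)/B₀ = κ_V P(V)`.
[cite: Poirier1991, §4.4 eq. (4.46) (elementary consequence of the definition `K = -V dP/dV`)] -/
theorem log_div_le_div_of_bulkModulus_ge {P P' : ℝ → ℝ} {V₀ V B₀ : ℝ} (hV : 0 < V) (hVV₀ : V ≤ V₀)
    (hB₀ : 0 < B₀) (hP₀ : P V₀ = 0) (hderiv : ∀ v ∈ Icc V V₀, HasDerivAt P (P' v) v)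
    (hK : ∀ v ∈ Icc V V₀, B₀ ≤ -v * P' v) : Real.log (V₀ / V) ≤ P V / B₀ := by
  rw [le_div_iff₀ hB₀, mul_comm]
  exact mul_log_div_le_of_bulkModulus_ge hV hVV₀ hP₀ hderiv hK

/-- THE VINET SHAPE DOMINATES THE LOGARITHM: `-ln x ≤ g_η(x)` for `0 < x ≤ 1`, `η ≥ 0`, from the
chain `ln(1/x) ≤ 1/x - 1 ≤ (1 - x)/x² ≤ (1 - x) x⁻² e^{η(1-x)}`.
[cite: CohenGulserenHemley2000, eq. (4) (elementary consequence)] -/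
theorem neg_log_le_vinetShape {η x : ℝ} (hη : 0 ≤ η) (hx0 : 0 < x) (hx1 : x ≤ 1) :
    -Real.log x ≤ vinetShape η x := by
  unfold vinetShape
  have h1 : -Real.log x ≤ (1 - x) / x := by
    have hl := Real.log_le_sub_one_of_pos (one_div_pos.mpr hx0)
    rw [Real.log_div one_ne_zero hx0.ne', Real.log_one] at hl
    have heq : (1 : ℝ) / x - 1 = (1 - x) / x := by
      field_simp
    linarith
  have h2 : (1 - x) / x ≤ (1 - x) / x ^ 2 := by
    rw [div_le_div_iff₀ hx0 (by positivity)]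
    nlinarith [mul_nonneg hx0.le (sq_nonneg (1 - x))]
  have h3 : (1 - x) / x ^ 2 ≤ (1 - x) / x ^ 2 * Real.exp (η * (1 - x)) := by
    have hA : 0 ≤ (1 - x) / x ^ 2 := div_nonneg (sub_nonneg.mpr hx1) (sq_nonneg x)
    have hE : 1 ≤ Real.exp (η * (1 - x)) := by
      have := Real.add_one_le_exp (η * (1 - x))
      nlinarith [mul_nonneg hη (sub_nonneg.mpr hx1)]
    nlinarith
  linarith

/-- VINET: `B₀ ln(V₀/V) ≤ P(V)` on the compression branch `0 < V ≤ V₀` (`B₀ ≥ 0`, `B₀' ≥ 1`) —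
the Vinet bulk modulus only stiffens under compression, so the linear compressibility estimate
bounds the Vinet compression. [cite: CohenGulserenHemley2000, eq. (4) (elementary consequence)] -/
theorem mul_log_div_le_vinetPressure {V₀ B₀ B₀' V : ℝ} (hV₀ : 0 < V₀) (hB₀ : 0 ≤ B₀) (hB : 1 ≤ B₀')
    (hV : 0 < V) (hVV₀ : V ≤ V₀) :
    B₀ * Real.log (V₀ / V) ≤ vinetPressure V₀ B₀ B₀' V := by
  rw [vinetPressure_eq_shape]
  have hlog : Real.log (V₀ / V) = -3 * Real.log (vinetX V₀ V) := by
    unfold vinetX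
    rw [Real.log_rpow (div_pos hV hV₀), Real.log_div hV.ne' hV₀.ne',
      Real.log_div hV₀.ne' hV.ne']
    ring
  rw [hlog]
  have h := neg_log_le_vinetShape (vinetEta_nonneg hB) (vinetX_pos hV₀ hV)
    (vinetX_le_one hV₀ hV hVV₀)
  nlinarith

/-- VINET INVERSE LAW — THE LINEAR COMPRESSIBILITY ESTIMATE NEVER UNDER-STATES THE COMPRESSION:
`ln(V₀/V(P)) ≤ P/B₀ = κ_V P` for `P ≥ 0` (`V₀ > 0`, `B₀ > 0`, `B₀' ≥ 1`).
[cite: CohenGulserenHemley2000, eq. (4) (elementary consequence)] -/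
theorem log_div_vinetVolume_le {V₀ B₀ B₀' P : ℝ} (hV₀ : 0 < V₀) (hB₀ : 0 < B₀) (hB : 1 ≤ B₀')
    (hP : 0 ≤ P) : Real.log (V₀ / vinetVolume V₀ B₀ B₀' P) ≤ P / B₀ := by
  have hVP : 0 < vinetVolume V₀ B₀ B₀' P := vinetVolume_pos hV₀ hB₀ hB hP
  have hle : vinetVolume V₀ B₀ B₀' P ≤ V₀ := vinetVolume_le_self hV₀.le hB₀ hB hP
  have h := mul_log_div_le_vinetPressure hV₀ hB₀.le hB hVP hle
  rw [vinetPressure_vinetVolume hV₀ hB₀ hB hP] at h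
  rw [le_div_iff₀ hB₀, mul_comm]
  exact h

/-- VINET INVERSE LAW: the relative volume change is bounded by the linear estimate,
`1 - V(P)/V₀ ≤ P/B₀` (`P ≥ 0`, `V₀ > 0`, `B₀ > 0`, `B₀' ≥ 1`).
[cite: CohenGulserenHemley2000, eq. (4) (elementary consequence)] -/
theorem one_sub_vinetVolume_div_le {V₀ B₀ B₀' P : ℝ} (hV₀ : 0 < V₀) (hB₀ : 0 < B₀) (hB : 1 ≤ B₀')
    (hP : 0 ≤ P) : 1 - vinetVolume V₀ B₀ B₀' P / V₀ ≤ P / B₀ := by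
  have hVP : 0 < vinetVolume V₀ B₀ B₀' P := vinetVolume_pos hV₀ hB₀ hB hP
  have hratio : vinetVolume V₀ B₀ B₀' P / V₀ =
      Real.exp (-Real.log (V₀ / vinetVolume V₀ B₀ B₀' P)) := by
    rw [Real.exp_neg, Real.exp_log (div_pos hV₀ hVP), inv_div]
  have h1 : 1 - Real.log (V₀ / vinetVolume V₀ B₀ B₀' P) ≤ vinetVolume V₀ B₀ B₀' P / V₀ := by
    rw [hratio]
    have := Real.add_one_le_exp (-Real.log (V₀ / vinetVolume V₀ B₀ B₀' P))
    linarith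
  have h2 := log_div_vinetVolume_le hV₀ hB₀ hB hP
  linarith

/-- VINET INVERSE LAW, exponential form: `V₀ e^{-P/B₀} ≤ V(P)` (`P ≥ 0`, `V₀ > 0`, `B₀ > 0`,
`B₀' ≥ 1`). [cite: CohenGulserenHemley2000, eq. (4) (elementary consequence)] -/
theorem mul_exp_le_vinetVolume {V₀ B₀ B₀' P : ℝ} (hV₀ : 0 < V₀) (hB₀ : 0 < B₀) (hB : 1 ≤ B₀')
    (hP : 0 ≤ P) : V₀ * Real.exp (-(P / B₀)) ≤ vinetVolume V₀ B₀ B₀' P := by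
  have hVP : 0 < vinetVolume V₀ B₀ B₀' P := vinetVolume_pos hV₀ hB₀ hB hP
  set L := Real.log (V₀ / vinetVolume V₀ B₀ B₀' P) with hL
  have hV : vinetVolume V₀ B₀ B₀' P = V₀ * Real.exp (-L) := by
    rw [hL, Real.exp_neg, Real.exp_log (div_pos hV₀ hVP), inv_div, mul_div_cancel₀ _ hV₀.ne']
  rw [hV]
  refine mul_le_mul_of_nonneg_left (Real.exp_le_exp.mpr ?_) hV₀.le
  have := log_div_vinetVolume_le hV₀ hB₀ hB hP
  linarith

/-- THE BIRCH–MURNAGHAN SHAPE DOMINATES THE LOGARITHM: `3 ln q ≤ h(q)` for `q ≥ 1`, `B₀' ≥ 4`, from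
`ln q ≤ q - 1 ≤ (q² - 1)/2 ≤ q⁵ (q² - 1)/2 ≤ h(q)/3`.
[cite: Poirier1991, §4.3.3 eq. (4.42) (elementary consequence)] -/
theorem three_mul_log_le_birchMurnaghan3Shape {B₀' q : ℝ} (hB : 4 ≤ B₀') (hq : 1 ≤ q) :
    3 * Real.log q ≤ birchMurnaghan3Shape B₀' q := by
  unfold birchMurnaghan3Shape
  have hq0 : 0 < q := lt_of_lt_of_le one_pos hq
  have h1 : Real.log q ≤ q - 1 := Real.log_le_sub_one_of_pos hq0
  have h2 : q - 1 ≤ (q ^ 2 - 1) / 2 := by nlinarith [sq_nonneg (q - 1)]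
  have hq2 : 0 ≤ q ^ 2 - 1 := by nlinarith
  have hq5 : 1 ≤ q ^ 5 := one_le_pow₀ hq
  have h3 : (q ^ 2 - 1) / 2 ≤ (q ^ 7 - q ^ 5) / 2 := by
    have : q ^ 7 - q ^ 5 = q ^ 5 * (q ^ 2 - 1) := by ring
    rw [this]
    nlinarith
  have h4 : 0 ≤ 3 / 4 * (B₀' - 4) * (q ^ 2 - 1) :=
    mul_nonneg (mul_nonneg (by norm_num) (sub_nonneg.mpr hB)) hq2
  have h75 : 0 ≤ q ^ 7 - q ^ 5 := by
    have : q ^ 7 - q ^ 5 = q ^ 5 * (q ^ 2 - 1) := by ring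
    rw [this]
    exact mul_nonneg (by positivity) hq2
  nlinarith

/-- THIRD-ORDER BIRCH–MURNAGHAN (`B₀' ≥ 4`): `B₀ ln(V₀/V) ≤ P(V)` on the compression branch
`0 < V ≤ V₀` (`B₀ ≥ 0`) — the linear compressibility estimate bounds the Birch–Murnaghan
compression. [cite: Poirier1991, §4.3.3 eq. (4.42) (elementary consequence)] -/
theorem mul_log_div_le_birchMurnaghan3Pressure {V₀ B₀ B₀' V : ℝ} (hV₀ : 0 < V₀) (hB₀ : 0 ≤ B₀)
    (hB : 4 ≤ B₀') (hV : 0 < V) (hVV₀ : V ≤ V₀) :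
    B₀ * Real.log (V₀ / V) ≤ birchMurnaghan3Pressure V₀ B₀ B₀' V := by
  rw [birchMurnaghan3Pressure_eq_shape hV₀ hV]
  have hlog : Real.log (V₀ / V) = 3 * Real.log (cubeRootRatio V₀ V) := by
    unfold cubeRootRatio
    rw [Real.log_rpow (div_pos hV₀ hV)]
    ring
  rw [hlog]
  have h := three_mul_log_le_birchMurnaghan3Shape hB (one_le_cubeRootRatio hV hVV₀)
  nlinarith

/-- BIRCH–MURNAGHAN INVERSE LAW (`B₀' ≥ 4`) — THE LINEAR COMPRESSIBILITY ESTIMATE NEVER UNDER-STATES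
THE COMPRESSION: `ln(V₀/V(P)) ≤ P/B₀ = κ_V P` for `P ≥ 0` (`V₀ > 0`, `B₀ > 0`).
[cite: Poirier1991, §4.3.3 eq. (4.42) (elementary consequence)] -/
theorem log_div_birchMurnaghan3Volume_le {V₀ B₀ B₀' P : ℝ} (hV₀ : 0 < V₀) (hB₀ : 0 < B₀)
    (hB : 4 ≤ B₀') (hP : 0 ≤ P) :
    Real.log (V₀ / birchMurnaghan3Volume V₀ B₀ B₀' P) ≤ P / B₀ := by
  have hVP : 0 < birchMurnaghan3Volume V₀ B₀ B₀' P := birchMurnaghan3Volume_pos hV₀ hB₀ hB hP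
  have hle : birchMurnaghan3Volume V₀ B₀ B₀' P ≤ V₀ :=
    birchMurnaghan3Volume_le_self hV₀.le hB₀ hB hP
  have h := mul_log_div_le_birchMurnaghan3Pressure hV₀ hB₀.le hB hVP hle
  rw [birchMurnaghan3Pressure_birchMurnaghan3Volume hV₀ hB₀ hB hP] at h
  rw [le_div_iff₀ hB₀, mul_comm]
  exact h

/-- BIRCH–MURNAGHAN INVERSE LAW (`B₀' ≥ 4`): `1 - V(P)/V₀ ≤ P/B₀` (`P ≥ 0`, `V₀ > 0`, `B₀ > 0`).
[cite: Poirier1991, §4.3.3 eq. (4.42) (elementary consequence)] -/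
theorem one_sub_birchMurnaghan3Volume_div_le {V₀ B₀ B₀' P : ℝ} (hV₀ : 0 < V₀) (hB₀ : 0 < B₀)
    (hB : 4 ≤ B₀') (hP : 0 ≤ P) : 1 - birchMurnaghan3Volume V₀ B₀ B₀' P / V₀ ≤ P / B₀ := by
  have hVP : 0 < birchMurnaghan3Volume V₀ B₀ B₀' P := birchMurnaghan3Volume_pos hV₀ hB₀ hB hP
  have hratio : birchMurnaghan3Volume V₀ B₀ B₀' P / V₀ =
      Real.exp (-Real.log (V₀ / birchMurnaghan3Volume V₀ B₀ B₀' P)) := by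
    rw [Real.exp_neg, Real.exp_log (div_pos hV₀ hVP), inv_div]
  have h1 : 1 - Real.log (V₀ / birchMurnaghan3Volume V₀ B₀ B₀' P) ≤
      birchMurnaghan3Volume V₀ B₀ B₀' P / V₀ := by
    rw [hratio]
    have := Real.add_one_le_exp (-Real.log (V₀ / birchMurnaghan3Volume V₀ B₀ B₀' P))
    linarith
  have h2 := log_div_birchMurnaghan3Volume_le hV₀ hB₀ hB hP
  linarith

/-- BIRCH–MURNAGHAN INVERSE LAW (`B₀' ≥ 4`), exponential form: `V₀ e^{-P/B₀} ≤ V(P)` (`P ≥ 0`,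
`V₀ > 0`, `B₀ > 0`). [cite: Poirier1991, §4.3.3 eq. (4.42) (elementary consequence)] -/
theorem mul_exp_le_birchMurnaghan3Volume {V₀ B₀ B₀' P : ℝ} (hV₀ : 0 < V₀) (hB₀ : 0 < B₀)
    (hB : 4 ≤ B₀') (hP : 0 ≤ P) :
    V₀ * Real.exp (-(P / B₀)) ≤ birchMurnaghan3Volume V₀ B₀ B₀' P := by
  have hVP : 0 < birchMurnaghan3Volume V₀ B₀ B₀' P := birchMurnaghan3Volume_pos hV₀ hB₀ hB hP
  set L := Real.log (V₀ / birchMurnaghan3Volume V₀ B₀ B₀' P) with hL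
  have hV : birchMurnaghan3Volume V₀ B₀ B₀' P = V₀ * Real.exp (-L) := by
    rw [hL, Real.exp_neg, Real.exp_log (div_pos hV₀ hVP), inv_div, mul_div_cancel₀ _ hV₀.ne']
  rw [hV]
  refine mul_le_mul_of_nonneg_left (Real.exp_le_exp.mpr ?_) hV₀.le
  have := log_div_birchMurnaghan3Volume_le hV₀ hB₀ hB hP
  linarith

/-- MURNAGHAN, pressure side: `B₀ ln(V₀/V) ≤ P(V)` for every `V > 0` (`B₀ ≥ 0`, `B₀' > 0`;
in expansion both sides are negative), from `ln y ≤ (y^{B₀'} - 1)/B₀'` at `y = V₀/V` — the same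
statement as `log_div_murnaghanVolume_le` read on the direct law.
[cite: Poirier1991, §4.2 eq. (4.6) (elementary consequence)] -/
theorem mul_log_div_le_murnaghanPressure {V₀ B₀ B₀' V : ℝ} (hV₀ : 0 < V₀) (hB₀ : 0 ≤ B₀)
    (hB : 0 < B₀') (hV : 0 < V) :
    B₀ * Real.log (V₀ / V) ≤ murnaghanPressure V₀ B₀ B₀' V := by
  unfold murnaghanPressure
  have hy : 0 < V₀ / V := div_pos hV₀ hV
  have hyB : 0 < (V₀ / V) ^ B₀' := Real.rpow_pos_of_pos hy _
  -- ln(y^{B₀'}) ≤ y^{B₀'} - 1, and ln(y^{B₀'}) = B₀' ln y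
  have h1 : B₀' * Real.log (V₀ / V) ≤ (V₀ / V) ^ B₀' - 1 := by
    have := Real.log_le_sub_one_of_pos hyB
    rwa [Real.log_rpow hy] at this
  have h2 : Real.log (V₀ / V) ≤ ((V₀ / V) ^ B₀' - 1) / B₀' := by
    rw [le_div_iff₀ hB]
    linarith
  calc B₀ * Real.log (V₀ / V) ≤ B₀ * (((V₀ / V) ^ B₀' - 1) / B₀') :=
        mul_le_mul_of_nonneg_left h2 hB₀
    _ = B₀ / B₀' * ((V₀ / V) ^ B₀' - 1) := by ring

/-! ## Murnaghan's law as a one-sided comparator: `K ≤ B₀ + B₀' P` under compression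

Murnaghan's law IS the statement `K = B₀ + B₀' P` (`murnaghan_bulkModulus_linear`).  If instead
the bulk modulus of a pressure–volume law grows no faster than linearly in its own pressure along
the compression path, `K(v) = -v P'(v) ≤ B₀ + B₀' P(v)` for `v ∈ [V, V₀]`, then the function
`v ↦ ln v + (1/B₀') ln(B₀ + B₀' P(v))` is monotone, whence
`(1/B₀') ln(1 + B₀' P(V)/B₀) ≤ ln(V₀/V)`, i.e. `V ≤ V₀ (1 + B₀' P(V)/B₀)^{-1/B₀'}`: the solid is AT
LEAST AS COMPRESSED as the Murnaghan law with the same `(V₀, B₀, B₀')` predicts.  Both closed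
forms used for fits satisfy the hypothesis on the whole compression branch — the Vinet form for
`B₀' ≥ 1` and the third-order Birch–Murnaghan form for `B₀' ≥ 4`, by elementary inequalities on
their printed bulk moduli — so, for equal parameters and every `P ≥ 0`,
`V₀ e^{-P/B₀} ≤ V_Vinet(P), V_BM3(P) ≤ V_Murnaghan(P) ≤ V₀ e^{-P/(B₀ + B₀' P)}`:
replacing a printed Vinet / Birch–Murnaghan fit by the invertible Murnaghan law with the same
`(B₀, B₀')` can only OVER-state the volume (under-state the compression), and the two-sided
Murnaghan bounds `P/(B₀ + B₀' P) ≤ ln(V₀/V(P)) ≤ P/B₀` hold for all three laws.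
Elementary consequences of the printed laws (no new facts). -/

/-- MURNAGHAN COMPARISON PRINCIPLE (form-independent): if `P(V₀) = 0`, `P ≥ 0` on `[V, V₀]`
(`V > 0`) and the bulk modulus obeys `-v P'(v) ≤ B₀ + B₀' P(v)` there (`B₀ > 0`, `B₀' > 0`), then
`(1/B₀') ln(1 + B₀' P(V)/B₀) ≤ ln(V₀/V)`.  An elementary integration of the definition
`K = -V dP/dV` against Murnaghan's linear law `K = B₀ + B₀' P`.
[cite: Poirier1991, §4.2 eqs. (4.4)–(4.7) (elementary consequence)] -/
theorem log_murnaghan_le_log_div_of_bulkModulus_le {P P' : ℝ → ℝ} {V₀ V B₀ B₀' : ℝ} (hV : 0 < V)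
    (hVV₀ : V ≤ V₀) (hB₀ : 0 < B₀) (hB : 0 < B₀') (hP₀ : P V₀ = 0)
    (hderiv : ∀ v ∈ Icc V V₀, HasDerivAt P (P' v) v) (hPnn : ∀ v ∈ Icc V V₀, 0 ≤ P v)
    (hK : ∀ v ∈ Icc V V₀, -v * P' v ≤ B₀ + B₀' * P v) :
    1 / B₀' * Real.log (1 + B₀' * P V / B₀) ≤ Real.log (V₀ / V) := by
  have hMpos : ∀ v ∈ Icc V V₀, 0 < B₀ + B₀' * P v := fun v hv => by
    have := mul_nonneg hB.le (hPnn v hv)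
    linarith
  have hd : ∀ v ∈ Icc V V₀,
      HasDerivAt (fun w => Real.log w + 1 / B₀' * Real.log (B₀ + B₀' * P w))
        (v⁻¹ + 1 / B₀' * (B₀' * P' v / (B₀ + B₀' * P v))) v := fun v hv =>
    (Real.hasDerivAt_log (lt_of_lt_of_le hV hv.1).ne').add
      ((((hderiv v hv).const_mul B₀').const_add B₀).log (hMpos v hv).ne' |>.const_mul (1 / B₀'))
  have hψ : MonotoneOn (fun w => Real.log w + 1 / B₀' * Real.log (B₀ + B₀' * P w)) (Icc V V₀) := by
    refine monotoneOn_of_deriv_nonneg (convex_Icc V V₀) ?_ ?_ ?_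
    · exact fun v hv => (hd v hv).continuousAt.continuousWithinAt
    · exact fun v hv => (hd v (interior_subset hv)).differentiableAt.differentiableWithinAt
    · intro v hv
      have hv' : v ∈ Icc V V₀ := interior_subset hv
      have hv0 : 0 < v := lt_of_lt_of_le hV hv'.1
      have hM := hMpos v hv'
      rw [(hd v hv').deriv]
      have heq : v⁻¹ + 1 / B₀' * (B₀' * P' v / (B₀ + B₀' * P v)) =
          (B₀ + B₀' * P v + v * P' v) / (v * (B₀ + B₀' * P v)) := by
        field_simp
      rw [heq]
      exact div_nonneg (by linarith [hK v hv']) (mul_pos hv0 hM).le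
  have h := hψ ⟨le_rfl, hVV₀⟩ ⟨hVV₀, le_rfl⟩ hVV₀
  have hV₀ : 0 < V₀ := lt_of_lt_of_le hV hVV₀
  simp only [hP₀, mul_zero, add_zero] at h
  have hlog : Real.log (1 + B₀' * P V / B₀) =
      Real.log (B₀ + B₀' * P V) - Real.log B₀ := by
    rw [← Real.log_div (hMpos V ⟨le_rfl, hVV₀⟩).ne' hB₀.ne']
    congr 1
    field_simp
  rw [hlog, Real.log_div hV₀.ne' hV.ne']
  nlinarith [h, one_div_pos.mpr hB]

/-- Under the hypotheses of the comparison principle the volume is bounded by the MURNAGHAN VOLUME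
at the same pressure: `V ≤ V₀ (1 + B₀' P(V)/B₀)^{-1/B₀'}`.
[cite: Poirier1991, §4.2 eq. (4.7) (elementary consequence)] -/
theorem le_murnaghanVolume_of_bulkModulus_le {P P' : ℝ → ℝ} {V₀ V B₀ B₀' : ℝ} (hV : 0 < V)
    (hVV₀ : V ≤ V₀) (hB₀ : 0 < B₀) (hB : 0 < B₀') (hP₀ : P V₀ = 0)
    (hderiv : ∀ v ∈ Icc V V₀, HasDerivAt P (P' v) v) (hPnn : ∀ v ∈ Icc V V₀, 0 ≤ P v)
    (hK : ∀ v ∈ Icc V V₀, -v * P' v ≤ B₀ + B₀' * P v) :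
    V ≤ murnaghanVolume V₀ B₀ B₀' (P V) := by
  have hV₀ : 0 < V₀ := lt_of_lt_of_le hV hVV₀
  have hy : 0 < 1 + B₀' * P V / B₀ :=
    lt_of_lt_of_le one_pos (one_le_murnaghanBase hB₀ hB.le (hPnn V ⟨le_rfl, hVV₀⟩))
  have hVM : 0 < murnaghanVolume V₀ B₀ B₀' (P V) := murnaghanVolume_pos hV₀ hy
  have h := log_murnaghan_le_log_div_of_bulkModulus_le hV hVV₀ hB₀ hB hP₀ hderiv hPnn hK
  rw [← log_div_murnaghanVolume hV₀ hy,
    Real.log_le_log_iff (div_pos hV₀ hVM) (div_pos hV₀ hV)] at h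
  exact (div_le_div_iff_of_pos_left hV₀ hVM hV).mp h

/-- THE BIRCH–MURNAGHAN BULK MODULUS GROWS NO FASTER THAN MURNAGHAN'S: in the compression variable
`q ≥ 1` with `f = (q² - 1)/2` and `B₀' ≥ 4`,
`q⁵ [1 + 7f + (3/2)(B₀'-4) f (2 + 9f)] ≤ 1 + B₀' h(q)`, i.e. `K(V) ≤ B₀ + B₀' P(V)` for the
third-order Birch–Murnaghan pair (the difference is
`½ (q-1)² (5q⁵ + 10q⁴ + 8q³ + 6q² + 4q + 2) + (9/8)(B₀'-4)(1 + (B₀'-4)) (q²-1)² q⁵ ≥ 0`).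
[cite: Poirier1991, §4.3.2 eqs. (4.35)–(4.37) (elementary consequence)] -/
theorem birchMurnaghan3_bulkModulusShape_le {B₀' q : ℝ} (hB : 4 ≤ B₀') (hq : 1 ≤ q) :
    q ^ 5 * (1 + 7 * ((q ^ 2 - 1) / 2) +
        3 / 2 * (B₀' - 4) * ((q ^ 2 - 1) / 2) * (2 + 9 * ((q ^ 2 - 1) / 2))) ≤
      1 + B₀' * birchMurnaghan3Shape B₀' q := by
  unfold birchMurnaghan3Shape
  have hq0 : 0 ≤ q := le_trans zero_le_one hq
  have hq5 : 0 ≤ q ^ 5 := pow_nonneg hq0 5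
  have hψ : 0 ≤ (q - 1) ^ 2 * (5 * q ^ 5 + 10 * q ^ 4 + 8 * q ^ 3 + 6 * q ^ 2 + 4 * q + 2) :=
    mul_nonneg (sq_nonneg _) (by positivity)
  have h2 : 0 ≤ (B₀' - 4) * (q ^ 2 - 1) ^ 2 * q ^ 5 :=
    mul_nonneg (mul_nonneg (sub_nonneg.mpr hB) (sq_nonneg _)) hq5
  have h3 : 0 ≤ (B₀' - 4) ^ 2 * (q ^ 2 - 1) ^ 2 * q ^ 5 :=
    mul_nonneg (mul_nonneg (sq_nonneg _) (sq_nonneg _)) hq5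
  nlinarith [hψ, h2, h3]

/-- THIRD-ORDER BIRCH–MURNAGHAN (`B₀' ≥ 4`, `B₀ ≥ 0`): on the compression branch `0 < V ≤ V₀` the
pressure is differentiable with `K(V) = -V P'(V) ≤ B₀ + B₀' P(V)`.
[cite: Poirier1991, §4.3.2 eqs. (4.35)–(4.37) (elementary consequence)] -/
theorem birchMurnaghan3_bulkModulus_le {V₀ B₀ B₀' V : ℝ} (hV₀ : 0 < V₀) (hB₀ : 0 ≤ B₀)
    (hB : 4 ≤ B₀') (hV : 0 < V) (hVV₀ : V ≤ V₀) :
    ∃ P' : ℝ, HasDerivAt (birchMurnaghan3Pressure V₀ B₀ B₀') P' V ∧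
      -V * P' ≤ B₀ + B₀' * birchMurnaghan3Pressure V₀ B₀ B₀' V := by
  obtain ⟨P', hP', hK⟩ := birchMurnaghan3_bulkModulus hV₀ hV B₀ B₀'
  refine ⟨P', hP', ?_⟩
  rw [hK, eulerianStrain_eq_cubeRootRatio hV₀ hV, birchMurnaghan3Pressure_eq_shape hV₀ hV]
  have h := mul_le_mul_of_nonneg_left
    (birchMurnaghan3_bulkModulusShape_le hB (one_le_cubeRootRatio hV hVV₀)) hB₀
  have heq : B₀ * (1 + B₀' * birchMurnaghan3Shape B₀' (cubeRootRatio V₀ V)) =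
      B₀ + B₀' * (B₀ * birchMurnaghan3Shape B₀' (cubeRootRatio V₀ V)) := by ring
  rw [← heq]
  simpa [mul_assoc] using h

/-- `P(V) ≥ 0` on the compression branch `0 < V ≤ V₀` for the third-order Birch–Murnaghan form
(`B₀ ≥ 0`, `B₀' ≥ 4`). [cite: Poirier1991, §4.3.3 eq. (4.42) (elementary consequence)] -/
theorem birchMurnaghan3Pressure_nonneg {V₀ B₀ B₀' V : ℝ} (hV₀ : 0 < V₀) (hB₀ : 0 ≤ B₀)
    (hB : 4 ≤ B₀') (hV : 0 < V) (hVV₀ : V ≤ V₀) : 0 ≤ birchMurnaghan3Pressure V₀ B₀ B₀' V := by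
  rw [birchMurnaghan3Pressure_eq_shape hV₀ hV]
  exact mul_nonneg hB₀ (birchMurnaghan3Shape_nonneg hB (one_le_cubeRootRatio hV hVV₀))

/-- THE BIRCH–MURNAGHAN VOLUME IS BOUNDED BY THE MURNAGHAN VOLUME with the same `(V₀, B₀, B₀')`:
`V_BM3(P) ≤ V₀ (1 + B₀' P/B₀)^{-1/B₀'}` for `P ≥ 0` (`V₀ > 0`, `B₀ > 0`, `B₀' ≥ 4`).
[cite: Poirier1991, §4.2 eq. (4.7), §4.3.3 eq. (4.42) (elementary consequence)] -/
theorem birchMurnaghan3Volume_le_murnaghanVolume {V₀ B₀ B₀' P : ℝ} (hV₀ : 0 < V₀) (hB₀ : 0 < B₀)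
    (hB : 4 ≤ B₀') (hP : 0 ≤ P) :
    birchMurnaghan3Volume V₀ B₀ B₀' P ≤ murnaghanVolume V₀ B₀ B₀' P := by
  have hB' : 0 < B₀' := by linarith
  set W := birchMurnaghan3Volume V₀ B₀ B₀' P with hW
  have hWpos : 0 < W := birchMurnaghan3Volume_pos hV₀ hB₀ hB hP
  have hWle : W ≤ V₀ := birchMurnaghan3Volume_le_self hV₀.le hB₀ hB hP
  have hPW : birchMurnaghan3Pressure V₀ B₀ B₀' W = P :=
    birchMurnaghan3Pressure_birchMurnaghan3Volume hV₀ hB₀ hB hP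
  -- derivative function from the closed-form bulk modulus
  have hex : ∀ v ∈ Icc W V₀, ∃ P' : ℝ, HasDerivAt (birchMurnaghan3Pressure V₀ B₀ B₀') P' v ∧
      -v * P' ≤ B₀ + B₀' * birchMurnaghan3Pressure V₀ B₀ B₀' v := fun v hv =>
    birchMurnaghan3_bulkModulus_le hV₀ hB₀.le hB (lt_of_lt_of_le hWpos hv.1) hv.2
  choose! D hD using hex
  have h := le_murnaghanVolume_of_bulkModulus_le (P := birchMurnaghan3Pressure V₀ B₀ B₀')
    (P' := D) hWpos hWle hB₀ hB' (birchMurnaghan3Pressure_self hV₀ B₀ B₀')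
    (fun v hv => (hD v hv).1)
    (fun v hv => birchMurnaghan3Pressure_nonneg hV₀ hB₀.le hB (lt_of_lt_of_le hWpos hv.1) hv.2)
    (fun v hv => (hD v hv).2)
  rwa [hPW] at h


/-- MURNAGHAN-TYPE LOWER BOUND FOR THE BIRCH–MURNAGHAN COMPRESSION (`B₀' ≥ 4`):
`(1/B₀') ln(1 + B₀' P/B₀) ≤ ln(V₀/V_BM3(P))`, hence `P/(B₀ + B₀' P) ≤ ln(V₀/V_BM3(P)) ≤ P/B₀`
(`P ≥ 0`, `V₀ > 0`, `B₀ > 0`). [cite: Poirier1991, §4.2 eq. (4.7), §4.3.3 eq. (4.42) (elementary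
consequence)] -/
theorem le_log_div_birchMurnaghan3Volume {V₀ B₀ B₀' P : ℝ} (hV₀ : 0 < V₀) (hB₀ : 0 < B₀)
    (hB : 4 ≤ B₀') (hP : 0 ≤ P) :
    P / (B₀ + B₀' * P) ≤ Real.log (V₀ / birchMurnaghan3Volume V₀ B₀ B₀' P) := by
  have hB' : 0 < B₀' := by linarith
  have hWpos : 0 < birchMurnaghan3Volume V₀ B₀ B₀' P := birchMurnaghan3Volume_pos hV₀ hB₀ hB hP
  have hy : 0 < 1 + B₀' * P / B₀ := lt_of_lt_of_le one_pos (one_le_murnaghanBase hB₀ hB'.le hP)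
  have hM : 0 < murnaghanVolume V₀ B₀ B₀' P := murnaghanVolume_pos hV₀ hy
  have h1 := le_log_div_murnaghanVolume hV₀ hB₀ hB' hP
  have h2 : Real.log (V₀ / murnaghanVolume V₀ B₀ B₀' P) ≤
      Real.log (V₀ / birchMurnaghan3Volume V₀ B₀ B₀' P) :=
    Real.log_le_log (div_pos hV₀ hM) (div_le_div_of_nonneg_left hV₀.le hWpos
      (birchMurnaghan3Volume_le_murnaghanVolume hV₀ hB₀ hB hP))
  exact h1.trans h2

/-- TWO-SIDED EXPONENTIAL BRACKET FOR THE BIRCH–MURNAGHAN VOLUME (`B₀' ≥ 4`):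
`V₀ e^{-P/B₀} ≤ V_BM3(P) ≤ V_Murnaghan(P) ≤ V₀ e^{-P/(B₀ + B₀' P)}` (`P ≥ 0`, `V₀ > 0`, `B₀ > 0`).
[cite: Poirier1991, §4.2 eq. (4.7), §4.3.3 eq. (4.42) (elementary consequence)] -/
theorem birchMurnaghan3Volume_mem_Icc_exp {V₀ B₀ B₀' P : ℝ} (hV₀ : 0 < V₀) (hB₀ : 0 < B₀)
    (hB : 4 ≤ B₀') (hP : 0 ≤ P) :
    birchMurnaghan3Volume V₀ B₀ B₀' P ∈
      Icc (V₀ * Real.exp (-(P / B₀))) (V₀ * Real.exp (-(P / (B₀ + B₀' * P)))) := by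
  have hB' : 0 < B₀' := by linarith
  refine ⟨mul_exp_le_birchMurnaghan3Volume hV₀ hB₀ hB hP, ?_⟩
  exact (birchMurnaghan3Volume_le_murnaghanVolume hV₀ hB₀ hB hP).trans
    (murnaghanVolume_mem_Icc_exp hV₀ hB₀ hB' hP).2

/-- THE VINET BULK MODULUS GROWS NO FASTER THAN MURNAGHAN'S: for `0 < x ≤ 1`, `η ≥ 0`, with
`u = 1 - x` and `E = e^{η u}`, `E [1 + (η x + 1) u] ≤ x² + (3 + 2η) u E`, i.e. `K(V) ≤ B₀ + B₀' P(V)`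
for the Vinet pair (`3 + 2η = 3B₀'`).  Proof: the claim is `E·A ≤ x²` with
`A = (2x - 1) - η u (2 - x)`; if `A ≤ 0` it is trivial, otherwise `η u < 1`, `E ≤ 1/(1 - η u)` and
`A ≤ x² (1 - η u)` since `x²(1 - η u) - A = u² (1 + η (2 + x)) ≥ 0`.
[cite: CohenGulserenHemley2000, eq. (4) (elementary consequence of its `K = -V dP/dV`)] -/
theorem vinet_bulkModulusShape_le {η x : ℝ} (hη : 0 ≤ η) (hx0 : 0 < x) (hx1 : x ≤ 1) :
    Real.exp (η * (1 - x)) * (1 + (η * x + 1) * (1 - x)) ≤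
      x ^ 2 + (3 + 2 * η) * (1 - x) * Real.exp (η * (1 - x)) := by
  set u := 1 - x with hu
  set E := Real.exp (η * u) with hE
  have hEpos : 0 < E := Real.exp_pos _
  have hu0 : 0 ≤ u := by rw [hu]; linarith
  -- reduce to E * A ≤ x²
  suffices h : E * ((2 * x - 1) - η * u * (2 - x)) ≤ x ^ 2 by
    have hx : x = 1 - u := by rw [hu]; ring
    nlinarith [h]
  by_cases hA : (2 * x - 1) - η * u * (2 - x) ≤ 0
  · have : E * ((2 * x - 1) - η * u * (2 - x)) ≤ 0 := mul_nonpos_of_nonneg_of_nonpos hEpos.le hA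
    nlinarith [sq_nonneg x]
  · have hA' : 0 < (2 * x - 1) - η * u * (2 - x) := lt_of_not_ge hA
    -- η u < 1, else A ≤ 3(x - 1) ≤ 0
    have ht : η * u < 1 := by
      by_contra hge
      have hge' : 1 ≤ η * u := le_of_not_gt hge
      have h2x : 0 < 2 - x := by linarith
      have : (2 - x) ≤ η * u * (2 - x) := by nlinarith
      linarith
    have hEt : E * (1 - η * u) ≤ 1 := by
      have h := Real.add_one_le_exp (-(η * u))
      rw [Real.exp_neg] at h
      have hE' : E⁻¹ = (Real.exp (η * u))⁻¹ := by rw [hE]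
      have : 1 - η * u ≤ E⁻¹ := by rw [hE']; linarith
      calc E * (1 - η * u) ≤ E * E⁻¹ := mul_le_mul_of_nonneg_left this hEpos.le
        _ = 1 := mul_inv_cancel₀ hEpos.ne'
    have hkey : (2 * x - 1) - η * u * (2 - x) ≤ x ^ 2 * (1 - η * u) := by
      have hx : x = 1 - u := by rw [hu]; ring
      nlinarith [sq_nonneg u, mul_nonneg (mul_nonneg hη (sq_nonneg u)) (by linarith : (0:ℝ) ≤ 2 + x)]
    calc E * ((2 * x - 1) - η * u * (2 - x)) ≤ E * (x ^ 2 * (1 - η * u)) :=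
          mul_le_mul_of_nonneg_left hkey hEpos.le
      _ = x ^ 2 * (E * (1 - η * u)) := by ring
      _ ≤ x ^ 2 * 1 := mul_le_mul_of_nonneg_left hEt (sq_nonneg x)
      _ = x ^ 2 := mul_one _

/-- `P(V) ≥ 0` on the compression branch `0 < V ≤ V₀` for the Vinet form (`B₀ ≥ 0`).
[cite: CohenGulserenHemley2000, eq. (4) (elementary consequence)] -/
theorem vinetPressure_nonneg {V₀ B₀ V : ℝ} (hV₀ : 0 < V₀) (hB₀ : 0 ≤ B₀) (hV : 0 < V)
    (hVV₀ : V ≤ V₀) (B₀' : ℝ) : 0 ≤ vinetPressure V₀ B₀ B₀' V := by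
  rw [vinetPressure_eq_shape]
  exact mul_nonneg (by positivity) (vinetShape_nonneg (vinetX_le_one hV₀ hV hVV₀) _)

/-- VINET (`B₀' ≥ 1`, `B₀ ≥ 0`): on the compression branch `0 < V ≤ V₀` the pressure is
differentiable with `K(V) = -V P'(V) ≤ B₀ + B₀' P(V)`.
[cite: CohenGulserenHemley2000, eq. (4) (elementary consequence of its `K = -V dP/dV`)] -/
theorem vinet_bulkModulus_le {V₀ B₀ B₀' V : ℝ} (hV₀ : 0 < V₀) (hB₀ : 0 ≤ B₀) (hB : 1 ≤ B₀')
    (hV : 0 < V) (hVV₀ : V ≤ V₀) :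
    ∃ P' : ℝ, HasDerivAt (vinetPressure V₀ B₀ B₀') P' V ∧
      -V * P' ≤ B₀ + B₀' * vinetPressure V₀ B₀ B₀' V := by
  obtain ⟨P', hP', hK⟩ := vinet_bulkModulus hV₀ hV B₀ B₀'
  refine ⟨P', hP', ?_⟩
  rw [hK]
  unfold vinetPressure
  set x := vinetX V₀ V with hx
  have hx0 : 0 < x := vinetX_pos hV₀ hV
  have hx1 : x ≤ 1 := vinetX_le_one hV₀ hV hVV₀
  have hx2 : 0 < x ^ 2 := by positivity
  have hη : 0 ≤ vinetEta B₀' := vinetEta_nonneg hB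
  have hcoef : 3 + 2 * vinetEta B₀' = 3 * B₀' := by unfold vinetEta; ring
  have h := mul_le_mul_of_nonneg_left (vinet_bulkModulusShape_le hη hx0 hx1) hB₀
  have lhs : B₀ / x ^ 2 * (1 + (vinetEta B₀' * x + 1) * (1 - x)) * Real.exp (vinetEta B₀' * (1 - x))
      = B₀ * (Real.exp (vinetEta B₀' * (1 - x)) * (1 + (vinetEta B₀' * x + 1) * (1 - x))) / x ^ 2 := by
    field_simp
  have rhs : B₀ + B₀' * (3 * B₀ * (1 - x) / x ^ 2 * Real.exp (vinetEta B₀' * (1 - x)))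
      = B₀ * (x ^ 2 + (3 + 2 * vinetEta B₀') * (1 - x) * Real.exp (vinetEta B₀' * (1 - x))) / x ^ 2 := by
    rw [hcoef]
    field_simp
  rw [lhs, rhs]
  exact div_le_div_of_nonneg_right h hx2.le

/-- THE VINET VOLUME IS BOUNDED BY THE MURNAGHAN VOLUME with the same `(V₀, B₀, B₀')`:
`V_Vinet(P) ≤ V₀ (1 + B₀' P/B₀)^{-1/B₀'}` for `P ≥ 0` (`V₀ > 0`, `B₀ > 0`, `B₀' ≥ 1`).
[cite: CohenGulserenHemley2000, eq. (4); Poirier1991, §4.2 eq. (4.7) (elementary consequence)] -/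
theorem vinetVolume_le_murnaghanVolume {V₀ B₀ B₀' P : ℝ} (hV₀ : 0 < V₀) (hB₀ : 0 < B₀)
    (hB : 1 ≤ B₀') (hP : 0 ≤ P) :
    vinetVolume V₀ B₀ B₀' P ≤ murnaghanVolume V₀ B₀ B₀' P := by
  have hB' : 0 < B₀' := by linarith
  set W := vinetVolume V₀ B₀ B₀' P with hW
  have hWpos : 0 < W := vinetVolume_pos hV₀ hB₀ hB hP
  have hWle : W ≤ V₀ := vinetVolume_le_self hV₀.le hB₀ hB hP
  have hPW : vinetPressure V₀ B₀ B₀' W = P := vinetPressure_vinetVolume hV₀ hB₀ hB hP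
  have hex : ∀ v ∈ Icc W V₀, ∃ P' : ℝ, HasDerivAt (vinetPressure V₀ B₀ B₀') P' v ∧
      -v * P' ≤ B₀ + B₀' * vinetPressure V₀ B₀ B₀' v := fun v hv =>
    vinet_bulkModulus_le hV₀ hB₀.le hB (lt_of_lt_of_le hWpos hv.1) hv.2
  choose! D hD using hex
  have h := le_murnaghanVolume_of_bulkModulus_le (P := vinetPressure V₀ B₀ B₀')
    (P' := D) hWpos hWle hB₀ hB' (vinetPressure_self hV₀ B₀ B₀')
    (fun v hv => (hD v hv).1)
    (fun v hv => vinetPressure_nonneg hV₀ hB₀.le (lt_of_lt_of_le hWpos hv.1) hv.2 B₀')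
    (fun v hv => (hD v hv).2)
  rwa [hPW] at h

/-- MURNAGHAN-TYPE LOWER BOUND FOR THE VINET COMPRESSION (`B₀' ≥ 1`):
`P/(B₀ + B₀' P) ≤ ln(V₀/V_Vinet(P))` (`P ≥ 0`, `V₀ > 0`, `B₀ > 0`) — with
`log_div_vinetVolume_le` the Vinet compression obeys the same two-sided bracket as Murnaghan's.
[cite: CohenGulserenHemley2000, eq. (4); Poirier1991, §4.2 eq. (4.7) (elementary consequence)] -/
theorem le_log_div_vinetVolume {V₀ B₀ B₀' P : ℝ} (hV₀ : 0 < V₀) (hB₀ : 0 < B₀) (hB : 1 ≤ B₀')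
    (hP : 0 ≤ P) : P / (B₀ + B₀' * P) ≤ Real.log (V₀ / vinetVolume V₀ B₀ B₀' P) := by
  have hB' : 0 < B₀' := by linarith
  have hWpos : 0 < vinetVolume V₀ B₀ B₀' P := vinetVolume_pos hV₀ hB₀ hB hP
  have hy : 0 < 1 + B₀' * P / B₀ := lt_of_lt_of_le one_pos (one_le_murnaghanBase hB₀ hB'.le hP)
  have hM : 0 < murnaghanVolume V₀ B₀ B₀' P := murnaghanVolume_pos hV₀ hy
  have h1 := le_log_div_murnaghanVolume hV₀ hB₀ hB' hP
  have h2 : Real.log (V₀ / murnaghanVolume V₀ B₀ B₀' P) ≤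
      Real.log (V₀ / vinetVolume V₀ B₀ B₀' P) :=
    Real.log_le_log (div_pos hV₀ hM) (div_le_div_of_nonneg_left hV₀.le hWpos
      (vinetVolume_le_murnaghanVolume hV₀ hB₀ hB hP))
  exact h1.trans h2

/-- TWO-SIDED EXPONENTIAL BRACKET FOR THE VINET VOLUME (`B₀' ≥ 1`):
`V₀ e^{-P/B₀} ≤ V_Vinet(P) ≤ V_Murnaghan(P) ≤ V₀ e^{-P/(B₀ + B₀' P)}` (`P ≥ 0`, `V₀ > 0`, `B₀ > 0`).
[cite: CohenGulserenHemley2000, eq. (4); Poirier1991, §4.2 eq. (4.7) (elementary consequence)] -/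
theorem vinetVolume_mem_Icc_exp {V₀ B₀ B₀' P : ℝ} (hV₀ : 0 < V₀) (hB₀ : 0 < B₀) (hB : 1 ≤ B₀')
    (hP : 0 ≤ P) :
    vinetVolume V₀ B₀ B₀' P ∈
      Icc (V₀ * Real.exp (-(P / B₀))) (V₀ * Real.exp (-(P / (B₀ + B₀' * P)))) := by
  have hB' : 0 < B₀' := by linarith
  refine ⟨mul_exp_le_vinetVolume hV₀ hB₀ hB hP, ?_⟩
  exact (vinetVolume_le_murnaghanVolume hV₀ hB₀ hB hP).trans
    (murnaghanVolume_mem_Icc_exp hV₀ hB₀ hB' hP).2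

/-! ## The Murnaghan sandwich: `B₀ + β P ≤ K` from below

The comparison principle runs in both directions.  If the bulk modulus grows AT LEAST linearly in
the pressure along the compression path, `B₀ + β P(v) ≤ K(v)` (`β > 0`), then the solid is at most
as compressed as the Murnaghan law with slope `β`: `ln(V₀/V) ≤ (1/β) ln(1 + β P(V)/B₀)`, i.e.
`V_Murnaghan(P; B₀, β) ≤ V`.  The printed forms obey such lower slopes GLOBALLY on the compression
branch with their large-compression limits: `β = 2/3` for the Vinet form (`B₀' ≥ 1`;
`K - (2/3)P = B₀ e^{η(1-x)} (1 + η(1-x))/x ≥ B₀`) and `β = 7/3` for the third-order Birch–Murnaghan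
form (`B₀' ≥ 4`; `K - (7/3)P = B₀ q⁵ (1 + 2cf + 2cf²) ≥ B₀`, `c = (3/2)(B₀'-4)`), so together with
the upper comparison (`K ≤ B₀ + B₀' P`) each printed law is SANDWICHED between two closed-form
Murnaghan laws with the same `B₀`:
`V_Murnaghan(P; B₀, 2/3) ≤ V_Vinet(P; B₀, B₀') ≤ V_Murnaghan(P; B₀, B₀')` and
`V_Murnaghan(P; B₀, 7/3) ≤ V_BM3(P; B₀, B₀') ≤ V_Murnaghan(P; B₀, B₀')`.
Elementary consequences of the printed laws (no new facts). -/

/-- REVERSE MURNAGHAN COMPARISON PRINCIPLE (form-independent): if `P(V₀) = 0`, `P ≥ 0` on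
`[V, V₀]` (`V > 0`) and the bulk modulus obeys `B₀ + β P(v) ≤ -v P'(v)` there (`B₀ > 0`, `β > 0`),
then `ln(V₀/V) ≤ (1/β) ln(1 + β P(V)/B₀)`.  Elementary integration of `K = -V dP/dV` against
Murnaghan's linear law. [cite: Poirier1991, §4.2 eqs. (4.4)–(4.7) (elementary consequence)] -/
theorem log_div_le_log_murnaghan_of_le_bulkModulus {P P' : ℝ → ℝ} {V₀ V B₀ β : ℝ} (hV : 0 < V)
    (hVV₀ : V ≤ V₀) (hB₀ : 0 < B₀) (hβ : 0 < β) (hP₀ : P V₀ = 0)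
    (hderiv : ∀ v ∈ Icc V V₀, HasDerivAt P (P' v) v) (hPnn : ∀ v ∈ Icc V V₀, 0 ≤ P v)
    (hK : ∀ v ∈ Icc V V₀, B₀ + β * P v ≤ -v * P' v) :
    Real.log (V₀ / V) ≤ 1 / β * Real.log (1 + β * P V / B₀) := by
  have hMpos : ∀ v ∈ Icc V V₀, 0 < B₀ + β * P v := fun v hv => by
    have := mul_nonneg hβ.le (hPnn v hv)
    linarith
  have hd : ∀ v ∈ Icc V V₀,
      HasDerivAt (fun w => Real.log w + 1 / β * Real.log (B₀ + β * P w))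
        (v⁻¹ + 1 / β * (β * P' v / (B₀ + β * P v))) v := fun v hv =>
    (Real.hasDerivAt_log (lt_of_lt_of_le hV hv.1).ne').add
      ((((hderiv v hv).const_mul β).const_add B₀).log (hMpos v hv).ne' |>.const_mul (1 / β))
  have hψ : AntitoneOn (fun w => Real.log w + 1 / β * Real.log (B₀ + β * P w)) (Icc V V₀) := by
    refine antitoneOn_of_deriv_nonpos (convex_Icc V V₀) ?_ ?_ ?_
    · exact fun v hv => (hd v hv).continuousAt.continuousWithinAt
    · exact fun v hv => (hd v (interior_subset hv)).differentiableAt.differentiableWithinAt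
    · intro v hv
      have hv' : v ∈ Icc V V₀ := interior_subset hv
      have hv0 : 0 < v := lt_of_lt_of_le hV hv'.1
      have hM := hMpos v hv'
      rw [(hd v hv').deriv]
      have heq : v⁻¹ + 1 / β * (β * P' v / (B₀ + β * P v)) =
          (B₀ + β * P v + v * P' v) / (v * (B₀ + β * P v)) := by
        field_simp
      rw [heq]
      exact div_nonpos_iff.mpr (Or.inr ⟨by linarith [hK v hv'], (mul_pos hv0 hM).le⟩)
  have h := hψ ⟨le_rfl, hVV₀⟩ ⟨hVV₀, le_rfl⟩ hVV₀
  have hV₀ : 0 < V₀ := lt_of_lt_of_le hV hVV₀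
  simp only [hP₀, mul_zero, add_zero] at h
  have hlog : Real.log (1 + β * P V / B₀) = Real.log (B₀ + β * P V) - Real.log B₀ := by
    rw [← Real.log_div (hMpos V ⟨le_rfl, hVV₀⟩).ne' hB₀.ne']
    congr 1
    field_simp
  rw [hlog, Real.log_div hV₀.ne' hV.ne']
  nlinarith [h, one_div_pos.mpr hβ]

/-- Under the hypotheses of the reverse principle the volume is bounded BELOW by the Murnaghan
volume of slope `β`: `V₀ (1 + β P(V)/B₀)^{-1/β} ≤ V`.
[cite: Poirier1991, §4.2 eq. (4.7) (elementary consequence)] -/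
theorem murnaghanVolume_le_of_le_bulkModulus {P P' : ℝ → ℝ} {V₀ V B₀ β : ℝ} (hV : 0 < V)
    (hVV₀ : V ≤ V₀) (hB₀ : 0 < B₀) (hβ : 0 < β) (hP₀ : P V₀ = 0)
    (hderiv : ∀ v ∈ Icc V V₀, HasDerivAt P (P' v) v) (hPnn : ∀ v ∈ Icc V V₀, 0 ≤ P v)
    (hK : ∀ v ∈ Icc V V₀, B₀ + β * P v ≤ -v * P' v) :
    murnaghanVolume V₀ B₀ β (P V) ≤ V := by
  have hV₀ : 0 < V₀ := lt_of_lt_of_le hV hVV₀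
  have hy : 0 < 1 + β * P V / B₀ :=
    lt_of_lt_of_le one_pos (one_le_murnaghanBase hB₀ hβ.le (hPnn V ⟨le_rfl, hVV₀⟩))
  have hVM : 0 < murnaghanVolume V₀ B₀ β (P V) := murnaghanVolume_pos hV₀ hy
  have h := log_div_le_log_murnaghan_of_le_bulkModulus hV hVV₀ hB₀ hβ hP₀ hderiv hPnn hK
  rw [← log_div_murnaghanVolume hV₀ hy,
    Real.log_le_log_iff (div_pos hV₀ hV) (div_pos hV₀ hVM)] at h
  exact (div_le_div_iff_of_pos_left hV₀ hV hVM).mp h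

/-- VINET: the bulk modulus grows at least with slope `2/3` in the pressure on the whole
compression branch — `x² + 2(1-x)E ≤ E [1 + (ηx+1)(1-x)]` for `0 < x ≤ 1`, `η ≥ 0`, `E = e^{η(1-x)}`
(the difference is `E x (1 + η(1-x)) - x² ≥ x - x² ≥ 0`), i.e. `B₀ + (2/3) P(V) ≤ K(V)`.
[cite: CohenGulserenHemley2000, eq. (4) (elementary consequence of its `K = -V dP/dV`)] -/
theorem vinet_le_bulkModulusShape {η x : ℝ} (hη : 0 ≤ η) (hx0 : 0 < x) (hx1 : x ≤ 1) :
    x ^ 2 + 2 * (1 - x) * Real.exp (η * (1 - x)) ≤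
      Real.exp (η * (1 - x)) * (1 + (η * x + 1) * (1 - x)) := by
  have hE : 1 ≤ Real.exp (η * (1 - x)) := by
    have := Real.add_one_le_exp (η * (1 - x))
    nlinarith [mul_nonneg hη (sub_nonneg.mpr hx1)]
  have hx : x ^ 2 ≤ x := by nlinarith
  nlinarith [mul_nonneg (mul_nonneg hη hx0.le) (sub_nonneg.mpr hx1),
    mul_le_mul_of_nonneg_left hE hx0.le,
    mul_nonneg (sub_nonneg.mpr hE) (mul_nonneg (mul_nonneg hη hx0.le) (sub_nonneg.mpr hx1))]

/-- VINET (`B₀' ≥ 1`, `B₀ ≥ 0`): on the compression branch `0 < V ≤ V₀` the pressure is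
differentiable with `B₀ + (2/3) P(V) ≤ K(V) = -V P'(V)`.
[cite: CohenGulserenHemley2000, eq. (4) (elementary consequence of its `K = -V dP/dV`)] -/
theorem vinet_le_bulkModulus {V₀ B₀ B₀' V : ℝ} (hV₀ : 0 < V₀) (hB₀ : 0 ≤ B₀) (hB : 1 ≤ B₀')
    (hV : 0 < V) (hVV₀ : V ≤ V₀) :
    ∃ P' : ℝ, HasDerivAt (vinetPressure V₀ B₀ B₀') P' V ∧
      B₀ + 2 / 3 * vinetPressure V₀ B₀ B₀' V ≤ -V * P' := by
  obtain ⟨P', hP', hK⟩ := vinet_bulkModulus hV₀ hV B₀ B₀'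
  refine ⟨P', hP', ?_⟩
  rw [hK]
  unfold vinetPressure
  set x := vinetX V₀ V with hx
  have hx0 : 0 < x := vinetX_pos hV₀ hV
  have hx1 : x ≤ 1 := vinetX_le_one hV₀ hV hVV₀
  have hx2 : 0 < x ^ 2 := by positivity
  have hη : 0 ≤ vinetEta B₀' := vinetEta_nonneg hB
  have h := mul_le_mul_of_nonneg_left (vinet_le_bulkModulusShape hη hx0 hx1) hB₀
  have lhs : B₀ + 2 / 3 * (3 * B₀ * (1 - x) / x ^ 2 * Real.exp (vinetEta B₀' * (1 - x)))
      = B₀ * (x ^ 2 + 2 * (1 - x) * Real.exp (vinetEta B₀' * (1 - x))) / x ^ 2 := by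
    field_simp
  have rhs : B₀ / x ^ 2 * (1 + (vinetEta B₀' * x + 1) * (1 - x)) * Real.exp (vinetEta B₀' * (1 - x))
      = B₀ * (Real.exp (vinetEta B₀' * (1 - x)) * (1 + (vinetEta B₀' * x + 1) * (1 - x))) / x ^ 2 := by
    field_simp
  rw [lhs, rhs]
  exact div_le_div_of_nonneg_right h hx2.le

/-- THE VINET VOLUME IS BOUNDED BELOW BY THE MURNAGHAN VOLUME OF SLOPE `2/3` (same `V₀`, `B₀`):
`V₀ (1 + (2/3) P/B₀)^{-3/2} ≤ V_Vinet(P)` for `P ≥ 0` (`V₀ > 0`, `B₀ > 0`, `B₀' ≥ 1`).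
[cite: CohenGulserenHemley2000, eq. (4); Poirier1991, §4.2 eq. (4.7) (elementary consequence)] -/
theorem murnaghanVolume_twoThirds_le_vinetVolume {V₀ B₀ B₀' P : ℝ} (hV₀ : 0 < V₀) (hB₀ : 0 < B₀)
    (hB : 1 ≤ B₀') (hP : 0 ≤ P) :
    murnaghanVolume V₀ B₀ (2 / 3) P ≤ vinetVolume V₀ B₀ B₀' P := by
  set W := vinetVolume V₀ B₀ B₀' P with hW
  have hWpos : 0 < W := vinetVolume_pos hV₀ hB₀ hB hP
  have hWle : W ≤ V₀ := vinetVolume_le_self hV₀.le hB₀ hB hP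
  have hPW : vinetPressure V₀ B₀ B₀' W = P := vinetPressure_vinetVolume hV₀ hB₀ hB hP
  have hex : ∀ v ∈ Icc W V₀, ∃ P' : ℝ, HasDerivAt (vinetPressure V₀ B₀ B₀') P' v ∧
      B₀ + 2 / 3 * vinetPressure V₀ B₀ B₀' v ≤ -v * P' := fun v hv =>
    vinet_le_bulkModulus hV₀ hB₀.le hB (lt_of_lt_of_le hWpos hv.1) hv.2
  choose! D hD using hex
  have h := murnaghanVolume_le_of_le_bulkModulus (P := vinetPressure V₀ B₀ B₀') (P' := D)
    hWpos hWle hB₀ (by norm_num : (0:ℝ) < 2 / 3) (vinetPressure_self hV₀ B₀ B₀')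
    (fun v hv => (hD v hv).1)
    (fun v hv => vinetPressure_nonneg hV₀ hB₀.le (lt_of_lt_of_le hWpos hv.1) hv.2 B₀')
    (fun v hv => (hD v hv).2)
  rwa [hPW] at h

/-- BIRCH–MURNAGHAN (`B₀' ≥ 4`): the bulk modulus grows at least with slope `7/3` in the pressure
on the whole compression branch — in the variable `q ≥ 1`, `f = (q²-1)/2`:
`1 + (7/3) h(q) ≤ q⁵ [1 + 7f + (3/2)(B₀'-4) f (2 + 9f)]`
(the difference is `q⁵ (1 + 2cf + 2cf²) - 1 ≥ 0`, `c = (3/2)(B₀'-4)`), i.e. `B₀ + (7/3) P(V) ≤ K(V)`.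
[cite: Poirier1991, §4.3.2 eqs. (4.35)–(4.37) (elementary consequence)] -/
theorem birchMurnaghan3_le_bulkModulusShape {B₀' q : ℝ} (hB : 4 ≤ B₀') (hq : 1 ≤ q) :
    1 + 7 / 3 * birchMurnaghan3Shape B₀' q ≤
      q ^ 5 * (1 + 7 * ((q ^ 2 - 1) / 2) +
        3 / 2 * (B₀' - 4) * ((q ^ 2 - 1) / 2) * (2 + 9 * ((q ^ 2 - 1) / 2))) := by
  unfold birchMurnaghan3Shape
  have hq5 : 1 ≤ q ^ 5 := one_le_pow₀ hq
  have hq2 : 0 ≤ q ^ 2 - 1 := by nlinarith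
  have h1 : 0 ≤ (B₀' - 4) * (q ^ 2 - 1) * q ^ 5 :=
    mul_nonneg (mul_nonneg (sub_nonneg.mpr hB) hq2) (by positivity)
  have h2 : 0 ≤ (B₀' - 4) * (q ^ 2 - 1) ^ 2 * q ^ 5 :=
    mul_nonneg (mul_nonneg (sub_nonneg.mpr hB) (sq_nonneg _)) (by positivity)
  nlinarith [h1, h2]

/-- THIRD-ORDER BIRCH–MURNAGHAN (`B₀' ≥ 4`, `B₀ ≥ 0`): on the compression branch `0 < V ≤ V₀` the
pressure is differentiable with `B₀ + (7/3) P(V) ≤ K(V) = -V P'(V)`.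
[cite: Poirier1991, §4.3.2 eqs. (4.35)–(4.37) (elementary consequence)] -/
theorem birchMurnaghan3_le_bulkModulus {V₀ B₀ B₀' V : ℝ} (hV₀ : 0 < V₀) (hB₀ : 0 ≤ B₀)
    (hB : 4 ≤ B₀') (hV : 0 < V) (hVV₀ : V ≤ V₀) :
    ∃ P' : ℝ, HasDerivAt (birchMurnaghan3Pressure V₀ B₀ B₀') P' V ∧
      B₀ + 7 / 3 * birchMurnaghan3Pressure V₀ B₀ B₀' V ≤ -V * P' := by
  obtain ⟨P', hP', hK⟩ := birchMurnaghan3_bulkModulus hV₀ hV B₀ B₀'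
  refine ⟨P', hP', ?_⟩
  rw [hK, eulerianStrain_eq_cubeRootRatio hV₀ hV, birchMurnaghan3Pressure_eq_shape hV₀ hV]
  have h := mul_le_mul_of_nonneg_left
    (birchMurnaghan3_le_bulkModulusShape hB (one_le_cubeRootRatio hV hVV₀)) hB₀
  have heq : B₀ * (1 + 7 / 3 * birchMurnaghan3Shape B₀' (cubeRootRatio V₀ V)) =
      B₀ + 7 / 3 * (B₀ * birchMurnaghan3Shape B₀' (cubeRootRatio V₀ V)) := by ring
  rw [← heq]
  simpa [mul_assoc] using h

/-- THE BIRCH–MURNAGHAN VOLUME IS BOUNDED BELOW BY THE MURNAGHAN VOLUME OF SLOPE `7/3`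
(same `V₀`, `B₀`): `V₀ (1 + (7/3) P/B₀)^{-3/7} ≤ V_BM3(P)` for `P ≥ 0` (`V₀ > 0`, `B₀ > 0`,
`B₀' ≥ 4`). [cite: Poirier1991, §4.2 eq. (4.7), §4.3.3 eq. (4.42) (elementary consequence)] -/
theorem murnaghanVolume_sevenThirds_le_birchMurnaghan3Volume {V₀ B₀ B₀' P : ℝ} (hV₀ : 0 < V₀)
    (hB₀ : 0 < B₀) (hB : 4 ≤ B₀') (hP : 0 ≤ P) :
    murnaghanVolume V₀ B₀ (7 / 3) P ≤ birchMurnaghan3Volume V₀ B₀ B₀' P := by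
  set W := birchMurnaghan3Volume V₀ B₀ B₀' P with hW
  have hWpos : 0 < W := birchMurnaghan3Volume_pos hV₀ hB₀ hB hP
  have hWle : W ≤ V₀ := birchMurnaghan3Volume_le_self hV₀.le hB₀ hB hP
  have hPW : birchMurnaghan3Pressure V₀ B₀ B₀' W = P :=
    birchMurnaghan3Pressure_birchMurnaghan3Volume hV₀ hB₀ hB hP
  have hex : ∀ v ∈ Icc W V₀, ∃ P' : ℝ, HasDerivAt (birchMurnaghan3Pressure V₀ B₀ B₀') P' v ∧
      B₀ + 7 / 3 * birchMurnaghan3Pressure V₀ B₀ B₀' v ≤ -v * P' := fun v hv =>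
    birchMurnaghan3_le_bulkModulus hV₀ hB₀.le hB (lt_of_lt_of_le hWpos hv.1) hv.2
  choose! D hD using hex
  have h := murnaghanVolume_le_of_le_bulkModulus (P := birchMurnaghan3Pressure V₀ B₀ B₀')
    (P' := D) hWpos hWle hB₀ (by norm_num : (0:ℝ) < 7 / 3) (birchMurnaghan3Pressure_self hV₀ B₀ B₀')
    (fun v hv => (hD v hv).1)
    (fun v hv => birchMurnaghan3Pressure_nonneg hV₀ hB₀.le hB (lt_of_lt_of_le hWpos hv.1) hv.2)
    (fun v hv => (hD v hv).2)
  rwa [hPW] at h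

/-- THE MURNAGHAN SANDWICH FOR THE VINET LAW (`B₀' ≥ 1`):
`V_Murnaghan(P; B₀, 2/3) ≤ V_Vinet(P; B₀, B₀') ≤ V_Murnaghan(P; B₀, B₀')` for `P ≥ 0`.
[cite: CohenGulserenHemley2000, eq. (4); Poirier1991, §4.2 eq. (4.7) (elementary consequence)] -/
theorem vinetVolume_mem_Icc_murnaghanVolume {V₀ B₀ B₀' P : ℝ} (hV₀ : 0 < V₀) (hB₀ : 0 < B₀)
    (hB : 1 ≤ B₀') (hP : 0 ≤ P) :
    vinetVolume V₀ B₀ B₀' P ∈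
      Icc (murnaghanVolume V₀ B₀ (2 / 3) P) (murnaghanVolume V₀ B₀ B₀' P) :=
  ⟨murnaghanVolume_twoThirds_le_vinetVolume hV₀ hB₀ hB hP,
    vinetVolume_le_murnaghanVolume hV₀ hB₀ hB hP⟩

/-- THE MURNAGHAN SANDWICH FOR THE THIRD-ORDER BIRCH–MURNAGHAN LAW (`B₀' ≥ 4`):
`V_Murnaghan(P; B₀, 7/3) ≤ V_BM3(P; B₀, B₀') ≤ V_Murnaghan(P; B₀, B₀')` for `P ≥ 0`.
[cite: Poirier1991, §4.2 eq. (4.7), §4.3.3 eq. (4.42) (elementary consequence)] -/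
theorem birchMurnaghan3Volume_mem_Icc_murnaghanVolume {V₀ B₀ B₀' P : ℝ} (hV₀ : 0 < V₀)
    (hB₀ : 0 < B₀) (hB : 4 ≤ B₀') (hP : 0 ≤ P) :
    birchMurnaghan3Volume V₀ B₀ B₀' P ∈
      Icc (murnaghanVolume V₀ B₀ (7 / 3) P) (murnaghanVolume V₀ B₀ B₀' P) :=
  ⟨murnaghanVolume_sevenThirds_le_birchMurnaghan3Volume hV₀ hB₀ hB hP,
    birchMurnaghan3Volume_le_murnaghanVolume hV₀ hB₀ hB hP⟩

end

end Literature.MathematicalPhysics.StatisticalMechanics
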